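import Literature.NumberTheory.Transcendental.KaehlerHodge
import Literature.NumberTheory.Transcendental.ComplexFormsProofs
import Literature.NumberTheory.Transcendental.KaehlerHodgeStarTypeProofs
import Literature.NumberTheory.Transcendental.DolbeaultProofs
import Literature.Geometry.Kaehler.ManifoldFormsChart
import Literature.Geometry.Kaehler.HodgeStarProofs
import Literature.Geometry.Kaehler.HodgeStarFrame
import Literature.Geometry.Kaehler.RiemannianHodgeStarStarProofs
import Literature.Geometry.Kaehler.HodgeStarOfVolumeFormProofs
import Literature.Geometry.Kaehler.KaehlerProofs
import Mathlib.LinearAlgebra.Complex.FiniteDimensional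
import HarnessLib

/-!
# The named fact `dolbeaultHarmonicForms_conj` is false as stated (`ℂ²` with the chart `(z, w) ↦ (z, w̄)` at the origin)

Theorems-only companion (plus the definitions of one explicit model) of
`Literature/NumberTheory/Transcendental/KaehlerHodge.lean` (C12), of `KaehlerHodgeConjProofs.lean`
(the conjugation plumbing `Δ_∂̄ ᾱ = \overline{Δ_∂ α}`) and of `KaehlerHodgeConjFact.lean` (the
corrected statement `dolbeaultHarmonicForms_conj_of_isManifold_complex`).

`KaehlerHodge.lean` records "on a Kähler manifold complex conjugation interchanges `ℋ^{p,q}_∂̄` and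
`ℋ^{q,p}_∂̄`" (Voisin (2002), §6.1.2, Thm. 6.7, Cor. 6.10, §6.1.3, Cor. 6.12; Huybrechts (2005), §3.2,
Remarks 3.2.7 (i)) as the named fact
`Literature.NumberTheory.Transcendental.dolbeaultHarmonicForms_conj g o`, a `def … : Prop` written in
`section Kaehler` after `variable … [IsManifold 𝓘(ℂ, E) ω M] [IsManifold 𝓘(ℝ, E) ∞ M] (g …) (o …)`.

**Finding.** The body mentions `g` (hence the real tangent bundle and `[IsManifold 𝓘(ℝ, E) ∞ M]`) but
nothing in it uses the *complex*-manifold instance, so Lean did not abstract it: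
`#check @dolbeaultHarmonicForms_conj` lists
`{E} [NormedAddCommGroup E] [NormedSpace ℂ E] {M} [TopologicalSpace M] [ChartedSpace E M] {k m : ℕ}
[FiniteDimensional ℂ E] {n : ℕ} [Fact (finrank ℝ E = n)] [IsManifold 𝓘(ℝ, E) ∞ M] (g) (o)` as its only
binders — exactly the defect recorded for its siblings `cHodgeLaplacian_eq_two_smul_dolbeaultLaplacian`
(*Correction* note in `KaehlerHodge.lean`), `dolbeaultLaplacian_eq_delLaplacian`
(`KaehlerHodgeDelLaplacianFact.lean`), `typeComponent_mem_charmonicForms`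
(`KaehlerHodgeTypeCounterexample.lean`) and `isDolbeaultHarmonic_iff`
(`KaehlerHodgeDolbeaultHarmonicCounterexample.lean`). The fact is therefore stated for every *real*
`C^∞` manifold whose charts take values in `E`, with the "complex structure" `tangentJ` — multiplication
by `i` in the coordinates of the *preferred chart* `chartAt x` — which is not a tensor unless the
transition maps are holomorphic; with it `IsOfType`, `typeComponent`, `∂̄`, `∂̄*` and `Δ_∂̄` are read
chart-wise. This file proves that in that generality the fact is **false**
(`OriginSwapAtlas.not_dolbeaultHarmonicForms_conj_Mc2`), records the universal closure over exactly
the binders the fact elaborates with (`not_dolbeaultHarmonicForms_conj`; also the fourfold-level closure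
`not_forall_dolbeaultHarmonicForms_conj`), and hence that no closed proof
`dolbeaultHarmonicForms_conj_holds` can exist. The intended statement carries
`[IsManifold 𝓘(ℂ, E) ω M]` as a binder of the `def` itself: it is the corrected named fact
`Literature.NumberTheory.Transcendental.dolbeaultHarmonicForms_conj_of_isManifold_complex`
(`KaehlerHodgeConjFact.lean`), which follows from the Kähler identity `Δ_∂̄ = Δ_∂` (proved glue there)
and is not yet discharged.

Why complex dimension two: `Δ_∂ α = \overline{Δ_∂̄ ᾱ}` holds for every metric
(`dolbeaultLaplacian_conj`), so the fact fails exactly when, on smooth forms of pure type, the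
conditions `Δ_∂̄ α = 0` and `Δ_∂ α = 0` differ *and* the difference survives passing to the `ℂ`-span
of the (junk-nonlinear) carrier of `ℋ^{q,p}`. In complex dimension `1` a chart-wise `J` compatible
with a Hermitian metric is `±i`, types merely swap, and on pure types the two Laplacians vanish
together (no counterexample on the `{id, conj}`-rigged plane or torus of the sibling files); on `ℂ²`
the chart `(z, w) ↦ (z, w̄)` rigs the complex structure to `J' = (i, -i)` at one point, whose
`(1,0)`-covectors `dz, dw̄` and `(0,1)`-covectors `dz̄, dw` mix the two types asymmetrically.

## The counterexample (`namespace OriginSwapAtlas`)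

* `Mc2` is a copy of `ℂ × ℂ` (a one-field structure, so that no instance of the model space applies
  to it) with the real-smooth, non-holomorphic atlas `{id, A}`, `A(z, w) = (z, w̄)` (an isometric,
  orientation-reversing real-linear involution), and the discontinuous choice of preferred chart
  `chartAt 0 = A`, `chartAt x = id` (`x ≠ 0`); a real `C^∞` manifold (`IsManifold 𝓘(ℝ, ℂ × ℂ) ∞ Mc2`)
  all of whose tangent coordinate changes are the constant maps `τ ∈ {id, A}` (`coordChange_eq`).
* `metric`: the flat metric `Re ⟪·, ·⟫ + Re ⟪·, ·⟫` on every `T_x Mc2 = ℂ × ℂ`, constant in every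
  trivialisation (`τ` is orthogonal), hence `C^∞`; Hermitian (`isHermitian`); its Kähler form is
  `dx∧dy + du∧dv` in chart coordinates, with chart representative at `x₀` equal to `dx∧dy ± du∧dv`
  according as the charts at the point and at `x₀` agree (`inChart_kaehlerForm`): locally constant
  off the origin, discontinuous at the origin, where `mextDeriv` (Mathlib's `fderivWithin` of a
  non-differentiable function) returns the junk value `0` — so `IsKaehler` holds (`isKaehler`).
* `orient`: the standard orientation read in the preferred charts (reversed at the origin); the
  volume form has the constant representatives `± det4`, so the hypothesis `ho` holds
  (`isSmoothForm_riemannianVolumeForm`). Degrees: `k = 1`, `m = 3`, `n = 4`, `(p, q) = (1, 0)`.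
* **Chart formula for `⋆`.** With `S := hodgeStarFrame k fr det4 h`, the inner-product-free frame
  star of the model space (`Literature.Geometry.Kaehler.hodgeStarFrame`, here for the standard real
  frame `fr = (e₁, e₂, e₃, e₄) = ((1,0), (i,0), (0,1), (0,i))` and the explicit determinant `det4`),
  and `Sc` its `ℂ`-linear extension, the representative of `⋆β` in *every* chart is
  `sgn(x₀) · Sc (representative of β)` (`inChart_hodgeStar`, `inChart_cHodgeStar`; proof: compute `⋆`
  in the orthonormal frame adapted to the transition, `hodgeStar_eq_hodgeStarFrame`, and pull back,
  `hodgeStarFrame_compContinuousLinearMap`). All further computations are done with chart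
  representatives on the model space; the values used are `⋆⋆ = ±1` (`S_S`, from
  `MForm.hodgeStar_hodgeStar_holds`), `⋆det4 = 1` (`S_det4`, from `hodgeStar_volumeFormL_holds`),
  `⋆` on `1`-forms `= ι_{ℓ♯} det4` (`S_one_apply`), the type-preservation of `⋆`
  (`IsOfType.cHodgeStar`, `hasWeight_Sc`) and the anti-equivariance `Sc (η ∘ A) = -(Sc η) ∘ A`
  (`Sc_comp_A`).
* (i) **`α = (z̄ + 1) w̄ dz` is `∂̄`-harmonic of type `(1,0)`** (`isDolbeaultHarmonic_alpha`). It is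
  smooth, of type `(1,0)` at every point (it vanishes at the origin), and `∂̄*α = -⋆∂⋆α = 0` exactly
  (`⋆α` has type `(2,1)`, and the `(3,1)`-part of a `4`-form on `ℂ²` vanishes,
  `typeComponent_eq_zero_of_finrank_lt_or_lt`). Further `∂̄α = (dα)^{1,1}` equals
  `-w̄ dz∧dz̄ - (z̄+1) dz∧dw̄` off the origin but is `0` at the origin (`dα(0) = -dz∧dw` in the chart
  `A`, of type `(2,0)`): the chart representative at the origin of `ρ = ⋆∂̄α` jumps there
  (`R₀_zero_ne`), so `dρ (origin) = 0` is Mathlib's junk value (`mextDeriv_rhoF_origin`), while off the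
  origin `dρ` is the constant `-dw̄ ∧ Sc(dz∧dz̄) - dz̄ ∧ Sc(dz∧dw̄)` of type `(1,2)`, killed by the
  projection to type `(2,1)` inside `∂` (`dolbeault_rhoF`). Hence `Δ_∂̄ α = ∂̄0 + ∂̄*∂̄α = 0`.
* (ii) **A linear functional vanishing on `ℋ^{0,1}`.** For *every* smooth `β` of type `(0,1)` the
  identity-chart representative is `c dz̄ + e dw̄` with `C^∞` coefficients (`rep_eq`; off `0` by the
  weight, at `0` by continuity), `⋆β` is smooth with representative `c T₁ + e T₂` (`T₁ = Sc dz̄`,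
  `T₂ = Sc dw̄`), `∂⋆β = d⋆β` (types), and no junk value can enter `∂̄*β`: its representative at the
  origin is the function `-2Φ ∘ A` with `2Φ = (c_x - i c_y) + (e_u - i e_v)` (`inChart_psi_origin`).
  Consequently the `dw̄`-coefficient of `∂̄∂̄*β (origin)` is `-½ L(β)` with
  `L(β) = Φ'(0) e₃ - i Φ'(0) e₄` (`first_term`), whereas `∂̄*∂̄β (origin)` is a multiple of `dz̄`
  whichever value — junk `0` or honest — `mextDeriv (⋆∂̄β) (origin)` takes
  (`fderiv_eq_zero_or_eq_of_eq_off_zero`, `second_term`: the honest value is `ℓ ∧ Sc(dz̄∧dw)` whose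
  `(1,2)`-part is a multiple of `dw̄∧dz̄∧dw = -2 Sc dz̄`). So `L` vanishes on every `∂̄`-harmonic
  `(0,1)`-form (`Lfun_eq_zero_of_isDolbeaultHarmonic`); it is additive and homogeneous on smooth forms,
  hence vanishes on the `ℂ`-span `ℋ^{0,1}` (`dolbeaultHarmonicForms_le_Tsub`).
* (iii) `L(ᾱ) = L((z + 1) w dz̄) = 4` (`Lfun_alphaBar`), so `ᾱ ∈ \overline{ℋ^{1,0}} ∖ ℋ^{0,1}` and
  `(ℋ^{1,0}).map conjₛₗ ≠ ℋ^{0,1}` (`not_dolbeaultHarmonicForms_conj_Mc2`).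

Every identity used holds at every point; the only junk values are the ones the fact itself feeds
into `IsKaehler` and `Δ_∂̄` (it quantifies over this real-smooth, non-holomorphic atlas). Two
technical notes for maintainers: (1) chart representatives live on the model space with its product
norm while values of forms live on `TangentSpace` with the Riemannian-bundle instances; the two types
are definitionally but not reducibly equal, so all computations go through representatives and the
bundle side is only touched inside `inChart_hodgeStar`; (2) on `ℂ`-valued real-linear maps and forms
the generic `zero_smul`/`neg_smul`/`add_smul` do not fire under `rw`/`simp` (instance path), whence the
restated `czero_smul`, `cneg_smul`, ….

## References

* C. Voisin, *Hodge Theory and Complex Algebraic Geometry I*, Cambridge Studies in Advanced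
  Mathematics 76 (2002), §6.1.2 Thm. 6.7, Cor. 6.10; §6.1.3 Cor. 6.12 — the intended (Kähler, hence
  complex) statement. [cite: Voisin2002, §6.1.2 Thm. 6.7, Cor. 6.10]
* D. Huybrechts, *Complex Geometry. An Introduction*, Universitext (2005), §3.2, Remarks 3.2.7 (i);
  §1.2, Lemma 1.2.24 (`⋆` and types). [cite: Huybrechts2005, §3.2 Rem. 3.2.7 (i)]
* F. W. Warner, *Foundations of Differentiable Manifolds and Lie Groups*, GTM 94 (1983), Ch. 2,
  Ex. 13 (the frame formula for `⋆`).
-/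

noncomputable section

open scoped Manifold ContDiff Topology ComplexConjugate InnerProductSpace
open Bundle Module Set Filter ContinuousAlternatingMap
open Literature.Geometry.Kaehler

namespace Literature.NumberTheory.Transcendental


namespace OriginSwapAtlas

/-- The model vector space `ℂ² = ℂ × ℂ` (real dimension `4`), with its product norm. [folklore] -/
abbrev V : Type := ℂ × ℂ

/-- the chart map `A (z, w) = (z, w̄)` as a real continuous linear equivalence [folklore] -/
def A : V ≃L[ℝ] V := (ContinuousLinearEquiv.refl ℝ ℂ).prodCongr Complex.conjCLE

/-- Evaluation formula (`A_apply`); pointwise computation in the model. [folklore] -/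
@[simp] theorem A_apply (v : V) : A v = (v.1, conj v.2) := rfl

/-- Auxiliary lemma `A_A` for the `ℂ²` counterexample (see the module docstring). [folklore] -/
@[simp] theorem A_A (v : V) : A (A v) = v := by
  ext <;> simp

/-- Evaluation formula (`A_symm_apply`); pointwise computation in the model. [folklore] -/
theorem A_symm_apply (v : V) : A.symm v = A v := by
  rw [ContinuousLinearEquiv.symm_apply_eq, A_A]

/-- A copy of `ℂ²` (one-field structure, so that no instance of `ℂ × ℂ` applies to it); it carries the
rigged atlas `{id, A}`. [folklore] -/
@[ext]
structure Mc2 : Type where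
  /-- the underlying point of `ℂ²` -/
  toV : V

namespace Mc2

/-- The topology of `ℂ²` transported to `Mc2`. [folklore] -/
instance : TopologicalSpace Mc2 := TopologicalSpace.induced Mc2.toV inferInstance

/-- The tautological homeomorphism `Mc2 ≃ₜ ℂ × ℂ`. [folklore] -/
def toVHomeo : Mc2 ≃ₜ V where
  toFun := Mc2.toV
  invFun := Mc2.mk
  left_inv _ := rfl
  right_inv _ := rfl
  continuous_toFun := continuous_induced_dom
  continuous_invFun := continuous_induced_rng.2 continuous_id

/-- Evaluation formula (`toVHomeo_apply`); pointwise computation in the model. [folklore] -/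
@[simp] theorem toVHomeo_apply (x : Mc2) : toVHomeo x = x.toV := rfl
/-- Evaluation formula (`toVHomeo_symm_apply`); pointwise computation in the model. [folklore] -/
@[simp] theorem toVHomeo_symm_apply (z : V) : toVHomeo.symm z = ⟨z⟩ := rfl

/-- The exceptional point (the origin), where the preferred chart is `A`. [folklore] -/
def origin : Mc2 := ⟨0⟩

/-- Auxiliary lemma `origin_toV` for the `ℂ²` counterexample (see the module docstring). [folklore] -/
@[simp] theorem origin_toV : origin.toV = 0 := rfl

/-- The identity chart of `Mc2`. [folklore] -/
def idChart : OpenPartialHomeomorph Mc2 V := toVHomeo.toOpenPartialHomeomorph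

/-- The chart `A (z, w) = (z, w̄)` of `Mc2`. [folklore] -/
def swapChart : OpenPartialHomeomorph Mc2 V :=
  (toVHomeo.trans A.toHomeomorph).toOpenPartialHomeomorph

/-- Evaluation formula (`idChart_apply`); pointwise computation in the model. [folklore] -/
@[simp] theorem idChart_apply (x : Mc2) : idChart x = x.toV := rfl
/-- Evaluation formula (`idChart_symm_apply`); pointwise computation in the model. [folklore] -/
@[simp] theorem idChart_symm_apply (z : V) : idChart.symm z = ⟨z⟩ := rfl
/-- Evaluation formula (`swapChart_apply`); pointwise computation in the model. [folklore] -/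
@[simp] theorem swapChart_apply (x : Mc2) : swapChart x = A x.toV := rfl
/-- Evaluation formula (`swapChart_symm_apply`); pointwise computation in the model. [folklore] -/
@[simp] theorem swapChart_symm_apply (z : V) : swapChart.symm z = ⟨A z⟩ := by
  change (⟨A.toHomeomorph.symm z⟩ : Mc2) = ⟨A z⟩
  congr 1
/-- Auxiliary lemma `idChart_source` for the `ℂ²` counterexample (see the module docstring).
[folklore] -/
@[simp] theorem idChart_source : idChart.source = univ := rfl
/-- Auxiliary lemma `swapChart_source` for the `ℂ²` counterexample (see the module docstring).
[folklore] -/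
@[simp] theorem swapChart_source : swapChart.source = univ := rfl
/-- Auxiliary lemma `idChart_target` for the `ℂ²` counterexample (see the module docstring).
[folklore] -/
@[simp] theorem idChart_target : idChart.target = univ := rfl
/-- Auxiliary lemma `swapChart_target` for the `ℂ²` counterexample (see the module docstring).
[folklore] -/
@[simp] theorem swapChart_target : swapChart.target = univ := rfl

/-- Auxiliary lemma `idChart_ne_swapChart` for the `ℂ²` counterexample (see the module docstring).
[folklore] -/
theorem idChart_ne_swapChart : idChart ≠ swapChart := by
  intro h
  have := congrArg (fun e : OpenPartialHomeomorph Mc2 V ↦ e ⟨(0, Complex.I)⟩) h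
  simp [Complex.conj_I, eq_neg_iff_add_eq_zero, Prod.ext_iff] at this

/-- **The rigged atlas**: charts `{id, A}`, preferred chart `A` at the origin and `id` elsewhere.
[folklore] -/
instance : ChartedSpace V Mc2 where
  atlas := {idChart, swapChart}
  chartAt x := if x.toV = 0 then swapChart else idChart
  mem_chart_source x := by split_ifs <;> simp
  chart_mem_atlas x := by split_ifs <;> simp

/-- Atlas bookkeeping `chartAt_eq` for `Mc2` (charts `{id, A}`, transitions `τ`). [folklore] -/
theorem chartAt_eq (x : Mc2) : chartAt V x = if x.toV = 0 then swapChart else idChart := rfl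

/-- Atlas bookkeeping `chartAt_of_eq` for `Mc2` (charts `{id, A}`, transitions `τ`). [folklore] -/
theorem chartAt_of_eq {x : Mc2} (hx : x.toV = 0) : chartAt V x = swapChart := by
  rw [chartAt_eq, if_pos hx]

/-- Atlas bookkeeping `chartAt_of_ne` for `Mc2` (charts `{id, A}`, transitions `τ`). [folklore] -/
theorem chartAt_of_ne {x : Mc2} (hx : x.toV ≠ 0) : chartAt V x = idChart := by
  rw [chartAt_eq, if_neg hx]

/-- Atlas bookkeeping `chartAt_source` for `Mc2` (charts `{id, A}`, transitions `τ`). [folklore] -/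
@[simp] theorem chartAt_source (x : Mc2) : (chartAt V x).source = univ := by
  rw [chartAt_eq]; split_ifs <;> rfl

/-- Atlas bookkeeping `chartAt_target` for `Mc2` (charts `{id, A}`, transitions `τ`). [folklore] -/
@[simp] theorem chartAt_target (x : Mc2) : (chartAt V x).target = univ := by
  rw [chartAt_eq]; split_ifs <;> rfl

/-- Atlas bookkeeping `extChartAt_source'` for `Mc2` (charts `{id, A}`, transitions `τ`). [folklore] -/
@[simp] theorem extChartAt_source' (x : Mc2) : (extChartAt 𝓘(ℝ, V) x).source = univ := by
  rw [extChartAt_source, chartAt_source]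

/-- Atlas bookkeeping `extChartAt_target'` for `Mc2` (charts `{id, A}`, transitions `τ`). [folklore] -/
@[simp] theorem extChartAt_target' (x : Mc2) : (extChartAt 𝓘(ℝ, V) x).target = univ := by
  rw [extChartAt_target, chartAt_target]; simp

/-- transition linear map between preferred charts [folklore] -/
def τ (x x' : Mc2) : V →L[ℝ] V :=
  if (x.toV = 0 ↔ x'.toV = 0) then ContinuousLinearMap.id ℝ V else (A : V →L[ℝ] V)

/-- Evaluation formula (`τ_τ_apply`); pointwise computation in the model. [folklore] -/
@[simp] theorem τ_τ_apply (x x' : Mc2) (v : V) : τ x x' (τ x x' v) = v := by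
  unfold τ; split_ifs <;> simp

/-- Atlas bookkeeping `extChartAt_comp_extChartAt_symm` for `Mc2` (charts `{id, A}`, transitions `τ`).
[folklore] -/
theorem extChartAt_comp_extChartAt_symm (x x' : Mc2) :
    (extChartAt 𝓘(ℝ, V) x' : Mc2 → V) ∘ (extChartAt 𝓘(ℝ, V) x).symm = τ x x' := by
  funext z
  by_cases hx : x.toV = 0 <;> by_cases hx' : x'.toV = 0 <;>
    simp [τ, hx, hx', chartAt_of_eq, chartAt_of_ne]

/-- `Mc2` is a real `C^∞` manifold (the transition maps `id`, `A` are real-linear). [folklore] -/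
instance : IsManifold 𝓘(ℝ, V) ∞ Mc2 := by
  refine isManifold_of_contDiffOn _ _ _ fun e e' he he' ↦ ?_
  have key : ∀ e e' : OpenPartialHomeomorph Mc2 V, e ∈ atlas V Mc2 → e' ∈ atlas V Mc2 →
      ∃ L : V →L[ℝ] V, (𝓘(ℝ, V) ∘ (e.symm ≫ₕ e') ∘ 𝓘(ℝ, V).symm : V → V) = L := by
    rintro e e' (rfl | rfl) (rfl | rfl)
    · exact ⟨ContinuousLinearMap.id ℝ V, by funext z; simp⟩
    · exact ⟨A, by funext z; simp⟩
    · exact ⟨A, by funext z; simp⟩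
    · exact ⟨ContinuousLinearMap.id ℝ V, by funext z; simp⟩
  obtain ⟨L, hL⟩ := key e e' he he'
  rw [hL]
  exact L.contDiff.contDiffOn

/-- Atlas bookkeeping `coordChange_eq` for `Mc2` (charts `{id, A}`, transitions `τ`). [folklore] -/
theorem coordChange_eq (x x' z : Mc2) :
    (tangentBundleCore 𝓘(ℝ, V) Mc2).coordChange (achart V x) (achart V x') z = τ x x' := by
  rw [tangentBundleCore_coordChange_achart, extChartAt_comp_extChartAt_symm,
    ModelWithCorners.Boundaryless.range_eq_univ, fderivWithin_univ, ContinuousLinearMap.fderiv]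

/-- Atlas bookkeeping `tangentCoordChange_eq` for `Mc2` (charts `{id, A}`, transitions `τ`).
[folklore] -/
theorem tangentCoordChange_eq (x x' z : Mc2) : tangentCoordChange 𝓘(ℝ, V) x x' z = τ x x' :=
  coordChange_eq x x' z

/-- Chart-representative computation `inChart_eq` for the rigged atlas `{id, A}`. [folklore] -/
theorem inChart_eq {F : Type*} [NormedAddCommGroup F] [NormedSpace ℝ F] {k : ℕ}
    (α : MForm 𝓘(ℝ, V) Mc2 F k) (x₀ : Mc2) (y : V) :
    α.inChart x₀ y = (α ((extChartAt 𝓘(ℝ, V) x₀).symm y)).compContinuousLinearMap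
      (τ x₀ ((extChartAt 𝓘(ℝ, V) x₀).symm y)) := by
  rw [α.inChart_eq_of_mem_target (by simp), tangentCoordChange_eq]

/-- Evaluation formula (`extChartAt_symm_apply_toV`); pointwise computation in the model. [folklore] -/
@[simp] theorem extChartAt_symm_apply_toV (x₀ : Mc2) (y : V) :
    ((extChartAt 𝓘(ℝ, V) x₀).symm y).toV = if x₀.toV = 0 then A y else y := by
  by_cases hx : x₀.toV = 0 <;> simp [hx, chartAt_of_eq, chartAt_of_ne]

/-- Evaluation formula (`extChartAt_apply`); pointwise computation in the model. [folklore] -/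
@[simp] theorem extChartAt_apply (x₀ x : Mc2) :
    extChartAt 𝓘(ℝ, V) x₀ x = if x₀.toV = 0 then A x.toV else x.toV := by
  by_cases hx : x₀.toV = 0 <;> simp [hx, chartAt_of_eq, chartAt_of_ne]

/-- Evaluation formula (`chartAt_symm_apply_toV`); pointwise computation in the model. [folklore] -/
@[simp] theorem chartAt_symm_apply_toV (x₀ : Mc2) (y : V) :
    ((chartAt V x₀).symm y).toV = if x₀.toV = 0 then A y else y := by
  by_cases hx : x₀.toV = 0 <;> simp [hx, chartAt_of_eq, chartAt_of_ne]

/-- Evaluation formula (`chartAt_apply'`); pointwise computation in the model. [folklore] -/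
@[simp] theorem chartAt_apply' (x₀ x : Mc2) :
    chartAt V x₀ x = if x₀.toV = 0 then A x.toV else x.toV := by
  by_cases hx : x₀.toV = 0 <;> simp [hx, chartAt_of_eq, chartAt_of_ne]

end Mc2

end OriginSwapAtlas

namespace OriginSwapAtlas
open Mc2

/-- `A` is orthogonal for the sum inner product [folklore] -/
def ip (v w : V) : ℝ := ⟪v.1, w.1⟫_ℝ + ⟪v.2, w.2⟫_ℝ

/-- Auxiliary lemma `ip_A_A` for the `ℂ²` counterexample (see the module docstring). [folklore] -/
theorem ip_A_A (v w : V) : ip (A v) (A w) = ip v w := by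
  simp only [ip, A_apply]
  have h : ⟪conj v.2, conj w.2⟫_ℝ = ⟪v.2, w.2⟫_ℝ := Complex.conjLIE.inner_map_map v.2 w.2
  rw [h]

/-- Auxiliary lemma `ip_τ_τ` for the `ℂ²` counterexample (see the module docstring). [folklore] -/
theorem ip_τ_τ (x x' : Mc2) (v w : V) : ip (τ x x' v) (τ x x' w) = ip v w := by
  unfold τ; split_ifs
  · rfl
  · exact ip_A_A v w

/-- the bilinear form as a CLM [folklore] -/
def ipL : V →L[ℝ] V →L[ℝ] ℝ :=
  (innerSL ℝ (E := ℂ)).bilinearComp ((ContinuousLinearMap.fst ℂ ℂ ℂ).restrictScalars ℝ)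
      ((ContinuousLinearMap.fst ℂ ℂ ℂ).restrictScalars ℝ) +
    (innerSL ℝ (E := ℂ)).bilinearComp ((ContinuousLinearMap.snd ℂ ℂ ℂ).restrictScalars ℝ)
      ((ContinuousLinearMap.snd ℂ ℂ ℂ).restrictScalars ℝ)

/-- Evaluation formula (`ipL_apply`); pointwise computation in the model. [folklore] -/
@[simp] theorem ipL_apply (v w : V) : ipL v w = ip v w := by
  simp [ipL, ip]

/-- Auxiliary lemma `ip_comm` for the `ℂ²` counterexample (see the module docstring). [folklore] -/
theorem ip_comm (v w : V) : ip v w = ip w v := by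
  simp only [ip, real_inner_comm v.1, real_inner_comm v.2]

/-- Auxiliary lemma `ip_self_eq` for the `ℂ²` counterexample (see the module docstring). [folklore] -/
theorem ip_self_eq (v : V) : ip v v = ‖v.1‖ ^ 2 + ‖v.2‖ ^ 2 := by
  simp only [ip, real_inner_self_eq_norm_sq]

/-- Auxiliary lemma `ip_self_pos` for the `ℂ²` counterexample (see the module docstring). [folklore] -/
theorem ip_self_pos {v : V} (hv : v ≠ 0) : 0 < ip v v := by
  rw [ip_self_eq]
  rcases eq_or_ne v.1 0 with h | h
  · have h2 : v.2 ≠ 0 := fun h2 ↦ hv (Prod.ext h h2)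
    have : 0 < ‖v.2‖ := norm_pos_iff.2 h2
    positivity
  · have : 0 < ‖v.1‖ := norm_pos_iff.2 h
    positivity

/-- Auxiliary lemma `norm_sq_le_ip_self` for the `ℂ²` counterexample (see the module docstring).
[folklore] -/
theorem norm_sq_le_ip_self (v : V) : ‖v‖ ^ 2 ≤ ip v v := by
  rw [ip_self_eq, Prod.norm_def]
  rcases le_total ‖v.1‖ ‖v.2‖ with h | h
  · rw [max_eq_right h]; nlinarith [norm_nonneg v.1]
  · rw [max_eq_left h]; nlinarith [norm_nonneg v.2]

set_option backward.isDefEq.respectTransparency false in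
/-- the flat metric on `Mc2` [folklore] -/
def metric : ContMDiffRiemannianMetric 𝓘(ℝ, V) ∞ V (fun x : Mc2 ↦ TangentSpace 𝓘(ℝ, V) x) where
  inner _ := ipL
  symm _ v w := by
    change ipL v w = ipL w v
    rw [ipL_apply, ipL_apply, ip_comm]
  pos _ v hv := by
    change 0 < ipL v v
    rw [ipL_apply]
    exact ip_self_pos hv
  isVonNBounded _ := by
    change Bornology.IsVonNBounded ℝ {v : V | ipL v v < 1}
    refine (NormedSpace.isVonNBounded_ball ℝ V 1).subset fun v hv ↦ ?_
    simp only [Set.mem_setOf_eq, ipL_apply] at hv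
    rw [Metric.mem_ball, dist_zero_right]
    have h := norm_sq_le_ip_self v
    nlinarith [norm_nonneg v]
  contMDiff := by
    intro x₀
    rw [contMDiffAt_section]
    convert! contMDiffAt_const (c := ipL)
    rename_i x
    refine ContinuousLinearMap.ext fun v ↦ ContinuousLinearMap.ext fun w ↦ ?_
    rw [trivializationAt_bilinForm_apply₂,
      TangentBundle.symmL_trivializationAt_eq_core (by simp : x ∈ (chartAt V x₀).source),
      coordChange_eq]
    change ipL (τ x₀ x v) (τ x₀ x w) = ipL v w
    rw [ipL_apply, ipL_apply, ip_τ_τ]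

/-- The flat metric as a `RiemannianBundle` structure (a reducible `def`, used as a *local* instance;
it is the instance `⟨g.toRiemannianMetric⟩` installed by the fact under refutation). [folklore] -/
@[reducible]
def bundle : RiemannianBundle (fun x : Mc2 ↦ TangentSpace 𝓘(ℝ, V) x) := ⟨metric.toRiemannianMetric⟩

/-- `dim_ℝ ℂ² = 4`, as the `Fact` instance the fact under refutation consumes. [folklore] -/
instance fact_finrank : Fact (finrank ℝ V = 4) :=
  ⟨by rw [Module.finrank_prod, Complex.finrank_real_complex]⟩

section WithMetric

attribute [local instance] bundle

/-- Auxiliary lemma `inner_eq` for the `ℂ²` counterexample (see the module docstring). [folklore] -/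
theorem inner_eq (x : Mc2) (u v : TangentSpace 𝓘(ℝ, V) x) :
    ⟪u, v⟫_ℝ = ip u v := by
  change ipL u v = _
  exact ipL_apply u v

/-- Auxiliary lemma `ip_eq_coord` for the `ℂ²` counterexample (see the module docstring). [folklore] -/
theorem ip_eq_coord (u v : V) :
    ip u v = u.1.re * v.1.re + u.1.im * v.1.im + u.2.re * v.2.re + u.2.im * v.2.im := by
  simp only [ip, Complex.inner, Complex.mul_re, Complex.conj_re, Complex.conj_im]
  ring

end WithMetric

end OriginSwapAtlas

namespace OriginSwapAtlas
open Mc2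

/-! ### explicit forms on the model space (subset of T1) -/

/-- The wedge product `ℓ ∧ η` of a real covector with a real `n`-covector, normalised as Mathlib's
`extDeriv` (`alternatizeUncurryFin (ℓ ⊗ η)`), so that `d (f • η) = df ∧ η` definitionally.
[folklore] -/
def wedge1r {n : ℕ} (ℓ : V →L[ℝ] ℝ) (η : V [⋀^Fin n]→L[ℝ] ℝ) : V [⋀^Fin (n + 1)]→L[ℝ] ℝ :=
  alternatizeUncurryFin (ℓ.smulRight η)

/-- Evaluation formula (`wedge1r_apply`); pointwise computation in the model. [folklore] -/
theorem wedge1r_apply {n : ℕ} (ℓ : V →L[ℝ] ℝ) (η : V [⋀^Fin n]→L[ℝ] ℝ) (v : Fin (n + 1) → V) :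
    wedge1r ℓ η v = ∑ i : Fin (n + 1), (-1) ^ (i : ℕ) • (ℓ (v i) * η (i.removeNth v)) := by
  simp [wedge1r, alternatizeUncurryFin_apply, ContinuousLinearMap.smulRight_apply, smul_eq_mul]

/-- The real coordinate functional `x = Re z` of `ℂ²`. [folklore] -/
def xL : V →L[ℝ] ℝ := Complex.reCLM.comp ((ContinuousLinearMap.fst ℂ ℂ ℂ).restrictScalars ℝ)
/-- The real coordinate functional `y = Im z`. [folklore] -/
def yL : V →L[ℝ] ℝ := Complex.imCLM.comp ((ContinuousLinearMap.fst ℂ ℂ ℂ).restrictScalars ℝ)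
/-- The real coordinate functional `u = Re w`. [folklore] -/
def uL : V →L[ℝ] ℝ := Complex.reCLM.comp ((ContinuousLinearMap.snd ℂ ℂ ℂ).restrictScalars ℝ)
/-- The real coordinate functional `v = Im w`. [folklore] -/
def vL : V →L[ℝ] ℝ := Complex.imCLM.comp ((ContinuousLinearMap.snd ℂ ℂ ℂ).restrictScalars ℝ)

/-- Evaluation formula (`xL_apply`); pointwise computation in the model. [folklore] -/
@[simp] theorem xL_apply (v : V) : xL v = v.1.re := rfl
/-- Evaluation formula (`yL_apply`); pointwise computation in the model. [folklore] -/
@[simp] theorem yL_apply (v : V) : yL v = v.1.im := rfl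
/-- Evaluation formula (`uL_apply`); pointwise computation in the model. [folklore] -/
@[simp] theorem uL_apply (v : V) : uL v = v.2.re := rfl
/-- Evaluation formula (`vL_apply`); pointwise computation in the model. [folklore] -/
@[simp] theorem vL_apply (v : V) : vL v = v.2.im := rfl

/-- A real covector as a real `1`-form. [folklore] -/
def form1r (ℓ : V →L[ℝ] ℝ) : V [⋀^Fin 1]→L[ℝ] ℝ := ofSubsingleton ℝ V ℝ (0 : Fin 1) ℓ

/-- Evaluation formula (`form1r_apply`); pointwise computation in the model. [folklore] -/
@[simp] theorem form1r_apply (ℓ : V →L[ℝ] ℝ) (v : Fin 1 → V) : form1r ℓ v = ℓ (v 0) := by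
  simp [form1r]

/-- Evaluation formula (`wedge1r_form1r_apply`); pointwise computation in the model. [folklore] -/
theorem wedge1r_form1r_apply (ℓ ℓ' : V →L[ℝ] ℝ) (v : Fin 2 → V) :
    wedge1r ℓ (form1r ℓ') v = ℓ (v 0) * ℓ' (v 1) - ℓ (v 1) * ℓ' (v 0) := by
  rw [wedge1r_apply, Fin.sum_univ_two]
  have h0 : (Fin.removeNth 0 v : Fin 1 → V) = ![v 1] := by
    funext i; fin_cases i; rfl
  have h1 : (Fin.removeNth 1 v : Fin 1 → V) = ![v 0] := by
    funext i; fin_cases i; rfl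
  rw [h0, h1]
  simp
  ring

/-- Evaluation formula (`wedge1r_two_apply`); pointwise computation in the model. [folklore] -/
theorem wedge1r_two_apply (ℓ : V →L[ℝ] ℝ) (η : V [⋀^Fin 2]→L[ℝ] ℝ) (v : Fin 3 → V) :
    wedge1r ℓ η v = ℓ (v 0) * η ![v 1, v 2] - ℓ (v 1) * η ![v 0, v 2] + ℓ (v 2) * η ![v 0, v 1] := by
  rw [wedge1r_apply, Fin.sum_univ_three]
  have h0 : (Fin.removeNth 0 v : Fin 2 → V) = ![v 1, v 2] := by
    funext i; fin_cases i <;> rfl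
  have h1 : (Fin.removeNth 1 v : Fin 2 → V) = ![v 0, v 2] := by
    funext i; fin_cases i <;> rfl
  have h2 : (Fin.removeNth 2 v : Fin 2 → V) = ![v 0, v 1] := by
    funext i; fin_cases i <;> rfl
  rw [h0, h1, h2]
  simp
  ring

/-- Evaluation formula (`wedge1r_three_apply`); pointwise computation in the model. [folklore] -/
theorem wedge1r_three_apply (ℓ : V →L[ℝ] ℝ) (η : V [⋀^Fin 3]→L[ℝ] ℝ) (v : Fin 4 → V) :
    wedge1r ℓ η v = ℓ (v 0) * η ![v 1, v 2, v 3] - ℓ (v 1) * η ![v 0, v 2, v 3]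
      + ℓ (v 2) * η ![v 0, v 1, v 3] - ℓ (v 3) * η ![v 0, v 1, v 2] := by
  rw [wedge1r_apply, Fin.sum_univ_four]
  have h0 : (Fin.removeNth 0 v : Fin 3 → V) = ![v 1, v 2, v 3] := by
    funext i; fin_cases i <;> rfl
  have h1 : (Fin.removeNth 1 v : Fin 3 → V) = ![v 0, v 2, v 3] := by
    funext i; fin_cases i <;> rfl
  have h2 : (Fin.removeNth 2 v : Fin 3 → V) = ![v 0, v 1, v 3] := by
    funext i; fin_cases i <;> rfl
  have h3 : (Fin.removeNth 3 v : Fin 3 → V) = ![v 0, v 1, v 2] := by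
    funext i; fin_cases i <;> rfl
  rw [h0, h1, h2, h3]
  simp
  ring

/-- The real `2`-form `dx ∧ dy`. [folklore] -/
def e12 : V [⋀^Fin 2]→L[ℝ] ℝ := wedge1r xL (form1r yL)
/-- The real `2`-form `du ∧ dv`. [folklore] -/
def e34 : V [⋀^Fin 2]→L[ℝ] ℝ := wedge1r uL (form1r vL)
/-- The real `3`-form `dy ∧ du ∧ dv`. [folklore] -/
def e234 : V [⋀^Fin 3]→L[ℝ] ℝ := wedge1r yL e34
/-- **The standard volume form** `det4 = dx ∧ dy ∧ du ∧ dv` of `ℂ² = ℝ⁴`, as an explicit continuous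
alternating map (it is the determinant in the frame `fr`, `det4_fr`, and the volume form of the
orientation family, `volumeForm_orient`). [folklore] -/
def det4 : V [⋀^Fin 4]→L[ℝ] ℝ := wedge1r xL e234

/-- Evaluation formula (`e12_apply`); pointwise computation in the model. [folklore] -/
@[simp] theorem e12_apply (v : Fin 2 → V) :
    e12 v = (v 0).1.re * (v 1).1.im - (v 1).1.re * (v 0).1.im := by
  simp [e12, wedge1r_form1r_apply, -form1r_apply]

/-- Evaluation formula (`e34_apply`); pointwise computation in the model. [folklore] -/
@[simp] theorem e34_apply (v : Fin 2 → V) :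
    e34 v = (v 0).2.re * (v 1).2.im - (v 1).2.re * (v 0).2.im := by
  simp [e34, wedge1r_form1r_apply, -form1r_apply]

/-- Evaluation formula (`e234_apply`); pointwise computation in the model. [folklore] -/
theorem e234_apply (v : Fin 3 → V) :
    e234 v = (v 0).1.im * ((v 1).2.re * (v 2).2.im - (v 2).2.re * (v 1).2.im)
      - (v 1).1.im * ((v 0).2.re * (v 2).2.im - (v 2).2.re * (v 0).2.im)
      + (v 2).1.im * ((v 0).2.re * (v 1).2.im - (v 1).2.re * (v 0).2.im) := by
  simp [e234, wedge1r_two_apply]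

/-- Evaluation formula (`det4_apply`); pointwise computation in the model. [folklore] -/
theorem det4_apply (v : Fin 4 → V) :
    det4 v = (v 0).1.re * e234 ![v 1, v 2, v 3] - (v 1).1.re * e234 ![v 0, v 2, v 3]
      + (v 2).1.re * e234 ![v 0, v 1, v 3] - (v 3).1.re * e234 ![v 0, v 1, v 2] := by
  simp [det4, wedge1r_three_apply]

/-- the standard real frame [folklore] -/
def e₁ : V := (1, 0)
/-- The frame vector `e₂ = (i, 0)`. [folklore] -/
def e₂ : V := (Complex.I, 0)
/-- The frame vector `e₃ = (0, 1)`. [folklore] -/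
def e₃ : V := (0, 1)
/-- The frame vector `e₄ = (0, i)`. [folklore] -/
def e₄ : V := (0, Complex.I)

/-- Auxiliary lemma `e₁_fst` for the `ℂ²` counterexample (see the module docstring). [folklore] -/
@[simp] theorem e₁_fst : e₁.1 = 1 := rfl
/-- Auxiliary lemma `e₁_snd` for the `ℂ²` counterexample (see the module docstring). [folklore] -/
@[simp] theorem e₁_snd : e₁.2 = 0 := rfl
/-- Auxiliary lemma `e₂_fst` for the `ℂ²` counterexample (see the module docstring). [folklore] -/
@[simp] theorem e₂_fst : e₂.1 = Complex.I := rfl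
/-- Auxiliary lemma `e₂_snd` for the `ℂ²` counterexample (see the module docstring). [folklore] -/
@[simp] theorem e₂_snd : e₂.2 = 0 := rfl
/-- Auxiliary lemma `e₃_fst` for the `ℂ²` counterexample (see the module docstring). [folklore] -/
@[simp] theorem e₃_fst : e₃.1 = 0 := rfl
/-- Auxiliary lemma `e₃_snd` for the `ℂ²` counterexample (see the module docstring). [folklore] -/
@[simp] theorem e₃_snd : e₃.2 = 1 := rfl
/-- Auxiliary lemma `e₄_fst` for the `ℂ²` counterexample (see the module docstring). [folklore] -/
@[simp] theorem e₄_fst : e₄.1 = 0 := rfl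
/-- Auxiliary lemma `e₄_snd` for the `ℂ²` counterexample (see the module docstring). [folklore] -/
@[simp] theorem e₄_snd : e₄.2 = Complex.I := rfl

/-- the frame as a function [folklore] -/
def fr : Fin 4 → V := ![e₁, e₂, e₃, e₄]

/-- Volume-form computation `det4_fr` in the model. [folklore] -/
theorem det4_fr : det4 fr = 1 := by
  simp [fr, det4_apply, e234_apply]

/-- Volume-form computation `det4_comp_A` in the model. [folklore] -/
theorem det4_comp_A (v : Fin 4 → V) : det4 (fun i ↦ A (v i)) = -det4 v := by
  simp [det4_apply, e234_apply]
  ring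

/-- coordinates: `v = re v.1 • e₁ + im v.1 • e₂ + re v.2 • e₃ + im v.2 • e₄` [folklore] -/
theorem decomp (v : V) : v = v.1.re • e₁ + v.1.im • e₂ + v.2.re • e₃ + v.2.im • e₄ := by
  ext <;> simp [e₁, e₂, e₃, e₄]

/-- Auxiliary lemma `linearIndependent_fr` for the `ℂ²` counterexample (see the module docstring).
[folklore] -/
theorem linearIndependent_fr : LinearIndependent ℝ fr := by
  rw [Fintype.linearIndependent_iff]
  intro g hg i
  rw [Fin.sum_univ_four] at hg
  simp only [fr, Matrix.cons_val_zero, Matrix.cons_val_one, Matrix.cons_val] at hg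
  have h1 := congrArg (fun v : V ↦ v.1.re) hg
  have h2 := congrArg (fun v : V ↦ v.1.im) hg
  have h3 := congrArg (fun v : V ↦ v.2.re) hg
  have h4 := congrArg (fun v : V ↦ v.2.im) hg
  simp [e₁, e₂, e₃, e₄] at h1 h2 h3 h4
  fin_cases i <;> assumption

section WithMetric

attribute [local instance] bundle

/-- the frame as a basis of the tangent space [folklore] -/
def basisT (x : Mc2) : Basis (Fin 4) ℝ (TangentSpace 𝓘(ℝ, V) x) :=
  basisOfLinearIndependentOfCardEqFinrank linearIndependent_fr
    (by rw [Fintype.card_fin]; exact (fact_finrank.out : finrank ℝ V = 4).symm)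

/-- Auxiliary lemma `coe_basisT` for the `ℂ²` counterexample (see the module docstring). [folklore] -/
@[simp] theorem coe_basisT (x : Mc2) : ⇑(basisT x) = fr :=
  coe_basisOfLinearIndependentOfCardEqFinrank _ _

/-- Auxiliary lemma `basisT_orthonormal` for the `ℂ²` counterexample (see the module docstring).
[folklore] -/
theorem basisT_orthonormal (x : Mc2) : Orthonormal ℝ (basisT x) := by
  rw [orthonormal_iff_ite]
  intro i j
  rw [inner_eq, ip_eq_coord, coe_basisT]
  fin_cases i <;> fin_cases j <;> simp [fr]

/-- The standard frame as an orthonormal basis of `T_x Mc2` for the flat metric. [folklore] -/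
def onBasis (x : Mc2) : OrthonormalBasis (Fin 4) ℝ (TangentSpace 𝓘(ℝ, V) x) :=
  (basisT x).toOrthonormalBasis (basisT_orthonormal x)

/-- Auxiliary lemma `toBasis_onBasis` for the `ℂ²` counterexample (see the module docstring).
[folklore] -/
theorem toBasis_onBasis (x : Mc2) : (onBasis x).toBasis = basisT x :=
  Basis.toBasis_toOrthonormalBasis _ _

/-- Auxiliary lemma `coe_onBasis` for the `ℂ²` counterexample (see the module docstring). [folklore] -/
@[simp] theorem coe_onBasis (x : Mc2) : ⇑(onBasis x) = fr := by
  rw [← OrthonormalBasis.coe_toBasis, toBasis_onBasis, coe_basisT]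

/-- The standard orientation of `T_x Mc2` (chart coordinates). [folklore] -/
def stdOrient (x : Mc2) : Orientation ℝ (TangentSpace 𝓘(ℝ, V) x) (Fin 4) := (basisT x).orientation

/-- **The orientation family**: the standard orientation of the chart coordinates off the origin, the
reversed one at the origin (where the chart is `A`) — i.e. the standard orientation of `ℂ²` read
in the preferred charts. [folklore] -/
def orient (x : Mc2) : Orientation ℝ (TangentSpace 𝓘(ℝ, V) x) (Fin 4) :=
  if x.toV = 0 then -stdOrient x else stdOrient x

/-- The sign `ε(x) = -1` at the origin, `+1` elsewhere. [folklore] -/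
def sgn (x : Mc2) : ℝ := if x.toV = 0 then -1 else 1

/-- Auxiliary lemma `basisT_det_eq` for the `ℂ²` counterexample (see the module docstring). [folklore] -/
theorem basisT_det_eq (x : Mc2) (v : Fin 4 → TangentSpace 𝓘(ℝ, V) x) :
    (basisT x).det v = det4 v := by
  set D : TangentSpace 𝓘(ℝ, V) x [⋀^Fin 4]→ₗ[ℝ] ℝ := det4.toAlternatingMap with hD
  have h := congrArg (fun f : TangentSpace 𝓘(ℝ, V) x [⋀^Fin 4]→ₗ[ℝ] ℝ ↦ f v)
    (AlternatingMap.eq_smul_basis_det (basisT x) D)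
  have h1 : D (basisT x) = 1 := by
    rw [hD, coe_basisT]
    exact det4_fr
  simp only [h1, one_smul] at h
  exact h.symm

/-- Volume-form computation `volumeForm_stdOrient` in the model. [folklore] -/
theorem volumeForm_stdOrient (x : Mc2) (v : Fin 4 → TangentSpace 𝓘(ℝ, V) x) :
    (stdOrient x).volumeForm v = det4 v := by
  have ho : (onBasis x).toBasis.orientation = stdOrient x := by rw [toBasis_onBasis]; rfl
  rw [Orientation.volumeForm_robust _ (onBasis x) ho, toBasis_onBasis, basisT_det_eq]

/-- Volume-form computation `volumeForm_orient` in the model. [folklore] -/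
theorem volumeForm_orient (x : Mc2) (v : Fin 4 → TangentSpace 𝓘(ℝ, V) x) :
    (orient x).volumeForm v = sgn x * det4 v := by
  unfold orient sgn
  split_ifs
  · rw [Orientation.volumeForm_neg_orientation, AlternatingMap.neg_apply, volumeForm_stdOrient]
    ring
  · rw [volumeForm_stdOrient]; ring

/-- Volume-form computation `volumeFormL_orient` in the model. [folklore] -/
theorem volumeFormL_orient (x : Mc2) : (orient x).volumeFormL = sgn x • det4 := by
  ext v
  rw [Orientation.volumeFormL_apply, volumeForm_orient]
  exact (smul_eq_mul (sgn x) (det4 v)).symm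

/-- Evaluation formula (`riemannianVolumeForm_apply'`); pointwise computation in the model. [folklore] -/
theorem riemannianVolumeForm_apply' (x : Mc2) (v : Fin 4 → TangentSpace 𝓘(ℝ, V) x) :
    riemannianVolumeForm orient x v = sgn x * det4 v := by
  rw [Literature.Geometry.Kaehler.riemannianVolumeForm_apply, Orientation.volumeFormL_apply,
    volumeForm_orient]

/-! ### chart representatives -/

/-- The sign of the transition `τ x x'` on the volume form: `+1` if the charts agree, `-1` otherwise.
[folklore] -/
def τsgn (x x' : Mc2) : ℝ := if (x.toV = 0 ↔ x'.toV = 0) then 1 else -1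

/-- Auxiliary lemma `sgn_mul_τsgn` for the `ℂ²` counterexample (see the module docstring). [folklore] -/
theorem sgn_mul_τsgn (x x' : Mc2) : sgn x' * τsgn x x' = sgn x := by
  unfold sgn τsgn
  by_cases hx : x.toV = 0 <;> by_cases hx' : x'.toV = 0 <;> simp [hx, hx']

/-- Volume-form computation `det4_comp_τ` in the model. [folklore] -/
theorem det4_comp_τ (x x' : Mc2) (v : Fin 4 → V) :
    det4 (fun i ↦ τ x x' (v i)) = τsgn x x' * det4 v := by
  unfold τ τsgn
  split_ifs
  · simp
  · rw [show (fun i ↦ (A : V →L[ℝ] V) (v i)) = fun i ↦ A (v i) from rfl, det4_comp_A]; ring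

/-- the transition typed into the tangent space [folklore] -/
def τT (x₀ z : Mc2) : V →L[ℝ] TangentSpace 𝓘(ℝ, V) z := τ x₀ z

/-- Evaluation formula (`inChart_apply'`); pointwise computation in the model. [folklore] -/
theorem inChart_apply' {F : Type*} [NormedAddCommGroup F] [NormedSpace ℝ F] {k : ℕ}
    (α : MForm 𝓘(ℝ, V) Mc2 F k) (x₀ : Mc2) (y : V) (v : Fin k → V) :
    α.inChart x₀ y v = α ((extChartAt 𝓘(ℝ, V) x₀).symm y)
      (fun i ↦ τT x₀ ((extChartAt 𝓘(ℝ, V) x₀).symm y) (v i)) := by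
  rw [inChart_eq, ContinuousAlternatingMap.compContinuousLinearMap_apply]
  rfl

/-- Atlas bookkeeping `τsgn_extChartAt_symm` for `Mc2` (charts `{id, A}`, transitions `τ`). [folklore] -/
theorem τsgn_extChartAt_symm (x₀ : Mc2) (y : V) :
    τsgn x₀ ((extChartAt 𝓘(ℝ, V) x₀).symm y) = if (x₀.toV = 0 ↔ y = 0) then 1 else -1 := by
  unfold τsgn
  by_cases hx : x₀.toV = 0
  · simp only [extChartAt_symm_apply_toV, hx, if_true, true_iff]
    have : A y = 0 ↔ y = 0 := A.map_eq_zero_iff (x := y)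
    simp only [this]
  · simp [hx, chartAt_of_ne]

/-- Chart-representative computation `inChart_riemannianVolumeForm` for the rigged atlas `{id, A}`.
[folklore] -/
theorem inChart_riemannianVolumeForm (x₀ : Mc2) (y : V) :
    (riemannianVolumeForm orient).inChart x₀ y = sgn x₀ • det4 := by
  ext v
  rw [inChart_apply', riemannianVolumeForm_apply', ContinuousAlternatingMap.smul_apply, smul_eq_mul]
  change sgn _ * det4 (fun i ↦ τ x₀ _ (v i)) = _
  rw [det4_comp_τ, ← mul_assoc, sgn_mul_τsgn]

/-- **The hypothesis `ho`**: the volume form of `(Mc2, g, o)` is smooth (its representatives are the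
constants `± det4`). [folklore] -/
theorem isSmoothForm_riemannianVolumeForm : IsSmoothForm (riemannianVolumeForm orient) := by
  intro x
  rw [funext (inChart_riemannianVolumeForm x)]
  exact contDiffWithinAt_const

/-- Hermitian [folklore] -/
theorem isHermitian : Bundle.RiemannianMetric.IsHermitian metric.toRiemannianMetric := by
  intro x v w
  change ipL (Complex.I • show V from v) (Complex.I • show V from w) = ipL (show V from v) (show V from w)
  rw [ipL_apply, ipL_apply, ip_eq_coord, ip_eq_coord]
  simp only [Prod.smul_fst, Prod.smul_snd, smul_eq_mul, Complex.mul_re, Complex.mul_im,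
    Complex.I_re, Complex.I_im]
  ring

/-- the instance form used by `KaehlerHodgeStarTypeProofs` [folklore] -/
theorem inner_tangentJ_tangentJ (x : Mc2) (v w : TangentSpace 𝓘(ℝ, V) x) :
    ⟪tangentJ V x v, tangentJ V x w⟫_ℝ = ⟪v, w⟫_ℝ :=
  isHermitian x v w

end WithMetric

end OriginSwapAtlas

namespace OriginSwapAtlas
open Mc2

/-! ### generic helpers -/

/-- Evaluation formula (`mextDeriv_apply_eq_zero`); pointwise computation in the model. [folklore] -/
theorem mextDeriv_apply_eq_zero {F : Type*} [NormedAddCommGroup F] [NormedSpace ℝ F] {k : ℕ}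
    {α : MForm 𝓘(ℝ, V) Mc2 F k} {x : Mc2}
    (h : fderivWithin ℝ (α.inChart x) (range 𝓘(ℝ, V)) (extChartAt 𝓘(ℝ, V) x x) = 0) :
    mextDeriv α x = 0 := by
  rw [mextDeriv, extDerivWithin, h]
  ext v
  simp [ContinuousAlternatingMap.alternatizeUncurryFin_apply]

/-- Auxiliary lemma `not_continuousAt_of_jump` for the `ℂ²` counterexample (see the module docstring).
[folklore] -/
theorem not_continuousAt_of_jump {X : Type*} [TopologicalSpace X] [T2Space X] {f : V → X}
    {a b : X} (hab : a ≠ b) (hf : ∀ y, f y = if y = 0 then a else b) : ¬ ContinuousAt f 0 := by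
  intro hc
  have h1 : Tendsto f (𝓝[≠] (0 : V)) (𝓝 a) := by
    have h0 : f 0 = a := by rw [hf, if_pos rfl]
    have := hc.tendsto.mono_left (nhdsWithin_le_nhds (s := {(0 : V)}ᶜ))
    rwa [h0] at this
  have h2 : Tendsto f (𝓝[≠] (0 : V)) (𝓝 b) := by
    refine (tendsto_const_nhds (x := b)).congr' ?_
    filter_upwards [self_mem_nhdsWithin] with y hy
    rw [hf, if_neg (by simpa using hy)]
  exact hab (tendsto_nhds_unique h1 h2)

/-- A function that agrees with a continuous function off `0` but differs from it at `0` is not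
continuous at `0`. [folklore] -/
theorem not_continuousAt_of_eq_off_zero {X : Type*} [TopologicalSpace X] [T2Space X] {f g : V → X}
    (hg : ContinuousAt g 0) (hfg : ∀ y, y ≠ 0 → f y = g y) (h0 : f 0 ≠ g 0) :
    ¬ ContinuousAt f 0 := by
  intro hc
  have h1 : Tendsto f (𝓝[≠] (0 : V)) (𝓝 (f 0)) :=
    hc.tendsto.mono_left (nhdsWithin_le_nhds (s := {(0 : V)}ᶜ))
  have h2 : Tendsto f (𝓝[≠] (0 : V)) (𝓝 (g 0)) := by
    refine (hg.tendsto.mono_left (nhdsWithin_le_nhds (s := {(0 : V)}ᶜ))).congr' ?_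
    filter_upwards [self_mem_nhdsWithin] with y hy
    exact (hfg y hy).symm
  exact h0 (tendsto_nhds_unique h1 h2)

/-- **Dichotomy for the junk derivative.** If `f` agrees with a differentiable `g` off `0`, then
the Fréchet derivative of `f` at `0` is either `0` (if `f` is not differentiable there) or that of
`g`. [folklore] -/
theorem fderiv_eq_zero_or_eq_of_eq_off_zero {X : Type*} [NormedAddCommGroup X] [NormedSpace ℝ X]
    {f g : V → X} (hg : DifferentiableAt ℝ g 0) (hfg : ∀ y, y ≠ 0 → f y = g y) :
    fderiv ℝ f 0 = 0 ∨ (f 0 = g 0 ∧ fderiv ℝ f 0 = fderiv ℝ g 0) := by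
  by_cases hd : DifferentiableAt ℝ f 0
  · right
    have h0 : f 0 = g 0 := by
      by_contra hne
      exact not_continuousAt_of_eq_off_zero hg.continuousAt hfg hne hd.continuousAt
    have hev : f =ᶠ[𝓝 0] g := Filter.Eventually.of_forall fun y ↦ by
      by_cases hy : y = 0
      · rw [hy]; exact h0
      · exact hfg y hy
    exact ⟨h0, hev.fderiv_eq⟩
  · left
    exact fderiv_zero_of_not_differentiableAt hd

section WithMetric

attribute [local instance] bundle

/-! ### the Kähler form -/

/-- Evaluation formula (`kaehlerForm_apply'`); pointwise computation in the model. [folklore] -/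
theorem kaehlerForm_apply' (x : Mc2) (v : Fin 2 → TangentSpace 𝓘(ℝ, V) x) :
    metric.toRiemannianMetric.kaehlerForm x v =
      (Prod.fst (v 0)).re * (Prod.fst (v 1)).im - (Prod.fst (v 1)).re * (Prod.fst (v 0)).im +
        ((Prod.snd (v 0)).re * (Prod.snd (v 1)).im - (Prod.snd (v 1)).re * (Prod.snd (v 0)).im) := by
  obtain ⟨a, b, rfl⟩ : ∃ a b : TangentSpace 𝓘(ℝ, V) x, v = ![a, b] :=
    ⟨v 0, v 1, by funext i; fin_cases i <;> rfl⟩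
  rw [Bundle.RiemannianMetric.kaehlerForm_apply_of_isHermitian _ isHermitian]
  simp only [Matrix.cons_val_zero, Matrix.cons_val_one, Matrix.cons_val_fin_one]
  change ipL (Complex.I • show V from a) (show V from b) = _
  rw [ipL_apply, ip_eq_coord]
  simp only [Prod.smul_fst, Prod.smul_snd, smul_eq_mul, Complex.mul_re, Complex.mul_im,
    Complex.I_re, Complex.I_im]
  ring

/-- Atlas bookkeeping `τT_fst` for `Mc2` (charts `{id, A}`, transitions `τ`). [folklore] -/
theorem τT_fst (x₀ z : Mc2) (w : V) : Prod.fst (τT x₀ z w) = w.1 := by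
  change (τ x₀ z w).1 = _
  unfold τ; split_ifs <;> simp

/-- Atlas bookkeeping `τT_snd_re` for `Mc2` (charts `{id, A}`, transitions `τ`). [folklore] -/
theorem τT_snd_re (x₀ z : Mc2) (w : V) : (Prod.snd (τT x₀ z w)).re = w.2.re := by
  change (τ x₀ z w).2.re = _
  unfold τ; split_ifs <;> simp

/-- Atlas bookkeeping `τT_snd_im` for `Mc2` (charts `{id, A}`, transitions `τ`). [folklore] -/
theorem τT_snd_im (x₀ z : Mc2) (w : V) : (Prod.snd (τT x₀ z w)).im = τsgn x₀ z * w.2.im := by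
  change (τ x₀ z w).2.im = _
  unfold τ τsgn; split_ifs <;> simp

/-- Chart-representative computation `inChart_kaehlerForm` for the rigged atlas `{id, A}`. [folklore] -/
theorem inChart_kaehlerForm (x₀ : Mc2) (y : V) :
    (metric.toRiemannianMetric.kaehlerForm).inChart x₀ y =
      e12 + (if (x₀.toV = 0 ↔ y = 0) then (1 : ℝ) else -1) • e34 := by
  ext v
  rw [inChart_apply', kaehlerForm_apply', ← τsgn_extChartAt_symm]
  simp only [τT_fst, τT_snd_re, τT_snd_im, ContinuousAlternatingMap.add_apply,
    ContinuousAlternatingMap.smul_apply, smul_eq_mul, e12_apply, e34_apply]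
  ring

/-- Auxiliary lemma `e12_add_e34_ne` for the `ℂ²` counterexample (see the module docstring).
[folklore] -/
theorem e12_add_e34_ne : e12 + (1 : ℝ) • e34 ≠ e12 + (-1 : ℝ) • e34 := by
  intro h
  have := congrArg (fun f : V [⋀^Fin 2]→L[ℝ] ℝ ↦ f ![e₃, e₄]) h
  simp only [ContinuousAlternatingMap.add_apply, ContinuousAlternatingMap.smul_apply, e12_apply,
    e34_apply, smul_eq_mul] at this
  norm_num at this

/-- the Kähler form is closed (junk at the origin) [folklore] -/
theorem isClosedForm_kaehlerForm : IsClosedForm metric.toRiemannianMetric.kaehlerForm := by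
  funext x₀
  rw [Pi.zero_apply]
  apply mextDeriv_apply_eq_zero
  rw [ModelWithCorners.Boundaryless.range_eq_univ, Mc2.extChartAt_apply]
  by_cases hx : x₀.toV = 0
  · rw [if_pos hx, hx, _root_.map_zero]
    apply fderivWithin_zero_of_not_differentiableWithinAt
    intro hd
    have hc : ContinuousAt (metric.toRiemannianMetric.kaehlerForm.inChart x₀) 0 := by
      simpa [continuousWithinAt_univ] using hd.continuousWithinAt
    refine not_continuousAt_of_jump e12_add_e34_ne (fun y ↦ ?_) hc
    rw [inChart_kaehlerForm]
    simp only [hx, true_iff]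
    split_ifs <;> rfl
  · rw [if_neg hx]
    have hev : metric.toRiemannianMetric.kaehlerForm.inChart x₀ =ᶠ[𝓝[univ] x₀.toV]
        fun _ ↦ e12 + (1 : ℝ) • e34 := by
      rw [nhdsWithin_univ]
      filter_upwards [isOpen_compl_singleton.mem_nhds (by simpa using hx)] with y hy
      rw [inChart_kaehlerForm]
      simp only [mem_compl_iff, mem_singleton_iff] at hy
      simp [hx, hy]
    rw [hev.fderivWithin_eq (by simp [inChart_kaehlerForm, hx]), fderivWithin_const_apply]

/-- **The flat metric of `Mc2` is Kähler** in the sense of `Bundle.RiemannianMetric.IsKaehler`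
(Hermitian, and its Kähler form is closed — at the origin by the junk value of `mextDeriv`).
[folklore] -/
theorem isKaehler : Bundle.RiemannianMetric.IsKaehler metric.toRiemannianMetric :=
  ⟨isHermitian, isClosedForm_kaehlerForm⟩

end WithMetric

end OriginSwapAtlas

namespace OriginSwapAtlas
open Mc2 Set.powersetCard

/-! ### the flat Hodge star of the model, inner-product free -/

/-- linearity of the frame star in the top form [folklore] -/
theorem hodgeStarFrame_smul_top {W : Type*} [NormedAddCommGroup W] [NormedSpace ℝ W] {n k m : ℕ}
    (c : Fin n → W) (Ω : W [⋀^Fin n]→L[ℝ] ℝ) (r : ℝ) (h : k + m = n) (β : W [⋀^Fin k]→L[ℝ] ℝ) :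
    hodgeStarFrame k c (r • Ω) h β = r • hodgeStarFrame k c Ω h β := by
  ext w
  rw [hodgeStarFrame_apply, ContinuousAlternatingMap.smul_apply, hodgeStarFrame_apply,
    Finset.smul_sum]
  refine Finset.sum_congr rfl fun s _ ↦ ?_
  rw [domDomCongr_smul, interiorProductMulti_smul, ContinuousAlternatingMap.smul_apply, smul_eq_mul,
    smul_eq_mul]
  ring

/-- the flat star of the model space (frame `fr`, volume `det4`) [folklore] -/
def S (k : ℕ) {m : ℕ} (h : k + m = 4) : (V [⋀^Fin k]→L[ℝ] ℝ) →ₗ[ℝ] (V [⋀^Fin m]→L[ℝ] ℝ) :=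
  hodgeStarFrame k fr det4 h

section WithMetric

attribute [local instance] bundle

/-- the frame transported by the transition map `τ x₀ z`, typed into the tangent space at `z`
[folklore] -/
def frτ (x₀ z : Mc2) : Fin 4 → TangentSpace 𝓘(ℝ, V) z := fun i ↦ τT x₀ z (fr i)

/-- Auxiliary lemma `linearIndependent_frτ` for the `ℂ²` counterexample (see the module docstring).
[folklore] -/
theorem linearIndependent_frτ (x₀ z : Mc2) : LinearIndependent ℝ (frτ x₀ z) := by
  rw [Fintype.linearIndependent_iff]
  intro g hg
  have hg' : (∑ i, g i • τ x₀ z (fr i) : V) = 0 := hg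
  have h1 := congrArg (τ x₀ z) hg'
  rw [_root_.map_sum, _root_.map_zero] at h1
  simp only [map_smul, τ_τ_apply] at h1
  exact (Fintype.linearIndependent_iff.1 linearIndependent_fr) g (by simpa [fr] using h1)

/-- The adapted frame as a real basis of `T_z Mc2`. [folklore] -/
def basisτ (x₀ z : Mc2) : Basis (Fin 4) ℝ (TangentSpace 𝓘(ℝ, V) z) :=
  basisOfLinearIndependentOfCardEqFinrank (linearIndependent_frτ x₀ z)
    (by rw [Fintype.card_fin]; exact (fact_finrank.out : finrank ℝ V = 4).symm)

/-- Auxiliary lemma `coe_basisτ` for the `ℂ²` counterexample (see the module docstring). [folklore] -/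
@[simp] theorem coe_basisτ (x₀ z : Mc2) : ⇑(basisτ x₀ z) = frτ x₀ z :=
  coe_basisOfLinearIndependentOfCardEqFinrank _ _

/-- Auxiliary lemma `basisτ_orthonormal` for the `ℂ²` counterexample (see the module docstring).
[folklore] -/
theorem basisτ_orthonormal (x₀ z : Mc2) : Orthonormal ℝ (basisτ x₀ z) := by
  rw [orthonormal_iff_ite]
  intro i j
  rw [inner_eq, coe_basisτ]
  change ip (τ x₀ z (fr i)) (τ x₀ z (fr j)) = _
  rw [ip_τ_τ, ip_eq_coord]
  fin_cases i <;> fin_cases j <;> simp [fr]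

/-- The adapted frame as an orthonormal basis of `T_z Mc2`. [folklore] -/
def onBasisτ (x₀ z : Mc2) : OrthonormalBasis (Fin 4) ℝ (TangentSpace 𝓘(ℝ, V) z) :=
  (basisτ x₀ z).toOrthonormalBasis (basisτ_orthonormal x₀ z)

/-- Auxiliary lemma `coe_onBasisτ` for the `ℂ²` counterexample (see the module docstring). [folklore] -/
theorem coe_onBasisτ (x₀ z : Mc2) : ⇑(onBasisτ x₀ z) = ⇑(τT x₀ z) ∘ fr := by
  rw [onBasisτ, ← OrthonormalBasis.coe_toBasis, Basis.toBasis_toOrthonormalBasis, coe_basisτ]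
  rfl

/-- Volume-form computation `volumeFormL_comp_τT` in the model. [folklore] -/
theorem volumeFormL_comp_τT (x₀ z : Mc2) :
    (orient z).volumeFormL.compContinuousLinearMap (τT x₀ z) = sgn x₀ • det4 := by
  ext v
  rw [ContinuousAlternatingMap.compContinuousLinearMap_apply, Orientation.volumeFormL_apply,
    volumeForm_orient, ContinuousAlternatingMap.smul_apply, smul_eq_mul]
  change sgn z * det4 (fun i ↦ τ x₀ z (v i)) = _
  rw [det4_comp_τ, ← mul_assoc, sgn_mul_τsgn]

/-- **Chart formula for the Hodge star of the model**: in every chart, the representative of `⋆α`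
is `± S` of the representative of `α`, where `S` is the inner-product-free frame star of the model
vector space (`hodgeStarFrame` for the frame `fr` and the top form `det4`). [folklore] -/
theorem inChart_hodgeStar {k m : ℕ} (h : k + m = 4) (α : MForm 𝓘(ℝ, V) Mc2 ℝ k) (x₀ : Mc2) (y : V) :
    (MForm.hodgeStar orient h α).inChart x₀ y = sgn x₀ • S k h (α.inChart x₀ y) := by
  rw [inChart_eq, inChart_eq, MForm.hodgeStar_apply]
  set z := (extChartAt 𝓘(ℝ, V) x₀).symm y
  rw [hodgeStar_eq_hodgeStarFrame (orient z) (onBasisτ x₀ z) h (α z), coe_onBasisτ]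
  change (hodgeStarFrame k (⇑(τT x₀ z) ∘ fr) (orient z).volumeFormL h (α z)).compContinuousLinearMap
    (τT x₀ z) = sgn x₀ • S k h ((α z).compContinuousLinearMap (τT x₀ z))
  rw [hodgeStarFrame_compContinuousLinearMap, volumeFormL_comp_τT, hodgeStarFrame_smul_top]
  rfl

end WithMetric

end OriginSwapAtlas

namespace OriginSwapAtlas
open Mc2 Set.powersetCard

/-! ### complex covectors on the model: re / im / ofReal, and `Sc` -/

/-- The real part of a complex covector of the model. [folklore] -/
abbrev reP {k : ℕ} (η : V [⋀^Fin k]→L[ℝ] ℂ) : V [⋀^Fin k]→L[ℝ] ℝ :=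
  Complex.reCLM.compContinuousAlternatingMap η
/-- The imaginary part of a complex covector of the model. [folklore] -/
abbrev imP {k : ℕ} (η : V [⋀^Fin k]→L[ℝ] ℂ) : V [⋀^Fin k]→L[ℝ] ℝ :=
  Complex.imCLM.compContinuousAlternatingMap η
/-- The complexification of a real covector of the model. [folklore] -/
abbrev ofR {k : ℕ} (γ : V [⋀^Fin k]→L[ℝ] ℝ) : V [⋀^Fin k]→L[ℝ] ℂ :=
  Complex.ofRealCLM.compContinuousAlternatingMap γ

/-- the `ℂ`-linear extension of `S` [folklore] -/
def Sc (k : ℕ) {m : ℕ} (h : k + m = 4) (η : V [⋀^Fin k]→L[ℝ] ℂ) : V [⋀^Fin m]→L[ℝ] ℂ :=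
  ofR (S k h (reP η)) + Complex.I • ofR (S k h (imP η))

/-- Evaluation formula (`Sc_apply`); pointwise computation in the model. [folklore] -/
theorem Sc_apply {k m : ℕ} (h : k + m = 4) (η : V [⋀^Fin k]→L[ℝ] ℂ) (w : Fin m → V) :
    Sc k h η w = (S k h (reP η) w : ℂ) + Complex.I * (S k h (imP η) w : ℂ) := by
  simp [Sc]

/-- Model Hodge-star computation `Sc_add`. [folklore] -/
theorem Sc_add {k m : ℕ} (h : k + m = 4) (η η' : V [⋀^Fin k]→L[ℝ] ℂ) :
    Sc k h (η + η') = Sc k h η + Sc k h η' := by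
  ext w
  simp only [Sc_apply, ContinuousAlternatingMap.add_apply]
  rw [show reP (η + η') = reP η + reP η' from by ext; simp,
    show imP (η + η') = imP η + imP η' from by ext; simp, map_add, map_add]
  simp only [ContinuousAlternatingMap.add_apply]
  push_cast
  ring

/-- Model Hodge-star computation `Sc_smul`. [folklore] -/
theorem Sc_smul {k m : ℕ} (h : k + m = 4) (c : ℂ) (η : V [⋀^Fin k]→L[ℝ] ℂ) :
    Sc k h (c • η) = c • Sc k h η := by
  ext w
  simp only [Sc_apply, ContinuousAlternatingMap.smul_apply, smul_eq_mul]
  rw [show reP (c • η) = c.re • reP η - c.im • imP η from by ext; simp [Complex.mul_re],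
    show imP (c • η) = c.re • imP η + c.im • reP η from by ext; simp [Complex.mul_im],
    map_sub, map_add, map_smul, map_smul, map_smul, map_smul]
  simp only [ContinuousAlternatingMap.sub_apply, ContinuousAlternatingMap.add_apply,
    ContinuousAlternatingMap.smul_apply, smul_eq_mul]
  apply Complex.ext <;> simp

/-- Model Hodge-star computation `Sc_zero`. [folklore] -/
theorem Sc_zero {k m : ℕ} (h : k + m = 4) : Sc k h (0 : V [⋀^Fin k]→L[ℝ] ℂ) = 0 := by
  ext w
  rw [Sc_apply, show reP (0 : V [⋀^Fin k]→L[ℝ] ℂ) = 0 from by ext; simp,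
    show imP (0 : V [⋀^Fin k]→L[ℝ] ℂ) = 0 from by ext; simp, _root_.map_zero]
  simp

/-- Model Hodge-star computation `Sc_ofR`. [folklore] -/
theorem Sc_ofR {k m : ℕ} (h : k + m = 4) (γ : V [⋀^Fin k]→L[ℝ] ℝ) :
    Sc k h (ofR γ) = ofR (S k h γ) := by
  ext w
  rw [Sc_apply, show reP (ofR γ) = γ from by ext; simp, show imP (ofR γ) = 0 from by ext; simp,
    _root_.map_zero]
  simp

/-- Model Hodge-star computation `Sc_neg`. [folklore] -/
theorem Sc_neg {k m : ℕ} (h : k + m = 4) (η : V [⋀^Fin k]→L[ℝ] ℂ) : Sc k h (-η) = -Sc k h η := by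
  rw [← neg_one_smul ℂ η, Sc_smul]
  exact neg_one_smul ℂ (Sc k h η)

/-- Model Hodge-star computation `Sc_sub`. [folklore] -/
theorem Sc_sub {k m : ℕ} (h : k + m = 4) (η η' : V [⋀^Fin k]→L[ℝ] ℂ) :
    Sc k h (η - η') = Sc k h η - Sc k h η' := by
  rw [sub_eq_add_neg, Sc_add, Sc_neg, ← sub_eq_add_neg]

section WithMetric

attribute [local instance] bundle

/-- Chart-representative computation `inChart_re` for the rigged atlas `{id, A}`. [folklore] -/
theorem inChart_re {k : ℕ} (β : MForm 𝓘(ℝ, V) Mc2 ℂ k) (x₀ : Mc2) (y : V) :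
    β.re.inChart x₀ y = reP (β.inChart x₀ y) := by
  ext v
  rw [inChart_apply']
  change _ = Complex.re (β.inChart x₀ y v)
  rw [inChart_apply']
  rfl

/-- Chart-representative computation `inChart_im` for the rigged atlas `{id, A}`. [folklore] -/
theorem inChart_im {k : ℕ} (β : MForm 𝓘(ℝ, V) Mc2 ℂ k) (x₀ : Mc2) (y : V) :
    β.im.inChart x₀ y = imP (β.inChart x₀ y) := by
  ext v
  rw [inChart_apply']
  change _ = Complex.im (β.inChart x₀ y v)
  rw [inChart_apply']
  rfl

/-- Chart-representative computation `inChart_ofReal` for the rigged atlas `{id, A}`. [folklore] -/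
theorem inChart_ofReal {k : ℕ} (γ : MForm 𝓘(ℝ, V) Mc2 ℝ k) (x₀ : Mc2) (y : V) :
    γ.ofReal.inChart x₀ y = ofR (γ.inChart x₀ y) := by
  ext v
  rw [inChart_apply']
  change _ = ((γ.inChart x₀ y v : ℝ) : ℂ)
  rw [inChart_apply']
  rfl

/-- **Chart formula for the complex Hodge star of the model.** [folklore] -/
theorem inChart_cHodgeStar {k m : ℕ} (h : k + m = 4) (β : MForm 𝓘(ℝ, V) Mc2 ℂ k) (x₀ : Mc2) (y : V) :
    (MForm.cHodgeStar orient h β).inChart x₀ y = sgn x₀ • Sc k h (β.inChart x₀ y) := by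
  rw [MForm.cHodgeStar_apply, MForm.inChart_add, Pi.add_apply, MForm.inChart_smul_complex,
    Pi.smul_apply, inChart_ofReal, inChart_ofReal, inChart_hodgeStar, inChart_hodgeStar, inChart_re,
    inChart_im, Sc, smul_add]
  congr 1
  · ext v; simp
  · ext v; simp only [ContinuousAlternatingMap.smul_apply, smul_eq_mul,
      ContinuousLinearMap.compContinuousAlternatingMap_coe, Function.comp_apply,
      Complex.ofRealCLM_apply, Complex.ofReal_mul, Complex.real_smul]
    ring

end WithMetric

end OriginSwapAtlas

namespace OriginSwapAtlas
open Mc2 Set.powersetCard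

/-! ### values of the model star: `⋆⋆`, `⋆det4`, `⋆` on `1`-forms -/

/-- a reference point off the origin [folklore] -/
def pt1 : Mc2 := ⟨e₁⟩

/-- Auxiliary lemma `pt1_toV` for the `ℂ²` counterexample (see the module docstring). [folklore] -/
@[simp] theorem pt1_toV : pt1.toV = e₁ := rfl

/-- Auxiliary lemma `e₁_ne_zero` for the `ℂ²` counterexample (see the module docstring). [folklore] -/
theorem e₁_ne_zero : e₁ ≠ 0 := by
  intro h; have := congrArg Prod.fst h; simp at this

/-- Auxiliary lemma `pt1_ne` for the `ℂ²` counterexample (see the module docstring). [folklore] -/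
theorem pt1_ne : pt1.toV ≠ 0 := e₁_ne_zero

/-- Auxiliary lemma `sgn_pt1` for the `ℂ²` counterexample (see the module docstring). [folklore] -/
@[simp] theorem sgn_pt1 : sgn pt1 = 1 := by simp [sgn, e₁_ne_zero]

/-- Atlas bookkeeping `τ_pt1_of_ne` for `Mc2` (charts `{id, A}`, transitions `τ`). [folklore] -/
theorem τ_pt1_of_ne {z : Mc2} (hz : z.toV ≠ 0) : τ pt1 z = ContinuousLinearMap.id ℝ V := by
  unfold τ; rw [if_pos]; simp [e₁_ne_zero, hz]

section WithMetric

attribute [local instance] bundle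

/-- the form with the same chart-coordinate expression `β` at every point [folklore] -/
def constForm {F : Type*} [NormedAddCommGroup F] [NormedSpace ℝ F] {k : ℕ}
    (β : V [⋀^Fin k]→L[ℝ] F) : MForm 𝓘(ℝ, V) Mc2 F k := fun _ ↦ β

/-- Evaluation formula (`constForm_apply`); pointwise computation in the model. [folklore] -/
@[simp] theorem constForm_apply {F : Type*} [NormedAddCommGroup F] [NormedSpace ℝ F] {k : ℕ}
    (β : V [⋀^Fin k]→L[ℝ] F) (x : Mc2) (v : Fin k → V) : constForm β x v = β v := rfl

/-- the representative at `pt1` of a "constant" form, at the centre `e₁` [folklore] -/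
theorem inChart_const_pt1 {F : Type*} [NormedAddCommGroup F] [NormedSpace ℝ F] {k : ℕ}
    (β : V [⋀^Fin k]→L[ℝ] F) :
    (constForm β).inChart pt1 e₁ = β := by
  ext v
  rw [inChart_apply']
  have hz : ((extChartAt 𝓘(ℝ, V) pt1).symm e₁).toV ≠ 0 := by
    rw [extChartAt_symm_apply_toV, if_neg pt1_ne]; exact e₁_ne_zero
  change β (fun i ↦ τ pt1 _ (v i)) = β v
  rw [τ_pt1_of_ne hz]
  rfl

/-- **`⋆⋆ = (-1)^{km}` for the model star.** [folklore] -/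
theorem S_S {k m : ℕ} (h : k + m = 4) (h' : m + k = 4) (β : V [⋀^Fin k]→L[ℝ] ℝ) :
    S m h' (S k h β) = ((-1 : ℝ) ^ (k * m)) • β := by
  have H := MForm.hodgeStar_hodgeStar_holds (I := 𝓘(ℝ, V)) (M := Mc2) orient (k := k) (m := m) h h'
    (constForm β)
  have H1 : (MForm.hodgeStar orient h' (MForm.hodgeStar orient h (constForm β))).inChart pt1 e₁ =
      (((-1 : ℝ) ^ (k * m)) • constForm β).inChart pt1 e₁ := by
    rw [H]
  rw [inChart_hodgeStar, inChart_hodgeStar, inChart_const_pt1, MForm.inChart_smul, Pi.smul_apply,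
    inChart_const_pt1, sgn_pt1, one_smul, one_smul] at H1
  exact H1

/-- **`⋆ det4 = 1` for the model star.** [folklore] -/
theorem S_det4 (h : 4 + 0 = 4) : S 4 h det4 = ContinuousAlternatingMap.constOfIsEmpty ℝ V (Fin 0) 1 := by
  have H : MForm.hodgeStar orient h (riemannianVolumeForm orient) =
      fun z ↦ ContinuousAlternatingMap.constOfIsEmpty ℝ (TangentSpace 𝓘(ℝ, V) z) (Fin 0) 1 := by
    funext z
    rw [MForm.hodgeStar_apply, Literature.Geometry.Kaehler.riemannianVolumeForm_apply]
    exact hodgeStar_volumeFormL_holds (orient z) h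
  have H1 : (MForm.hodgeStar orient h (riemannianVolumeForm orient)).inChart pt1 e₁ =
      MForm.inChart (I := 𝓘(ℝ, V)) (M := Mc2)
        (fun z ↦ ContinuousAlternatingMap.constOfIsEmpty ℝ (TangentSpace 𝓘(ℝ, V) z) (Fin 0) 1) pt1 e₁ := by
    rw [H]
  rw [inChart_hodgeStar, inChart_riemannianVolumeForm, sgn_pt1, one_smul, one_smul] at H1
  rw [H1]
  ext v
  rw [inChart_apply']
  rfl

end WithMetric

/-- the sharp of a real covector with respect to the frame [folklore] -/
def sharp (ℓ : V →L[ℝ] ℝ) : V := ℓ e₁ • e₁ + ℓ e₂ • e₂ + ℓ e₃ • e₃ + ℓ e₄ • e₄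

/-- **The model star on `1`-forms**: `⋆ℓ = ι_{ℓ♯} det4`. [folklore] -/
theorem S_one_apply (h : 1 + 3 = 4) (ℓ : V →L[ℝ] ℝ) (w : Fin 3 → V) :
    S 1 h (form1r ℓ) w = det4 (Fin.cons (sharp ℓ) w) := by
  rw [S, hodgeStarFrame_apply, ← Equiv.sum_comp ofSingleton]
  have hmulti : ∀ i : Fin 4, frameMultiIndex fr (ofSingleton i : Set.powersetCard (Fin 4) 1) =
      fun _ ↦ fr i := by
    intro i
    funext j
    rw [frameMultiIndex_apply, ofFinEmbEquiv_symm_apply]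
    exact congrArg fr (Finset.orderEmbOfFin_singleton i j)
  have hvol : ∀ i : Fin 4,
      (det4.domDomCongr (finCongr (show 4 = 3 + 1 by omega))).interiorProductMulti 1
        (fun _ : Fin 1 ↦ fr i) w = det4 (Fin.cons (fr i) w) := by
    intro i
    rw [interiorProductMulti_apply, domDomCongr_apply]
    congr 1
    funext j
    fin_cases j <;> rfl
  simp only [hmulti, hvol, form1r_apply]
  have hsmul : ∀ (a : V) (r : ℝ), det4 (Fin.cons (r • a) w) = r * det4 (Fin.cons a w) := by
    intro a r
    have h2 := det4.toContinuousMultilinearMap.cons_smul w r a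
    simp only [ContinuousAlternatingMap.coe_toContinuousMultilinearMap] at h2
    rw [h2, smul_eq_mul]
  have hlin : ∀ (a b : V) (r : ℝ), det4 (Fin.cons (b + r • a) w) =
      det4 (Fin.cons b w) + r * det4 (Fin.cons a w) := by
    intro a b r
    have h1 := det4.toContinuousMultilinearMap.cons_add w b (r • a)
    simp only [ContinuousAlternatingMap.coe_toContinuousMultilinearMap] at h1
    rw [h1, hsmul]
  rw [Fin.sum_univ_four, sharp]
  simp only [fr, Matrix.cons_val_zero, Matrix.cons_val_one, Matrix.cons_val]
  change _ = det4 (Fin.cons (ℓ e₁ • e₁ + ℓ e₂ • e₂ + ℓ e₃ • e₃ + ℓ e₄ • e₄) w)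
  rw [hlin, hlin, hlin, hsmul]

end OriginSwapAtlas

namespace OriginSwapAtlas
open Mc2

/-! ### complex constant forms on the model space -/

/-- The wedge product `ℓ ∧ η` of a complex covector with a complex `n`-covector (real-multilinear,
`ℂ`-valued), normalised as Mathlib's `extDeriv`. [folklore] -/
def wedge1 {n : ℕ} (ℓ : V →L[ℝ] ℂ) (η : V [⋀^Fin n]→L[ℝ] ℂ) : V [⋀^Fin (n + 1)]→L[ℝ] ℂ :=
  alternatizeUncurryFin (ℓ.smulRight η)

/-- Evaluation formula (`wedge1_apply`); pointwise computation in the model. [folklore] -/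
theorem wedge1_apply {n : ℕ} (ℓ : V →L[ℝ] ℂ) (η : V [⋀^Fin n]→L[ℝ] ℂ) (v : Fin (n + 1) → V) :
    wedge1 ℓ η v = ∑ i : Fin (n + 1), (-1) ^ (i : ℕ) • (ℓ (v i) * η (i.removeNth v)) := by
  simp [wedge1, alternatizeUncurryFin_apply, ContinuousLinearMap.smulRight_apply, smul_eq_mul]

/-- Wedge-product identity `wedge1_add_left` in the model. [folklore] -/
theorem wedge1_add_left {n : ℕ} (ℓ ℓ' : V →L[ℝ] ℂ) (η : V [⋀^Fin n]→L[ℝ] ℂ) :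
    wedge1 (ℓ + ℓ') η = wedge1 ℓ η + wedge1 ℓ' η := by
  ext v; simp only [wedge1_apply, ContinuousAlternatingMap.add_apply, _root_.add_apply,
    ← Finset.sum_add_distrib]
  refine Finset.sum_congr rfl fun i _ ↦ ?_
  rw [add_mul, smul_add]

/-- Wedge-product identity `wedge1_smul_left` in the model. [folklore] -/
theorem wedge1_smul_left {n : ℕ} (c : ℂ) (ℓ : V →L[ℝ] ℂ) (η : V [⋀^Fin n]→L[ℝ] ℂ) :
    wedge1 (c • ℓ) η = c • wedge1 ℓ η := by
  ext v; simp only [wedge1_apply, ContinuousAlternatingMap.smul_apply, _root_.smul_apply,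
    smul_eq_mul, Finset.mul_sum]
  refine Finset.sum_congr rfl fun i _ ↦ ?_
  rw [mul_smul_comm, mul_assoc]

/-- Wedge-product identity `wedge1_zero_left` in the model. [folklore] -/
theorem wedge1_zero_left {n : ℕ} (η : V [⋀^Fin n]→L[ℝ] ℂ) : wedge1 (0 : V →L[ℝ] ℂ) η = 0 := by
  ext v; simp [wedge1_apply]

/-- The complex coordinate functional `dz` (real-linear, `ℂ`-valued). [folklore] -/
def zL : V →L[ℝ] ℂ := (ContinuousLinearMap.fst ℂ ℂ ℂ).restrictScalars ℝ
/-- The complex coordinate functional `dw`. [folklore] -/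
def wL : V →L[ℝ] ℂ := (ContinuousLinearMap.snd ℂ ℂ ℂ).restrictScalars ℝ
/-- The functional `dz̄`. [folklore] -/
def zbL : V →L[ℝ] ℂ := (Complex.conjCLE : ℂ →L[ℝ] ℂ).comp zL
/-- The functional `dw̄`. [folklore] -/
def wbL : V →L[ℝ] ℂ := (Complex.conjCLE : ℂ →L[ℝ] ℂ).comp wL

/-- Evaluation formula (`zL_apply`); pointwise computation in the model. [folklore] -/
@[simp] theorem zL_apply (v : V) : zL v = v.1 := rfl
/-- Evaluation formula (`wL_apply`); pointwise computation in the model. [folklore] -/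
@[simp] theorem wL_apply (v : V) : wL v = v.2 := rfl
/-- Evaluation formula (`zbL_apply`); pointwise computation in the model. [folklore] -/
@[simp] theorem zbL_apply (v : V) : zbL v = conj v.1 := rfl
/-- Evaluation formula (`wbL_apply`); pointwise computation in the model. [folklore] -/
@[simp] theorem wbL_apply (v : V) : wbL v = conj v.2 := rfl

/-- A complex covector as a complex `1`-form. [folklore] -/
def form1 (ℓ : V →L[ℝ] ℂ) : V [⋀^Fin 1]→L[ℝ] ℂ := ofSubsingleton ℝ V ℂ (0 : Fin 1) ℓ

/-- Evaluation formula (`form1_apply`); pointwise computation in the model. [folklore] -/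
@[simp] theorem form1_apply (ℓ : V →L[ℝ] ℂ) (v : Fin 1 → V) : form1 ℓ v = ℓ (v 0) := by
  simp [form1]

/-- Auxiliary lemma `form1_add` for the `ℂ²` counterexample (see the module docstring). [folklore] -/
theorem form1_add (ℓ ℓ' : V →L[ℝ] ℂ) : form1 (ℓ + ℓ') = form1 ℓ + form1 ℓ' := by ext v; simp
/-- Auxiliary lemma `form1_smul` for the `ℂ²` counterexample (see the module docstring). [folklore] -/
theorem form1_smul (c : ℂ) (ℓ : V →L[ℝ] ℂ) : form1 (c • ℓ) = c • form1 ℓ := by ext v; simp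

/-! The `ℂ`-action on real-linear maps / forms with values in `ℂ`: `simp`/`rw` do not find the
generic `zero_smul`/`neg_smul`/`add_smul` here (instance-path mismatch), so we restate them. -/
/-- `0 • η = 0` for the `ℂ`-action on complex model covectors (restated, see above). [folklore] -/
theorem czero_smul {n : ℕ} (η : V [⋀^Fin n]→L[ℝ] ℂ) : (0 : ℂ) • η = 0 := zero_smul ℂ η
/-- Auxiliary lemma `cneg_smul` for the `ℂ²` counterexample (see the module docstring). [folklore] -/
theorem cneg_smul {n : ℕ} (c : ℂ) (η : V [⋀^Fin n]→L[ℝ] ℂ) : (-c) • η = -(c • η) := neg_smul c η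
/-- Auxiliary lemma `cadd_smul` for the `ℂ²` counterexample (see the module docstring). [folklore] -/
theorem cadd_smul {n : ℕ} (a b : ℂ) (η : V [⋀^Fin n]→L[ℝ] ℂ) : (a + b) • η = a • η + b • η :=
  add_smul a b η
/-- Auxiliary lemma `csub_smul` for the `ℂ²` counterexample (see the module docstring). [folklore] -/
theorem csub_smul {n : ℕ} (a b : ℂ) (η : V [⋀^Fin n]→L[ℝ] ℂ) : (a - b) • η = a • η - b • η :=
  sub_smul a b η
/-- Auxiliary lemma `cone_smul` for the `ℂ²` counterexample (see the module docstring). [folklore] -/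
theorem cone_smul {n : ℕ} (η : V [⋀^Fin n]→L[ℝ] ℂ) : (1 : ℂ) • η = η := one_smul ℂ η
/-- Auxiliary lemma `czero_smulL` for the `ℂ²` counterexample (see the module docstring). [folklore] -/
theorem czero_smulL (ℓ : V →L[ℝ] ℂ) : (0 : ℂ) • ℓ = 0 := zero_smul ℂ ℓ
/-- Auxiliary lemma `cone_smulL` for the `ℂ²` counterexample (see the module docstring). [folklore] -/
theorem cone_smulL (ℓ : V →L[ℝ] ℂ) : (1 : ℂ) • ℓ = ℓ := one_smul ℂ ℓ
/-- Auxiliary lemma `cneg_smulL` for the `ℂ²` counterexample (see the module docstring). [folklore] -/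
theorem cneg_smulL (c : ℂ) (ℓ : V →L[ℝ] ℂ) : (-c) • ℓ = -(c • ℓ) := neg_smul c ℓ
/-- Auxiliary lemma `cadd_smulL` for the `ℂ²` counterexample (see the module docstring). [folklore] -/
theorem cadd_smulL (a b : ℂ) (ℓ : V →L[ℝ] ℂ) : (a + b) • ℓ = a • ℓ + b • ℓ := add_smul a b ℓ

/-- Evaluation formula (`wedge1_form1_apply`); pointwise computation in the model. [folklore] -/
theorem wedge1_form1_apply (ℓ ℓ' : V →L[ℝ] ℂ) (v : Fin 2 → V) :
    wedge1 ℓ (form1 ℓ') v = ℓ (v 0) * ℓ' (v 1) - ℓ (v 1) * ℓ' (v 0) := by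
  rw [wedge1_apply, Fin.sum_univ_two]
  have h0 : (Fin.removeNth 0 v : Fin 1 → V) = ![v 1] := by
    funext i; fin_cases i; rfl
  have h1 : (Fin.removeNth 1 v : Fin 1 → V) = ![v 0] := by
    funext i; fin_cases i; rfl
  rw [h0, h1]
  simp
  ring

/-- Evaluation formula (`wedge1_two_apply`); pointwise computation in the model. [folklore] -/
theorem wedge1_two_apply (ℓ : V →L[ℝ] ℂ) (η : V [⋀^Fin 2]→L[ℝ] ℂ) (v : Fin 3 → V) :
    wedge1 ℓ η v = ℓ (v 0) * η ![v 1, v 2] - ℓ (v 1) * η ![v 0, v 2] + ℓ (v 2) * η ![v 0, v 1] := by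
  rw [wedge1_apply, Fin.sum_univ_three]
  have h0 : (Fin.removeNth 0 v : Fin 2 → V) = ![v 1, v 2] := by
    funext i; fin_cases i <;> rfl
  have h1 : (Fin.removeNth 1 v : Fin 2 → V) = ![v 0, v 2] := by
    funext i; fin_cases i <;> rfl
  have h2 : (Fin.removeNth 2 v : Fin 2 → V) = ![v 0, v 1] := by
    funext i; fin_cases i <;> rfl
  rw [h0, h1, h2]
  simp
  ring

/-- Evaluation formula (`wedge1_three_apply`); pointwise computation in the model. [folklore] -/
theorem wedge1_three_apply (ℓ : V →L[ℝ] ℂ) (η : V [⋀^Fin 3]→L[ℝ] ℂ) (v : Fin 4 → V) :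
    wedge1 ℓ η v = ℓ (v 0) * η ![v 1, v 2, v 3] - ℓ (v 1) * η ![v 0, v 2, v 3]
      + ℓ (v 2) * η ![v 0, v 1, v 3] - ℓ (v 3) * η ![v 0, v 1, v 2] := by
  rw [wedge1_apply, Fin.sum_univ_four]
  have h0 : (Fin.removeNth 0 v : Fin 3 → V) = ![v 1, v 2, v 3] := by
    funext i; fin_cases i <;> rfl
  have h1 : (Fin.removeNth 1 v : Fin 3 → V) = ![v 0, v 2, v 3] := by
    funext i; fin_cases i <;> rfl
  have h2 : (Fin.removeNth 2 v : Fin 3 → V) = ![v 0, v 1, v 3] := by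
    funext i; fin_cases i <;> rfl
  have h3 : (Fin.removeNth 3 v : Fin 3 → V) = ![v 0, v 1, v 2] := by
    funext i; fin_cases i <;> rfl
  rw [h0, h1, h2, h3]
  simp
  ring

/-! ### rotations and weights -/

/-- rotation by `e^{iθ}` of the model space (`= tangentRotate V x θ` at every point `x`) [folklore] -/
def rot (θ : ℝ) : V →L[ℝ] V :=
  ((Complex.exp (θ * Complex.I) • ContinuousLinearMap.id ℂ V).restrictScalars ℝ : V →L[ℝ] V)

/-- Evaluation formula (`rot_apply`); pointwise computation in the model. [folklore] -/
@[simp] theorem rot_apply (θ : ℝ) (v : V) : rot θ v = Complex.exp (θ * Complex.I) • v := rfl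

/-- Auxiliary lemma `tangentRotate_eq_rot` for the `ℂ²` counterexample (see the module docstring).
[folklore] -/
theorem tangentRotate_eq_rot (x : Mc2) (θ : ℝ) (v : TangentSpace 𝓘(ℝ, V) x) :
    Literature.NumberTheory.Transcendental.tangentRotate V x θ v = rot θ v := rfl

/-- a complex covector has weight `w` if it transforms by `e^{iwθ}` under `e^{iθ}` [folklore] -/
def HasWeight {k : ℕ} (w : ℤ) (η : V [⋀^Fin k]→L[ℝ] ℂ) : Prop :=
  ∀ (θ : ℝ) (v : Fin k → V), η (fun i ↦ rot θ (v i)) = Complex.exp ((w : ℂ) * θ * Complex.I) * η v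

/-- Auxiliary lemma `HasWeight.add` for the `ℂ²` counterexample (see the module docstring). [folklore] -/
theorem HasWeight.add {k : ℕ} {w : ℤ} {η η' : V [⋀^Fin k]→L[ℝ] ℂ} (h : HasWeight w η)
    (h' : HasWeight w η') : HasWeight w (η + η') := fun θ v ↦ by
  simp only [ContinuousAlternatingMap.add_apply, h θ v, h' θ v, mul_add]

/-- Auxiliary lemma `HasWeight.smul` for the `ℂ²` counterexample (see the module docstring).
[folklore] -/
theorem HasWeight.smul {k : ℕ} {w : ℤ} {η : V [⋀^Fin k]→L[ℝ] ℂ} (c : ℂ) (h : HasWeight w η) :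
    HasWeight w (c • η) := fun θ v ↦ by
  simp only [ContinuousAlternatingMap.smul_apply, h θ v, smul_eq_mul]; ring

/-- Auxiliary lemma `HasWeight.neg` for the `ℂ²` counterexample (see the module docstring). [folklore] -/
theorem HasWeight.neg {k : ℕ} {w : ℤ} {η : V [⋀^Fin k]→L[ℝ] ℂ} (h : HasWeight w η) :
    HasWeight w (-η) := by rw [← neg_one_smul ℂ η]; exact h.smul (-1)

/-- Auxiliary lemma `HasWeight.sub` for the `ℂ²` counterexample (see the module docstring). [folklore] -/
theorem HasWeight.sub {k : ℕ} {w : ℤ} {η η' : V [⋀^Fin k]→L[ℝ] ℂ} (h : HasWeight w η)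
    (h' : HasWeight w η') : HasWeight w (η - η') := by
  rw [sub_eq_add_neg]; exact h.add h'.neg

/-- Weight of the covector or operator in `hasWeight_zero` under the rotations `e^{iθ}` (Voisin
(2002), §2.3.1). [folklore] -/
theorem hasWeight_zero {k : ℕ} (w : ℤ) : HasWeight w (0 : V [⋀^Fin k]→L[ℝ] ℂ) := fun θ v ↦ by simp

/-- weights of `1`-forms from the behaviour of the functional [folklore] -/
theorem hasWeight_form1 {w : ℤ} {ℓ : V →L[ℝ] ℂ}
    (h : ∀ (θ : ℝ) (v : V), ℓ (rot θ v) = Complex.exp ((w : ℂ) * θ * Complex.I) * ℓ v) :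
    HasWeight w (form1 ℓ) := fun θ v ↦ by
  simp only [form1_apply, h]

/-- Auxiliary lemma `zL_rot` for the `ℂ²` counterexample (see the module docstring). [folklore] -/
theorem zL_rot (θ : ℝ) (v : V) : zL (rot θ v) = Complex.exp (((1 : ℤ) : ℂ) * θ * Complex.I) * zL v := by
  simp

/-- Auxiliary lemma `wL_rot` for the `ℂ²` counterexample (see the module docstring). [folklore] -/
theorem wL_rot (θ : ℝ) (v : V) : wL (rot θ v) = Complex.exp (((1 : ℤ) : ℂ) * θ * Complex.I) * wL v := by
  simp

/-- Auxiliary lemma `zbL_rot` for the `ℂ²` counterexample (see the module docstring). [folklore] -/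
theorem zbL_rot (θ : ℝ) (v : V) :
    zbL (rot θ v) = Complex.exp (((-1 : ℤ) : ℂ) * θ * Complex.I) * zbL v := by
  simp only [zbL_apply, rot_apply, Prod.smul_fst, smul_eq_mul, map_mul, ← Complex.exp_conj, map_mul,
    Complex.conj_ofReal, Complex.conj_I]
  push_cast
  ring_nf

/-- Auxiliary lemma `wbL_rot` for the `ℂ²` counterexample (see the module docstring). [folklore] -/
theorem wbL_rot (θ : ℝ) (v : V) :
    wbL (rot θ v) = Complex.exp (((-1 : ℤ) : ℂ) * θ * Complex.I) * wbL v := by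
  simp only [wbL_apply, rot_apply, Prod.smul_snd, smul_eq_mul, map_mul, ← Complex.exp_conj, map_mul,
    Complex.conj_ofReal, Complex.conj_I]
  push_cast
  ring_nf

/-- **Weights add under `wedge1`.** [folklore] -/
theorem HasWeight.wedge1 {n : ℕ} {a b : ℤ} {ℓ : V →L[ℝ] ℂ} {η : V [⋀^Fin n]→L[ℝ] ℂ}
    (hℓ : ∀ (θ : ℝ) (v : V), ℓ (rot θ v) = Complex.exp ((a : ℂ) * θ * Complex.I) * ℓ v)
    (hη : HasWeight b η) : HasWeight (a + b) (wedge1 ℓ η) := fun θ v ↦ by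
  rw [wedge1_apply, wedge1_apply, Finset.mul_sum]
  refine Finset.sum_congr rfl fun i _ ↦ ?_
  have : (fun j ↦ rot θ (i.removeNth v j)) = i.removeNth (fun j ↦ rot θ (v j)) := rfl
  rw [hℓ, ← this, hη θ (i.removeNth v)]
  simp only [Int.cast_add]
  rw [show Complex.exp (((a : ℂ) + b) * θ * Complex.I) =
      Complex.exp ((a : ℂ) * θ * Complex.I) * Complex.exp ((b : ℂ) * θ * Complex.I) from by
    rw [← Complex.exp_add]; ring_nf]
  ring

section WithMetric

attribute [local instance] bundle

/-- a constant complex form has type `(p,q)` iff its value has weight `p - q` [folklore] -/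
theorem isOfType_constForm {k : ℕ} {p q : ℕ} {η : V [⋀^Fin k]→L[ℝ] ℂ} (hpq : p + q = k)
    (h : HasWeight ((p : ℤ) - q) η) :
    Literature.NumberTheory.Transcendental.IsOfType p q (constForm η) := by
  refine ⟨hpq, fun x θ v ↦ ?_⟩
  have := h θ v
  push_cast at this ⊢
  exact this

end WithMetric

end OriginSwapAtlas

namespace OriginSwapAtlas
open Mc2

/-! ### the catalogue of constant forms -/

/-- The complex `1`-form `dz` of the model. [folklore] -/
def dz₀ : V [⋀^Fin 1]→L[ℝ] ℂ := form1 zL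
/-- The complex `1`-form `dz̄`. [folklore] -/
def dzb₀ : V [⋀^Fin 1]→L[ℝ] ℂ := form1 zbL
/-- The complex `1`-form `dw`. [folklore] -/
def dw₀ : V [⋀^Fin 1]→L[ℝ] ℂ := form1 wL
/-- The complex `1`-form `dw̄`. [folklore] -/
def dwb₀ : V [⋀^Fin 1]→L[ℝ] ℂ := form1 wbL

/-- generic antisymmetry / alternation of `wedge1` on `1`-forms [folklore] -/
theorem wedge1_form1_swap (X Y : V →L[ℝ] ℂ) : wedge1 X (form1 Y) = -wedge1 Y (form1 X) := by
  ext v; simp only [wedge1_form1_apply, ContinuousAlternatingMap.neg_apply]; ring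

/-- Wedge-product identity `wedge1_form1_self` in the model. [folklore] -/
theorem wedge1_form1_self (X : V →L[ℝ] ℂ) : wedge1 X (form1 X) = 0 := by
  ext v; rw [wedge1_form1_apply]; change _ = (0 : ℂ); ring

/-- the six basic `2`-forms [folklore] -/
def dzdzb : V [⋀^Fin 2]→L[ℝ] ℂ := wedge1 zL dzb₀
/-- The `2`-form `dz ∧ dw` (type `(2,0)`). [folklore] -/
def dzdw : V [⋀^Fin 2]→L[ℝ] ℂ := wedge1 zL dw₀
/-- The `2`-form `dz ∧ dw̄` (type `(1,1)`). [folklore] -/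
def dzdwb : V [⋀^Fin 2]→L[ℝ] ℂ := wedge1 zL dwb₀
/-- The `2`-form `dz̄ ∧ dw` (type `(1,1)`). [folklore] -/
def dzbdw : V [⋀^Fin 2]→L[ℝ] ℂ := wedge1 zbL dw₀
/-- The `2`-form `dz̄ ∧ dw̄` (type `(0,2)`). [folklore] -/
def dzbdwb : V [⋀^Fin 2]→L[ℝ] ℂ := wedge1 zbL dwb₀
/-- The `2`-form `dw ∧ dw̄` (type `(1,1)`). [folklore] -/
def dwdwb : V [⋀^Fin 2]→L[ℝ] ℂ := wedge1 wL dwb₀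

/-- weights of the basic functionals, packaged [folklore] -/
theorem hasWeight_dz₀ : HasWeight 1 dz₀ := hasWeight_form1 zL_rot
/-- Weight of the covector or operator in `hasWeight_dw₀` under the rotations `e^{iθ}` (Voisin (2002),
§2.3.1). [folklore] -/
theorem hasWeight_dw₀ : HasWeight 1 dw₀ := hasWeight_form1 wL_rot
/-- Weight of the covector or operator in `hasWeight_dzb₀` under the rotations `e^{iθ}` (Voisin
(2002), §2.3.1). [folklore] -/
theorem hasWeight_dzb₀ : HasWeight (-1) dzb₀ := hasWeight_form1 zbL_rot
/-- Weight of the covector or operator in `hasWeight_dwb₀` under the rotations `e^{iθ}` (Voisin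
(2002), §2.3.1). [folklore] -/
theorem hasWeight_dwb₀ : HasWeight (-1) dwb₀ := hasWeight_form1 wbL_rot

/-- Weight of the covector or operator in `hasWeight_dzdzb` under the rotations `e^{iθ}` (Voisin
(2002), §2.3.1). [folklore] -/
theorem hasWeight_dzdzb : HasWeight 0 dzdzb := by
  unfold dzdzb; simpa using HasWeight.wedge1 zL_rot hasWeight_dzb₀
/-- Weight of the covector or operator in `hasWeight_dzdw` under the rotations `e^{iθ}` (Voisin
(2002), §2.3.1). [folklore] -/
theorem hasWeight_dzdw : HasWeight 2 dzdw := by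
  unfold dzdw; simpa using HasWeight.wedge1 zL_rot hasWeight_dw₀
/-- Weight of the covector or operator in `hasWeight_dzdwb` under the rotations `e^{iθ}` (Voisin
(2002), §2.3.1). [folklore] -/
theorem hasWeight_dzdwb : HasWeight 0 dzdwb := by
  unfold dzdwb; simpa using HasWeight.wedge1 zL_rot hasWeight_dwb₀
/-- Weight of the covector or operator in `hasWeight_dzbdw` under the rotations `e^{iθ}` (Voisin
(2002), §2.3.1). [folklore] -/
theorem hasWeight_dzbdw : HasWeight 0 dzbdw := by
  unfold dzbdw; simpa using HasWeight.wedge1 zbL_rot hasWeight_dw₀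
/-- Weight of the covector or operator in `hasWeight_dzbdwb` under the rotations `e^{iθ}` (Voisin
(2002), §2.3.1). [folklore] -/
theorem hasWeight_dzbdwb : HasWeight (-2) dzbdwb := by
  unfold dzbdwb; have := HasWeight.wedge1 zbL_rot hasWeight_dwb₀; norm_num at this; exact this
/-- Weight of the covector or operator in `hasWeight_dwdwb` under the rotations `e^{iθ}` (Voisin
(2002), §2.3.1). [folklore] -/
theorem hasWeight_dwdwb : HasWeight 0 dwdwb := by
  unfold dwdwb; simpa using HasWeight.wedge1 wL_rot hasWeight_dwb₀

/-- the `3`-forms `E1 = dz∧dz̄∧dw`, `E2 = dz∧dz̄∧dw̄`, `E3 = dz∧dw∧dw̄`, `E4 = dz̄∧dw∧dw̄` [folklore] -/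
def E1₀ : V [⋀^Fin 3]→L[ℝ] ℂ := wedge1 zL dzbdw
/-- The `3`-form `E₂ = dz ∧ dz̄ ∧ dw̄` (type `(1,2)`). [folklore] -/
def E2₀ : V [⋀^Fin 3]→L[ℝ] ℂ := wedge1 zL dzbdwb
/-- The `3`-form `E₃ = dz ∧ dw ∧ dw̄` (type `(2,1)`). [folklore] -/
def E3₀ : V [⋀^Fin 3]→L[ℝ] ℂ := wedge1 zL dwdwb
/-- The `3`-form `E₄ = dz̄ ∧ dw ∧ dw̄` (type `(1,2)`). [folklore] -/
def E4₀ : V [⋀^Fin 3]→L[ℝ] ℂ := wedge1 zbL dwdwb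

/-- Weight of the covector or operator in `hasWeight_E1₀` under the rotations `e^{iθ}` (Voisin (2002),
§2.3.1). [folklore] -/
theorem hasWeight_E1₀ : HasWeight 1 E1₀ := by
  unfold E1₀; simpa using HasWeight.wedge1 zL_rot hasWeight_dzbdw
/-- Weight of the covector or operator in `hasWeight_E2₀` under the rotations `e^{iθ}` (Voisin (2002),
§2.3.1). [folklore] -/
theorem hasWeight_E2₀ : HasWeight (-1) E2₀ := by
  unfold E2₀; have := HasWeight.wedge1 zL_rot hasWeight_dzbdwb; norm_num at this; exact this
/-- Weight of the covector or operator in `hasWeight_E3₀` under the rotations `e^{iθ}` (Voisin (2002),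
§2.3.1). [folklore] -/
theorem hasWeight_E3₀ : HasWeight 1 E3₀ := by
  unfold E3₀; simpa using HasWeight.wedge1 zL_rot hasWeight_dwdwb
/-- Weight of the covector or operator in `hasWeight_E4₀` under the rotations `e^{iθ}` (Voisin (2002),
§2.3.1). [folklore] -/
theorem hasWeight_E4₀ : HasWeight (-1) E4₀ := by
  unfold E4₀; have := HasWeight.wedge1 zbL_rot hasWeight_dwdwb; norm_num at this; exact this

/-! ### decomposition of covectors -/

/-- Evaluation formula (`clm_apply_decomp`); pointwise computation in the model. [folklore] -/
theorem clm_apply_decomp (ℓ : V →L[ℝ] ℂ) (v : V) :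
    ℓ v = (v.1.re : ℂ) * ℓ e₁ + (v.1.im : ℂ) * ℓ e₂ + (v.2.re : ℂ) * ℓ e₃ + (v.2.im : ℂ) * ℓ e₄ := by
  conv_lhs => rw [decomp v]
  simp only [map_add, map_smul, Complex.real_smul]

/-- **Decomposition of a complex covector** in `dz, dz̄, dw, dw̄`. [folklore] -/
theorem clm_decomp (ℓ : V →L[ℝ] ℂ) :
    ℓ = (2⁻¹ * (ℓ e₁ - Complex.I * ℓ e₂)) • zL + (2⁻¹ * (ℓ e₁ + Complex.I * ℓ e₂)) • zbL +
      (2⁻¹ * (ℓ e₃ - Complex.I * ℓ e₄)) • wL + (2⁻¹ * (ℓ e₃ + Complex.I * ℓ e₄)) • wbL := by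
  refine ContinuousLinearMap.ext fun v ↦ ?_
  apply Complex.ext
  · rw [clm_apply_decomp ℓ v]
    simp only [_root_.add_apply, _root_.smul_apply, zL_apply, zbL_apply, wL_apply, wbL_apply,
      smul_eq_mul]
    simp only [Complex.add_re, Complex.mul_re, Complex.mul_im, Complex.ofReal_re, Complex.ofReal_im,
      Complex.conj_re, Complex.conj_im, Complex.I_re, Complex.I_im, Complex.sub_re, Complex.sub_im,
      Complex.add_im, Complex.inv_re, Complex.inv_im]
    norm_num
    ring
  · rw [clm_apply_decomp ℓ v]
    simp only [_root_.add_apply, _root_.smul_apply, zL_apply, zbL_apply, wL_apply, wbL_apply,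
      smul_eq_mul]
    simp only [Complex.add_re, Complex.mul_re, Complex.mul_im, Complex.ofReal_re, Complex.ofReal_im,
      Complex.conj_re, Complex.conj_im, Complex.I_re, Complex.I_im, Complex.sub_re, Complex.sub_im,
      Complex.add_im, Complex.inv_re, Complex.inv_im]
    norm_num
    ring

end OriginSwapAtlas

namespace OriginSwapAtlas
open Mc2

/-! ### `1`-covectors of weight `-1` -/

/-- Auxiliary lemma `exp_neg_pi_div_two` for the `ℂ²` counterexample (see the module docstring).
[folklore] -/
theorem exp_neg_pi_div_two : Complex.exp (((-1 : ℤ) : ℂ) * ((Real.pi / 2 : ℝ) : ℂ) * Complex.I) = -Complex.I := by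
  have : (((-1 : ℤ) : ℂ) * ((Real.pi / 2 : ℝ) : ℂ) * Complex.I) = -(Real.pi / 2) * Complex.I := by
    push_cast; ring
  rw [this, show (-(Real.pi / 2) * Complex.I : ℂ) = ((-(Real.pi / 2) : ℝ) : ℂ) * Complex.I by push_cast; ring,
    Complex.exp_mul_I]
  rw [← Complex.ofReal_cos, ← Complex.ofReal_sin, Real.cos_neg, Real.sin_neg, Real.cos_pi_div_two,
    Real.sin_pi_div_two]
  simp

/-- Auxiliary lemma `rot_pi_div_two` for the `ℂ²` counterexample (see the module docstring).
[folklore] -/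
theorem rot_pi_div_two (v : V) : rot (Real.pi / 2) v = Complex.I • v := by
  rw [rot_apply, show ((Real.pi / 2 : ℝ) : ℂ) * Complex.I = ((Real.pi / 2 : ℝ) : ℂ) * Complex.I from rfl,
    Complex.exp_mul_I, ← Complex.ofReal_cos, ← Complex.ofReal_sin, Real.cos_pi_div_two,
    Real.sin_pi_div_two]
  simp

/-- Auxiliary lemma `e₂_eq` for the `ℂ²` counterexample (see the module docstring). [folklore] -/
theorem e₂_eq : (Complex.I • e₁ : V) = e₂ := by ext <;> simp [e₁, e₂]
/-- Auxiliary lemma `e₄_eq` for the `ℂ²` counterexample (see the module docstring). [folklore] -/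
theorem e₄_eq : (Complex.I • e₃ : V) = e₄ := by ext <;> simp [e₃, e₄]

/-- a `1`-covector as `form1` of its functional [folklore] -/
theorem eq_form1 (η : V [⋀^Fin 1]→L[ℝ] ℂ) :
    η = form1 ((ofSubsingleton ℝ V ℂ (0 : Fin 1)).symm η) := by
  rw [form1, Equiv.apply_symm_apply]

/-- Evaluation formula (`ofSubsingleton_symm_apply'`); pointwise computation in the model. [folklore] -/
theorem ofSubsingleton_symm_apply' (η : V [⋀^Fin 1]→L[ℝ] ℂ) (u : V) :
    (ofSubsingleton ℝ V ℂ (0 : Fin 1)).symm η u = η ![u] := by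
  conv_rhs => rw [eq_form1 η]
  rw [form1_apply]
  rfl

/-- **A `1`-covector of weight `-1` is `η(e₁) dz̄ + η(e₃) dw̄`.** [folklore] -/
theorem eq_of_hasWeight_neg_one {η : V [⋀^Fin 1]→L[ℝ] ℂ} (h : HasWeight (-1) η) :
    η = (η ![e₁]) • dzb₀ + (η ![e₃]) • dwb₀ := by
  set ℓ := (ofSubsingleton ℝ V ℂ (0 : Fin 1)).symm η with hℓ
  have hJ : ∀ u : V, ℓ (Complex.I • u) = -Complex.I * ℓ u := by
    intro u
    rw [ofSubsingleton_symm_apply', ofSubsingleton_symm_apply', ← rot_pi_div_two]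
    have := h (Real.pi / 2) ![u]
    rw [exp_neg_pi_div_two] at this
    convert this using 2
    funext i; fin_cases i; rfl
  have h2 : ℓ e₂ = -Complex.I * ℓ e₁ := by rw [← e₂_eq, hJ]
  have h4 : ℓ e₄ = -Complex.I * ℓ e₃ := by rw [← e₄_eq, hJ]
  have key : ∀ v : V, ℓ v = ℓ e₁ * conj v.1 + ℓ e₃ * conj v.2 := by
    intro v
    rw [clm_apply_decomp ℓ v, h2, h4]
    apply Complex.ext
    · simp; ring
    · simp; ring
  have hb : η ![e₁] = ℓ e₁ := (ofSubsingleton_symm_apply' η e₁).symm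
  have hd : η ![e₃] = ℓ e₃ := (ofSubsingleton_symm_apply' η e₃).symm
  rw [hb, hd]
  ext v
  conv_lhs => rw [eq_form1 η, ← hℓ, form1_apply, key]
  simp only [ContinuousAlternatingMap.add_apply, ContinuousAlternatingMap.smul_apply, dzb₀, dwb₀,
    form1_apply, zbL_apply, wbL_apply, smul_eq_mul]

/-! ### top-degree covectors are multiples of `det4` -/

/-- The complexified volume form `det4 ⊗ 1`. [folklore] -/
def det4c : V [⋀^Fin 4]→L[ℝ] ℂ := ofR det4

/-- Evaluation formula (`det4c_apply`); pointwise computation in the model. [folklore] -/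
@[simp] theorem det4c_apply (v : Fin 4 → V) : det4c v = (det4 v : ℂ) := by simp [det4c]

/-- The standard frame as a real basis of the model space. [folklore] -/
def basisV : Basis (Fin 4) ℝ V :=
  basisOfLinearIndependentOfCardEqFinrank linearIndependent_fr
    (by rw [Fintype.card_fin]; exact (fact_finrank.out : finrank ℝ V = 4).symm)

/-- Auxiliary lemma `coe_basisV` for the `ℂ²` counterexample (see the module docstring). [folklore] -/
@[simp] theorem coe_basisV : ⇑basisV = fr := coe_basisOfLinearIndependentOfCardEqFinrank _ _

/-- Auxiliary lemma `real_top_eq_smul_det4` for the `ℂ²` counterexample (see the module docstring).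
[folklore] -/
theorem real_top_eq_smul_det4 (X : V [⋀^Fin 4]→L[ℝ] ℝ) : X = X fr • det4 := by
  have hX := AlternatingMap.eq_smul_basis_det basisV X.toAlternatingMap
  have hD := AlternatingMap.eq_smul_basis_det basisV det4.toAlternatingMap
  rw [ContinuousAlternatingMap.coe_toAlternatingMap, coe_basisV, det4_fr, one_smul] at hD
  rw [ContinuousAlternatingMap.coe_toAlternatingMap, coe_basisV, ← hD] at hX
  ext v
  have := congrArg (fun f : V [⋀^Fin 4]→ₗ[ℝ] ℝ ↦ f v) hX
  simpa using this

/-- **Every complex `4`-covector of the model is `X(fr) · det4`.** [folklore] -/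
theorem top_eq_smul_det4c (X : V [⋀^Fin 4]→L[ℝ] ℂ) : X = X fr • det4c := by
  have hr := real_top_eq_smul_det4 (reP X)
  have hi := real_top_eq_smul_det4 (imP X)
  ext v
  have hr' := congrArg (fun f : V [⋀^Fin 4]→L[ℝ] ℝ ↦ f v) hr
  have hi' := congrArg (fun f : V [⋀^Fin 4]→L[ℝ] ℝ ↦ f v) hi
  simp only [ContinuousLinearMap.compContinuousAlternatingMap_coe, Function.comp_apply,
    Complex.reCLM_apply, Complex.imCLM_apply, ContinuousAlternatingMap.smul_apply, smul_eq_mul] at hr' hi'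
  rw [ContinuousAlternatingMap.smul_apply, det4c_apply, smul_eq_mul]
  apply Complex.ext
  · rw [hr']; simp
  · rw [hi']; simp

/-! ### `Sc` on `1`-forms and on `det4c` -/

/-- Auxiliary lemma `reP_form1` for the `ℂ²` counterexample (see the module docstring). [folklore] -/
theorem reP_form1 (ℓ : V →L[ℝ] ℂ) : reP (form1 ℓ) = form1r (Complex.reCLM.comp ℓ) := by
  ext v; simp
/-- Auxiliary lemma `imP_form1` for the `ℂ²` counterexample (see the module docstring). [folklore] -/
theorem imP_form1 (ℓ : V →L[ℝ] ℂ) : imP (form1 ℓ) = form1r (Complex.imCLM.comp ℓ) := by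
  ext v; simp

/-- Evaluation formula (`Sc_form1_apply`); pointwise computation in the model. [folklore] -/
theorem Sc_form1_apply (h : 1 + 3 = 4) (ℓ : V →L[ℝ] ℂ) (w : Fin 3 → V) :
    Sc 1 h (form1 ℓ) w = (det4 (Fin.cons (sharp (Complex.reCLM.comp ℓ)) w) : ℂ) +
      Complex.I * (det4 (Fin.cons (sharp (Complex.imCLM.comp ℓ)) w) : ℂ) := by
  rw [Sc_apply, reP_form1, imP_form1, S_one_apply, S_one_apply]

/-- Auxiliary lemma `sharp_re_zbL` for the `ℂ²` counterexample (see the module docstring). [folklore] -/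
@[simp] theorem sharp_re_zbL : sharp (Complex.reCLM.comp zbL) = e₁ := by
  simp [sharp]
/-- Auxiliary lemma `sharp_im_zbL` for the `ℂ²` counterexample (see the module docstring). [folklore] -/
@[simp] theorem sharp_im_zbL : sharp (Complex.imCLM.comp zbL) = -e₂ := by
  simp [sharp]
/-- Auxiliary lemma `sharp_re_wbL` for the `ℂ²` counterexample (see the module docstring). [folklore] -/
@[simp] theorem sharp_re_wbL : sharp (Complex.reCLM.comp wbL) = e₃ := by
  simp [sharp]
/-- Auxiliary lemma `sharp_im_wbL` for the `ℂ²` counterexample (see the module docstring). [folklore] -/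
@[simp] theorem sharp_im_wbL : sharp (Complex.imCLM.comp wbL) = -e₄ := by
  simp [sharp]
/-- Auxiliary lemma `sharp_re_zL` for the `ℂ²` counterexample (see the module docstring). [folklore] -/
@[simp] theorem sharp_re_zL : sharp (Complex.reCLM.comp zL) = e₁ := by
  simp [sharp]
/-- Auxiliary lemma `sharp_im_zL` for the `ℂ²` counterexample (see the module docstring). [folklore] -/
@[simp] theorem sharp_im_zL : sharp (Complex.imCLM.comp zL) = e₂ := by
  simp [sharp]
/-- Auxiliary lemma `sharp_re_wL` for the `ℂ²` counterexample (see the module docstring). [folklore] -/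
@[simp] theorem sharp_re_wL : sharp (Complex.reCLM.comp wL) = e₃ := by
  simp [sharp]
/-- Auxiliary lemma `sharp_im_wL` for the `ℂ²` counterexample (see the module docstring). [folklore] -/
@[simp] theorem sharp_im_wL : sharp (Complex.imCLM.comp wL) = e₄ := by
  simp [sharp]

/-- Volume-form computation `det4_cons_neg` in the model. [folklore] -/
theorem det4_cons_neg (a : V) (w : Fin 3 → V) : det4 (Fin.cons (-a) w) = -det4 (Fin.cons a w) := by
  have h2 := det4.toContinuousMultilinearMap.cons_smul w (-1 : ℝ) a
  simp only [ContinuousAlternatingMap.coe_toContinuousMultilinearMap, neg_one_smul] at h2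
  exact h2

/-- Model Hodge-star computation `Sc_det4c`. [folklore] -/
theorem Sc_det4c (h : 4 + 0 = 4) : Sc 4 h det4c = ContinuousAlternatingMap.constOfIsEmpty ℝ V (Fin 0) 1 := by
  rw [det4c, Sc_ofR, S_det4]
  ext v
  simp

end OriginSwapAtlas

namespace OriginSwapAtlas
open Mc2

/-! ### `d` in charts, representatives -/

/-- Auxiliary lemma `range_eq_univ` for the `ℂ²` counterexample (see the module docstring). [folklore] -/
theorem range_eq_univ : range (𝓘(ℝ, V)) = univ := ModelWithCorners.Boundaryless.range_eq_univ

/-- Derivative computation `mextDeriv_eq_extDeriv` (Mathlib's `fderiv`/`extDeriv`, junk value `0`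
where not differentiable). [folklore] -/
theorem mextDeriv_eq_extDeriv {F : Type*} [NormedAddCommGroup F] [NormedSpace ℝ F] {k : ℕ}
    (α : MForm 𝓘(ℝ, V) Mc2 F k) (x : Mc2) :
    mextDeriv α x = extDeriv (α.inChart x) (extChartAt 𝓘(ℝ, V) x x) := by
  rw [mextDeriv_eq_extDerivWithin, range_eq_univ, extDerivWithin_univ]

/-- the representative in the identity chart (based at `pt1`) [folklore] -/
abbrev rep {F : Type*} [NormedAddCommGroup F] [NormedSpace ℝ F] {k : ℕ}
    (α : MForm 𝓘(ℝ, V) Mc2 F k) : V → V [⋀^Fin k]→L[ℝ] F := α.inChart pt1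

/-- Atlas bookkeeping `τ_eq_τ_pt1` for `Mc2` (charts `{id, A}`, transitions `τ`). [folklore] -/
theorem τ_eq_τ_pt1 {z : Mc2} (hz : z.toV ≠ 0) (w : Mc2) : τ z w = τ pt1 w := by
  unfold τ
  by_cases hw : w.toV = 0 <;> simp [hz, hw, e₁_ne_zero]

/-- Chart-representative computation `inChart_eq_rep` for the rigged atlas `{id, A}`. [folklore] -/
theorem inChart_eq_rep {F : Type*} [NormedAddCommGroup F] [NormedSpace ℝ F] {k : ℕ}
    (α : MForm 𝓘(ℝ, V) Mc2 F k) {z : Mc2} (hz : z.toV ≠ 0) : α.inChart z = rep α := by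
  funext y
  rw [inChart_eq, rep, inChart_eq]
  have h1 : (extChartAt 𝓘(ℝ, V) z).symm y = (extChartAt 𝓘(ℝ, V) pt1).symm y := by
    apply Mc2.ext; simp [hz, e₁_ne_zero]
  rw [h1, τ_eq_τ_pt1 hz]

/-- Atlas bookkeeping `extChartAt_pt1_symm` for `Mc2` (charts `{id, A}`, transitions `τ`). [folklore] -/
@[simp] theorem extChartAt_pt1_symm (y : V) : ((extChartAt 𝓘(ℝ, V) pt1).symm y) = ⟨y⟩ := by
  apply Mc2.ext; simp [e₁_ne_zero]

/-- Atlas bookkeeping `extChartAt_origin_symm` for `Mc2` (charts `{id, A}`, transitions `τ`).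
[folklore] -/
@[simp] theorem extChartAt_origin_symm (y : V) : ((extChartAt 𝓘(ℝ, V) origin).symm y) = ⟨A y⟩ := by
  apply Mc2.ext; simp

/-- Atlas bookkeeping `τ_origin_pt1` for `Mc2` (charts `{id, A}`, transitions `τ`). [folklore] -/
theorem τ_origin_pt1 : τ origin pt1 = (A : V →L[ℝ] V) := by
  unfold τ; simp [e₁_ne_zero]

/-- the representative at the origin is the pull-back by `A` of the identity-chart representative
[folklore] -/
theorem inChart_origin_eq {F : Type*} [NormedAddCommGroup F] [NormedSpace ℝ F] {k : ℕ}
    (α : MForm 𝓘(ℝ, V) Mc2 F k) (y : V) :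
    α.inChart origin y = (rep α (A y)).compContinuousLinearMap (A : V →L[ℝ] V) := by
  rw [α.inChart_eq_comp_inChart (x₀ := origin) (x₁ := pt1) (y := y) (by simp) (by simp),
    tangentCoordChange_eq, τ_origin_pt1]
  simp [rep, e₁_ne_zero]

/-- `dα` at a point off the origin, in terms of the identity-chart representative [folklore] -/
theorem mextDeriv_of_ne {F : Type*} [NormedAddCommGroup F] [NormedSpace ℝ F] {k : ℕ}
    (α : MForm 𝓘(ℝ, V) Mc2 F k) {z : Mc2} (hz : z.toV ≠ 0) :
    mextDeriv α z = extDeriv (rep α) z.toV := by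
  rw [mextDeriv_eq_extDeriv, inChart_eq_rep α hz, Mc2.extChartAt_apply, if_neg hz]

/-- `dα` at the origin [folklore] -/
theorem mextDeriv_origin {F : Type*} [NormedAddCommGroup F] [NormedSpace ℝ F] {k : ℕ}
    (α : MForm 𝓘(ℝ, V) Mc2 F k) :
    mextDeriv α origin = extDeriv (α.inChart origin) 0 := by
  rw [mextDeriv_eq_extDeriv, Mc2.extChartAt_apply]; simp; rfl

section WithMetric

attribute [local instance] bundle

/-- smoothness of a form gives a `C^∞` identity-chart representative [folklore] -/
theorem contDiff_rep {F : Type*} [NormedAddCommGroup F] [NormedSpace ℝ F] {k : ℕ}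
    {α : MForm 𝓘(ℝ, V) Mc2 F k} (hα : IsSmoothForm α) : ContDiff ℝ ∞ (rep α) := by
  rw [contDiff_iff_contDiffAt]
  intro y
  have h := MForm.SmoothAt.contDiffWithinAt_inChart (x₀ := pt1) (z := (⟨y⟩ : Mc2)) (by simp) (hα ⟨y⟩)
  rw [range_eq_univ, contDiffWithinAt_univ, Mc2.extChartAt_apply, if_neg pt1_ne] at h
  exact h

end WithMetric

/-! ### pointwise tools for type components -/

/-- the type projection at a point depends only on the value at that point [folklore] -/
theorem typeComponent_congr {k : ℕ} {α α' : MForm 𝓘(ℝ, V) Mc2 ℂ k} {x : Mc2} (h : α x = α' x)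
    (p q : ℕ) : (α.typeComponent p q) x = (α'.typeComponent p q) x := by
  unfold MForm.typeComponent MForm.weightComponent
  split_ifs <;> simp [h]

/-- function multiples [folklore] -/
def fsmul {k : ℕ} (f : Mc2 → ℂ) (α : MForm 𝓘(ℝ, V) Mc2 ℂ k) : MForm 𝓘(ℝ, V) Mc2 ℂ k :=
  fun x ↦ f x • α x

/-- Evaluation formula (`fsmul_apply`); pointwise computation in the model. [folklore] -/
@[simp] theorem fsmul_apply {k : ℕ} (f : Mc2 → ℂ) (α : MForm 𝓘(ℝ, V) Mc2 ℂ k) (x : Mc2) :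
    fsmul f α x = f x • α x := rfl

/-- Type of the form in `isOfType_fsmul` (chart-wise types, `IsOfType`). [folklore] -/
theorem isOfType_fsmul {k p q : ℕ} (f : Mc2 → ℂ) {α : MForm 𝓘(ℝ, V) Mc2 ℂ k} (hα : IsOfType p q α) :
    IsOfType p q (fsmul f α) :=
  ⟨hα.1, fun x θ v ↦ by
    simp only [fsmul_apply, ContinuousAlternatingMap.smul_apply, hα.2 x θ v, smul_eq_mul]; ring⟩

/-- Chart-wise `∂̄`/type computation `typeComponent_fsmul_self` on `Mc2`. [folklore] -/
theorem typeComponent_fsmul_self {k p q : ℕ} (f : Mc2 → ℂ) {α : MForm 𝓘(ℝ, V) Mc2 ℂ k}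
    (hα : IsOfType p q α) : (fsmul f α).typeComponent p q = fsmul f α :=
  (isOfType_fsmul f hα).typeComponent_eq_self

/-- Chart-wise `∂̄`/type computation `typeComponent_fsmul_of_ne` on `Mc2`. [folklore] -/
theorem typeComponent_fsmul_of_ne {k p q p' q' : ℕ} (f : Mc2 → ℂ) {α : MForm 𝓘(ℝ, V) Mc2 ℂ k}
    (hα : IsOfType p q α) (hne : p ≠ p' ∨ q ≠ q') : (fsmul f α).typeComponent p' q' = 0 :=
  IsOfType.typeComponent_of_ne_holds (isOfType_fsmul f hα) hne

end OriginSwapAtlas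

namespace OriginSwapAtlas
open Mc2

/-! ### generic: `d` of coefficient-times-constant, smoothness via representatives -/

/-- Derivative computation `extDeriv_smul_const_of_hasFDerivAt` (Mathlib's `fderiv`/`extDeriv`, junk
value `0` where not differentiable). [folklore] -/
theorem extDeriv_smul_const_of_hasFDerivAt {n : ℕ} {f : V → ℂ} {f' : V →L[ℝ] ℂ} {y : V}
    (hf : HasFDerivAt f f' y) (η : V [⋀^Fin n]→L[ℝ] ℂ) :
    extDeriv (fun y ↦ f y • η) y = wedge1 f' η := by
  rw [extDeriv, (hf.smul_const η).fderiv]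
  rfl

/-- Chart-representative computation `rep_congr` for the rigged atlas `{id, A}`. [folklore] -/
theorem rep_congr {F : Type*} [NormedAddCommGroup F] [NormedSpace ℝ F] {k : ℕ}
    {β β' : MForm 𝓘(ℝ, V) Mc2 F k} {y : V} (h : β ⟨y⟩ = β' ⟨y⟩) : rep β y = rep β' y := by
  rw [rep, rep, inChart_eq, inChart_eq, extChartAt_pt1_symm, h]

/-- Chart-representative computation `inChart_origin_congr` for the rigged atlas `{id, A}`. [folklore] -/
theorem inChart_origin_congr {F : Type*} [NormedAddCommGroup F] [NormedSpace ℝ F] {k : ℕ}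
    {β β' : MForm 𝓘(ℝ, V) Mc2 F k} {y : V} (h : β ⟨A y⟩ = β' ⟨A y⟩) :
    β.inChart origin y = β'.inChart origin y := by
  rw [inChart_eq, inChart_eq, extChartAt_origin_symm, h]

/-- Chart-representative computation `rep_fsmul_constForm_of_ne` for the rigged atlas `{id, A}`.
[folklore] -/
theorem rep_fsmul_constForm_of_ne {k : ℕ} (f : Mc2 → ℂ) (η : V [⋀^Fin k]→L[ℝ] ℂ) {y : V}
    (hy : y ≠ 0) : rep (fsmul f (constForm η)) y = f ⟨y⟩ • η := by
  ext v
  rw [rep, inChart_apply', extChartAt_pt1_symm]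
  change f ⟨y⟩ • η (fun i ↦ τ pt1 ⟨y⟩ (v i)) = _
  rw [τ_pt1_of_ne (z := ⟨y⟩) hy]
  rfl

/-- Chart-representative computation `rep_zero_of_eq` for the rigged atlas `{id, A}`. [folklore] -/
theorem rep_zero_of_eq {F : Type*} [NormedAddCommGroup F] [NormedSpace ℝ F] {k : ℕ}
    {β : MForm 𝓘(ℝ, V) Mc2 F k} (h : β origin = 0) : rep β 0 = 0 := by
  ext v
  rw [rep, inChart_apply', extChartAt_pt1_symm, show (⟨0⟩ : Mc2) = origin from rfl, h]
  rfl

/-- Chart-representative computation `inChart_origin_fsmul_constForm_of_ne` for the rigged atlas `{id,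
A}`. [folklore] -/
theorem inChart_origin_fsmul_constForm_of_ne {k : ℕ} (f : Mc2 → ℂ) (η : V [⋀^Fin k]→L[ℝ] ℂ)
    {y : V} (hy : y ≠ 0) :
    (fsmul f (constForm η)).inChart origin y = f ⟨A y⟩ • η.compContinuousLinearMap (A : V →L[ℝ] V) := by
  rw [inChart_origin_eq, rep_fsmul_constForm_of_ne f η (fun h ↦ hy (A.map_eq_zero_iff.1 h))]
  ext v
  simp

section WithMetric

attribute [local instance] bundle

/-- a form with a `C^∞` identity-chart representative is smooth [folklore] -/
theorem isSmoothForm_of_contDiff_rep {F : Type*} [NormedAddCommGroup F] [NormedSpace ℝ F] {k : ℕ}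
    {α : MForm 𝓘(ℝ, V) Mc2 F k} (h : ContDiff ℝ ∞ (rep α)) : IsSmoothForm α := by
  intro x
  rw [range_eq_univ, contDiffWithinAt_univ, Mc2.extChartAt_apply]
  by_cases hx : x.toV = 0
  · rw [if_pos hx, hx, _root_.map_zero]
    have hx' : x = origin := Mc2.ext hx
    subst hx'
    rw [show (MForm.inChart α origin) = fun y ↦ (rep α (A y)).compContinuousLinearMap (A : V →L[ℝ] V)
      from funext (inChart_origin_eq α)]
    exact ContDiffAt.continuousAlternatingMapCompContinuousLinearMap
      ((h.comp A.contDiff).contDiffAt) contDiffAt_const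
  · rw [if_neg hx, inChart_eq_rep α hx]
    exact h.contDiffAt

/-- weights of identity-chart values of a typed form, off the origin [folklore] -/
theorem hasWeight_rep {k p q : ℕ} {β : MForm 𝓘(ℝ, V) Mc2 ℂ k} (hβ : IsOfType p q β) {y : V}
    (hy : y ≠ 0) : HasWeight ((p : ℤ) - q) (rep β y) := by
  intro θ v
  have hτ : ∀ u : V, τT pt1 (⟨y⟩ : Mc2) (rot θ u) =
      tangentRotate V (⟨y⟩ : Mc2) θ (τT pt1 (⟨y⟩ : Mc2) u) := by
    intro u
    change τ pt1 ⟨y⟩ (rot θ u) = rot θ (τ pt1 ⟨y⟩ u)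
    rw [τ_pt1_of_ne (z := ⟨y⟩) hy]
    rfl
  have := hβ.2 ⟨y⟩ θ (fun i ↦ τT pt1 (⟨y⟩ : Mc2) (v i))
  rw [rep, inChart_apply', inChart_apply', extChartAt_pt1_symm]
  simp only [hτ]
  exact this

end WithMetric

/-! ### The form `α = (z̄ + 1) w̄ dz` -/

/-- the coefficient `a = (z̄ + 1) w̄` [folklore] -/
def aV (y : V) : ℂ := (conj y.1 + 1) * conj y.2

/-- `α`, in chart coordinates at every point (it vanishes at the origin) [folklore] -/
def alpha : MForm 𝓘(ℝ, V) Mc2 ℂ 1 := fsmul (fun z ↦ aV z.toV) (constForm dz₀)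

/-- Derivative computation `hasFDerivAt_aV` (Mathlib's `fderiv`/`extDeriv`, junk value `0` where not
differentiable). [folklore] -/
theorem hasFDerivAt_aV (y : V) :
    HasFDerivAt aV ((conj y.1 + 1) • wbL + conj y.2 • zbL) y := by
  have h1 : HasFDerivAt (fun y : V ↦ conj y.1 + 1) zbL y := by
    simpa using (zbL.hasFDerivAt (x := y)).add_const 1
  have h2 : HasFDerivAt (fun y : V ↦ conj y.2) wbL y := wbL.hasFDerivAt
  exact h1.mul h2

/-- Smoothness statement `contDiff_aV`. [folklore] -/
theorem contDiff_aV : ContDiff ℝ ∞ aV := by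
  unfold aV
  apply ContDiff.mul
  · exact (zbL.contDiff).add contDiff_const
  · exact wbL.contDiff

/-- Chart-representative computation `rep_alpha` for the rigged atlas `{id, A}`. [folklore] -/
theorem rep_alpha : rep alpha = fun y ↦ aV y • dz₀ := by
  funext y
  by_cases hy : y = 0
  · subst hy
    have h0 : aV 0 = 0 := by simp [aV]
    rw [alpha, rep_zero_of_eq, h0, czero_smul]
    change aV 0 • dz₀ = 0
    rw [h0, czero_smul]
  · rw [alpha, rep_fsmul_constForm_of_ne _ _ hy]

/-- Smoothness statement `contDiff_rep_alpha`. [folklore] -/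
theorem contDiff_rep_alpha : ContDiff ℝ ∞ (rep alpha) := by
  rw [rep_alpha]; exact contDiff_aV.smul contDiff_const

section WithMetric
attribute [local instance] bundle

/-- Auxiliary lemma `isSmoothForm_alpha` for the `ℂ²` counterexample (see the module docstring).
[folklore] -/
theorem isSmoothForm_alpha : IsSmoothForm alpha := isSmoothForm_of_contDiff_rep contDiff_rep_alpha

/-- Type of the form in `isOfType_alpha` (chart-wise types, `IsOfType`). [folklore] -/
theorem isOfType_alpha : IsOfType 1 0 alpha :=
  isOfType_fsmul _ (isOfType_constForm rfl (by simpa using hasWeight_dz₀))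

end WithMetric

/-- `dα` off the origin: `-w̄ dz∧dz̄ - (z̄+1) dz∧dw̄` [folklore] -/
def f₁ (z : Mc2) : ℂ := -conj z.toV.2
/-- The coefficient `-(z̄ + 1)` of `dz∧dw̄` in `dα` (off the origin). [folklore] -/
def f₂ (z : Mc2) : ℂ := -(conj z.toV.1 + 1)

/-- the comparison form for `dα` off the origin [folklore] -/
def Tα : MForm 𝓘(ℝ, V) Mc2 ℂ 2 := fsmul f₁ (constForm dzdzb) + fsmul f₂ (constForm dzdwb)

/-- Wedge-product identity `wedge1_zbL_dz₀` in the model. [folklore] -/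
theorem wedge1_zbL_dz₀ : wedge1 zbL dz₀ = -dzdzb := by rw [dz₀, wedge1_form1_swap]; rfl
/-- Wedge-product identity `wedge1_wbL_dz₀` in the model. [folklore] -/
theorem wedge1_wbL_dz₀ : wedge1 wbL dz₀ = -dzdwb := by rw [dz₀, wedge1_form1_swap]; rfl
/-- Wedge-product identity `wedge1_wL_dz₀` in the model. [folklore] -/
theorem wedge1_wL_dz₀ : wedge1 wL dz₀ = -dzdw := by rw [dz₀, wedge1_form1_swap]; rfl

/-- Derivative computation `extDeriv_rep_alpha` (Mathlib's `fderiv`/`extDeriv`, junk value `0` where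
not differentiable). [folklore] -/
theorem extDeriv_rep_alpha (y : V) :
    extDeriv (rep alpha) y = (-conj y.2) • dzdzb + (-(conj y.1 + 1)) • dzdwb := by
  rw [rep_alpha, extDeriv_smul_const_of_hasFDerivAt (hasFDerivAt_aV y), wedge1_add_left,
    wedge1_smul_left, wedge1_smul_left, wedge1_wbL_dz₀, wedge1_zbL_dz₀, smul_neg, smul_neg, cneg_smul,
    cneg_smul]
  abel

/-- Derivative computation `mextDeriv_alpha_of_ne` (Mathlib's `fderiv`/`extDeriv`, junk value `0`
where not differentiable). [folklore] -/
theorem mextDeriv_alpha_of_ne {z : Mc2} (hz : z.toV ≠ 0) : mextDeriv alpha z = Tα z := by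
  rw [mextDeriv_of_ne alpha hz, extDeriv_rep_alpha]
  rfl

/-- the representative of `α` at the origin: `(z̄+1) w dz` [folklore] -/
def aA (y : V) : ℂ := (conj y.1 + 1) * y.2

/-- Chart-representative computation `inChart_alpha_origin` for the rigged atlas `{id, A}`. [folklore] -/
theorem inChart_alpha_origin : alpha.inChart origin = fun y ↦ aA y • dz₀ := by
  funext y
  by_cases hy : y = 0
  · subst hy
    have h0 : aA 0 = 0 := by simp [aA]
    rw [h0, czero_smul]
    ext v
    rw [inChart_apply', alpha, fsmul_apply, ContinuousAlternatingMap.smul_apply, extChartAt_origin_symm]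
    simp [aV]
  · rw [alpha, inChart_origin_fsmul_constForm_of_ne _ _ hy]
    have : dz₀.compContinuousLinearMap (A : V →L[ℝ] V) = dz₀ := by ext v; simp [dz₀]
    rw [this]
    simp [aV, aA]

/-- Derivative computation `hasFDerivAt_aA_zero` (Mathlib's `fderiv`/`extDeriv`, junk value `0` where
not differentiable). [folklore] -/
theorem hasFDerivAt_aA_zero : HasFDerivAt aA wL 0 := by
  have h1 : HasFDerivAt (fun y : V ↦ conj y.1 + 1) zbL 0 := by
    simpa using (zbL.hasFDerivAt (x := (0 : V))).add_const 1
  have h2 : HasFDerivAt (fun y : V ↦ y.2) wL 0 := wL.hasFDerivAt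
  have h3 := h1.mul h2
  have hd : ((conj (0 : V).1 + 1) • wL + (0 : V).2 • zbL : V →L[ℝ] ℂ) = wL := by
    simp only [Prod.fst_zero, _root_.map_zero, zero_add, Prod.snd_zero]
    rw [cone_smulL, czero_smulL, add_zero]
  rw [hd] at h3
  exact h3

/-- Derivative computation `mextDeriv_alpha_origin` (Mathlib's `fderiv`/`extDeriv`, junk value `0`
where not differentiable). [folklore] -/
theorem mextDeriv_alpha_origin : mextDeriv alpha origin = constForm (-dzdw) origin := by
  rw [mextDeriv_origin, inChart_alpha_origin, extDeriv_smul_const_of_hasFDerivAt hasFDerivAt_aA_zero,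
    wedge1_wL_dz₀]
  rfl

end OriginSwapAtlas

namespace OriginSwapAtlas
open Mc2

/-- Auxiliary lemma `finrank_V` for the `ℂ²` counterexample (see the module docstring). [folklore] -/
theorem finrank_V : finrank ℂ V = 2 := by
  rw [Module.finrank_prod, Module.finrank_self]

/-- Chart-representative computation `rep_constForm_of_ne` for the rigged atlas `{id, A}`. [folklore] -/
theorem rep_constForm_of_ne {k : ℕ} (η : V [⋀^Fin k]→L[ℝ] ℂ) {y : V} (hy : y ≠ 0) :
    rep (constForm η) y = η := by
  ext v
  rw [rep, inChart_apply', extChartAt_pt1_symm]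
  change η (fun i ↦ τ pt1 ⟨y⟩ (v i)) = η v
  rw [τ_pt1_of_ne (z := ⟨y⟩) hy]
  rfl

/-- Chart-representative computation `rep_add` for the rigged atlas `{id, A}`. [folklore] -/
theorem rep_add {F : Type*} [NormedAddCommGroup F] [NormedSpace ℝ F] {k : ℕ}
    (β β' : MForm 𝓘(ℝ, V) Mc2 F k) (y : V) : rep (β + β') y = rep β y + rep β' y := by
  rw [rep, MForm.inChart_add]; rfl

section WithMetric
attribute [local instance] bundle

/-- `Sc` preserves weights (from `IsOfType.cHodgeStar`) [folklore] -/
theorem hasWeight_Sc {k m p q p' q' : ℕ} (h : k + m = 4) {η : V [⋀^Fin k]→L[ℝ] ℂ} (hpq : p + q = k)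
    (hη : HasWeight ((p : ℤ) - q) η) (hpq' : p' + q' = m) (hw : (p' : ℤ) - q' = (p : ℤ) - q) :
    HasWeight ((p' : ℤ) - q') (Sc k h η) := by
  have hT : IsOfType p' q' (MForm.cHodgeStar orient h (constForm η)) :=
    (isOfType_constForm hpq hη).cHodgeStar orient inner_tangentJ_tangentJ h hpq' hw
  have := hasWeight_rep hT e₁_ne_zero
  rwa [rep, inChart_cHodgeStar, sgn_pt1, one_smul, ← rep, rep_constForm_of_ne η e₁_ne_zero] at this

/-! ### `Δ_∂̄ α = 0`, first term: `∂̄* α = 0` -/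

/-- Chart-wise `∂̄`/type computation `dolbeaultBarAdjoint_alpha` on `Mc2`. [folklore] -/
theorem dolbeaultBarAdjoint_alpha (h : (0 + 1) + 3 = 4) : dolbeaultBarAdjoint orient h alpha = 0 := by
  have hT : IsOfType 2 1 (MForm.cHodgeStar orient h alpha) :=
    isOfType_alpha.cHodgeStar orient inner_tangentJ_tangentJ h rfl (by norm_num)
  rw [dolbeaultBarAdjoint, IsOfType.dolbeault_eq_holds hT,
    typeComponent_eq_zero_of_finrank_lt_or_lt orient inner_tangentJ_tangentJ
      (show 4 + 0 = 4 by norm_num) (Or.inl (by rw [finrank_V]; norm_num)), _root_.map_zero, neg_zero]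

/-! ### second term: `∂̄*∂̄ α = 0` -/

/-- Chart-wise `∂̄`/type computation `typeComponent_Tα` on `Mc2`. [folklore] -/
theorem typeComponent_Tα : Tα.typeComponent 1 1 = Tα := by
  rw [Tα, MForm.typeComponent_add,
    typeComponent_fsmul_self f₁ (isOfType_constForm rfl (by simpa using hasWeight_dzdzb)),
    typeComponent_fsmul_self f₂ (isOfType_constForm rfl (by simpa using hasWeight_dzdwb))]

/-- Chart-wise `∂̄`/type computation `dolbeaultBar_alpha_eq` on `Mc2`. [folklore] -/
theorem dolbeaultBar_alpha_eq : dolbeaultBar alpha = (mextDeriv alpha).typeComponent 1 1 :=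
  IsOfType.dolbeaultBar_eq_holds isOfType_alpha

/-- Chart-wise `∂̄`/type computation `dolbeaultBar_alpha_of_ne` on `Mc2`. [folklore] -/
theorem dolbeaultBar_alpha_of_ne {z : Mc2} (hz : z.toV ≠ 0) : dolbeaultBar alpha z = Tα z := by
  rw [dolbeaultBar_alpha_eq, typeComponent_congr (mextDeriv_alpha_of_ne hz) 1 1, typeComponent_Tα]

/-- Chart-wise `∂̄`/type computation `dolbeaultBar_alpha_of_eq` on `Mc2`. [folklore] -/
theorem dolbeaultBar_alpha_of_eq {z : Mc2} (hz : z.toV = 0) : dolbeaultBar alpha z = 0 := by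
  obtain rfl : z = origin := Mc2.ext hz
  rw [dolbeaultBar_alpha_eq, typeComponent_congr mextDeriv_alpha_origin 1 1,
    IsOfType.typeComponent_of_ne_holds (p := 2) (q := 0)
      (isOfType_constForm rfl (by simpa using (hasWeight_dzdw).neg)) (Or.inl (by norm_num))]
  rfl

/-- Chart-representative computation `rep_dolbeaultBar_alpha_of_ne` for the rigged atlas `{id, A}`.
[folklore] -/
theorem rep_dolbeaultBar_alpha_of_ne {y : V} (hy : y ≠ 0) :
    rep (dolbeaultBar alpha) y = f₁ ⟨y⟩ • dzdzb + f₂ ⟨y⟩ • dzdwb := by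
  rw [rep_congr (dolbeaultBar_alpha_of_ne (z := ⟨y⟩) hy), Tα, rep_add, rep_fsmul_constForm_of_ne _ _ hy,
    rep_fsmul_constForm_of_ne _ _ hy]

/-- Chart-representative computation `rep_dolbeaultBar_alpha_zero` for the rigged atlas `{id, A}`.
[folklore] -/
theorem rep_dolbeaultBar_alpha_zero : rep (dolbeaultBar alpha) 0 = 0 :=
  rep_zero_of_eq (dolbeaultBar_alpha_of_eq rfl)

end WithMetric

end OriginSwapAtlas

namespace OriginSwapAtlas
open Mc2

section WithMetric
attribute [local instance] bundle

/-- degrees for the star on `2`-forms [folklore] -/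
theorem h22 : 2 + 2 = 4 := rfl

/-- `ρ := ⋆∂̄α` [folklore] -/
def rhoF : MForm 𝓘(ℝ, V) Mc2 ℂ 2 := MForm.cHodgeStar orient h22 (dolbeaultBar alpha)

/-- Type of the form in `isOfType_rhoF` (chart-wise types, `IsOfType`). [folklore] -/
theorem isOfType_rhoF : IsOfType 1 1 rhoF := by
  have hτ : IsOfType 1 1 (dolbeaultBar alpha) := by
    rw [dolbeaultBar_alpha_eq]; exact isOfType_typeComponent_holds rfl _
  exact hτ.cHodgeStar orient inner_tangentJ_tangentJ h22 rfl rfl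

/-- the constants `S₁ = Sc (dz∧dz̄)`, `S₂ = Sc (dz∧dw̄)`, of weight `0` [folklore] -/
def S₁ : V [⋀^Fin 2]→L[ℝ] ℂ := Sc 2 h22 dzdzb
/-- The constant `2`-covector `Sc (dz∧dw̄)` (of weight `0`). [folklore] -/
def S₂ : V [⋀^Fin 2]→L[ℝ] ℂ := Sc 2 h22 dzdwb

/-- Weight of the covector or operator in `hasWeight_S₁` under the rotations `e^{iθ}` (Voisin (2002),
§2.3.1). [folklore] -/
theorem hasWeight_S₁ : HasWeight 0 S₁ := by
  unfold S₁
  simpa using hasWeight_Sc (p := 1) (q := 1) (p' := 1) (q' := 1) h22 rfl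
    (by simpa using hasWeight_dzdzb) rfl rfl
/-- Weight of the covector or operator in `hasWeight_S₂` under the rotations `e^{iθ}` (Voisin (2002),
§2.3.1). [folklore] -/
theorem hasWeight_S₂ : HasWeight 0 S₂ := by
  unfold S₂
  simpa using hasWeight_Sc (p := 1) (q := 1) (p' := 1) (q' := 1) h22 rfl
    (by simpa using hasWeight_dzdwb) rfl rfl

/-- the smooth function agreeing with `rep ρ` off `0` [folklore] -/
def R₁ (y : V) : V [⋀^Fin 2]→L[ℝ] ℂ := f₁ ⟨y⟩ • S₁ + f₂ ⟨y⟩ • S₂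

/-- Chart-representative computation `rep_rhoF_of_ne` for the rigged atlas `{id, A}`. [folklore] -/
theorem rep_rhoF_of_ne {y : V} (hy : y ≠ 0) : rep rhoF y = R₁ y := by
  rw [rep, rhoF, inChart_cHodgeStar, sgn_pt1, one_smul, ← rep, rep_dolbeaultBar_alpha_of_ne hy, Sc_add,
    Sc_smul, Sc_smul]
  rfl

/-- Chart-representative computation `rep_rhoF_zero` for the rigged atlas `{id, A}`. [folklore] -/
theorem rep_rhoF_zero : rep rhoF 0 = 0 := by
  rw [rep, rhoF, inChart_cHodgeStar, sgn_pt1, one_smul, ← rep, rep_dolbeaultBar_alpha_zero, Sc_zero]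

/-- Derivative computation `hasFDerivAt_f₁` (Mathlib's `fderiv`/`extDeriv`, junk value `0` where not
differentiable). [folklore] -/
theorem hasFDerivAt_f₁ (y : V) : HasFDerivAt (fun y : V ↦ f₁ ⟨y⟩) (-wbL) y := by
  have : (fun y : V ↦ f₁ ⟨y⟩) = fun y ↦ -(wbL y) := rfl
  rw [this]; exact wbL.hasFDerivAt.neg

/-- Derivative computation `hasFDerivAt_f₂` (Mathlib's `fderiv`/`extDeriv`, junk value `0` where not
differentiable). [folklore] -/
theorem hasFDerivAt_f₂ (y : V) : HasFDerivAt (fun y : V ↦ f₂ ⟨y⟩) (-zbL) y := by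
  have : (fun y : V ↦ f₂ ⟨y⟩) = fun y ↦ -(zbL y + 1) := rfl
  rw [this]; exact ((zbL.hasFDerivAt (x := y)).add_const 1).neg

/-- Smoothness statement `contDiff_f₁`. [folklore] -/
theorem contDiff_f₁ : ContDiff ℝ ∞ (fun y : V ↦ f₁ ⟨y⟩) := by
  have : (fun y : V ↦ f₁ ⟨y⟩) = fun y ↦ -(wbL y) := rfl
  rw [this]; exact wbL.contDiff.neg

/-- Smoothness statement `contDiff_f₂`. [folklore] -/
theorem contDiff_f₂ : ContDiff ℝ ∞ (fun y : V ↦ f₂ ⟨y⟩) := by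
  have : (fun y : V ↦ f₂ ⟨y⟩) = fun y ↦ -(zbL y + 1) := rfl
  rw [this]; exact (zbL.contDiff.add contDiff_const).neg

/-- the constant `3`-covector `dR₁ = -dw̄ ∧ S₁ - dz̄ ∧ S₂`, of weight `-1` [folklore] -/
def C₃ : V [⋀^Fin 3]→L[ℝ] ℂ := wedge1 (-wbL) S₁ + wedge1 (-zbL) S₂

/-- Weight of the covector or operator in `hasWeight_C₃` under the rotations `e^{iθ}` (Voisin (2002),
§2.3.1). [folklore] -/
theorem hasWeight_C₃ : HasWeight (-1) C₃ := by
  unfold C₃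
  refine HasWeight.add ?_ ?_
  · have := HasWeight.wedge1 (a := -1) (ℓ := -wbL) (fun θ v ↦ by
      simp only [_root_.neg_apply, wbL_rot]; ring) hasWeight_S₁
    simpa using this
  · have := HasWeight.wedge1 (a := -1) (ℓ := -zbL) (fun θ v ↦ by
      simp only [_root_.neg_apply, zbL_rot]; ring) hasWeight_S₂
    simpa using this

/-- Derivative computation `extDeriv_R₁` (Mathlib's `fderiv`/`extDeriv`, junk value `0` where not
differentiable). [folklore] -/
theorem extDeriv_R₁ (y : V) : extDeriv R₁ y = C₃ := by
  have h1 : DifferentiableAt ℝ (fun y : V ↦ f₁ ⟨y⟩ • S₁) y :=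
    ((hasFDerivAt_f₁ y).smul_const S₁).differentiableAt
  have h2 : DifferentiableAt ℝ (fun y : V ↦ f₂ ⟨y⟩ • S₂) y :=
    ((hasFDerivAt_f₂ y).smul_const S₂).differentiableAt
  rw [show R₁ = (fun y : V ↦ f₁ ⟨y⟩ • S₁) + fun y : V ↦ f₂ ⟨y⟩ • S₂ from rfl, extDeriv_add h1 h2,
    extDeriv_smul_const_of_hasFDerivAt (hasFDerivAt_f₁ y),
    extDeriv_smul_const_of_hasFDerivAt (hasFDerivAt_f₂ y)]
  rfl

/-- `dρ` off the origin is the constant `C₃` [folklore] -/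
theorem mextDeriv_rhoF_of_ne {z : Mc2} (hz : z.toV ≠ 0) : mextDeriv rhoF z = constForm C₃ z := by
  rw [mextDeriv_of_ne rhoF hz]
  have hev : rep rhoF =ᶠ[𝓝 z.toV] R₁ := by
    filter_upwards [isOpen_compl_singleton.mem_nhds (by simpa using hz)] with y hy
    exact rep_rhoF_of_ne hy
  rw [hev.extDeriv_eq, extDeriv_R₁]
  rfl

/-- values of `∂̄α` vanish at every point with zero coordinates [folklore] -/
theorem dolbeaultBar_alpha_eq_zero_of {z : Mc2} (hz : z.toV = 0) : dolbeaultBar alpha z = 0 :=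
  dolbeaultBar_alpha_of_eq hz

/-- the representative of `∂̄α` at the origin [folklore] -/
theorem inChart_dolbeaultBar_alpha_origin_of_ne {y : V} (hy : y ≠ 0) :
    (dolbeaultBar alpha).inChart origin y =
      f₁ ⟨A y⟩ • dzdzb + f₂ ⟨A y⟩ • dzdw := by
  have hAy : A y ≠ 0 := fun h ↦ hy (A.map_eq_zero_iff.1 h)
  rw [inChart_origin_congr (dolbeaultBar_alpha_of_ne (z := ⟨A y⟩) hAy), Tα, MForm.inChart_add,
    Pi.add_apply, inChart_origin_fsmul_constForm_of_ne _ _ hy,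
    inChart_origin_fsmul_constForm_of_ne _ _ hy]
  have h1 : dzdzb.compContinuousLinearMap (A : V →L[ℝ] V) = dzdzb := by
    ext v; simp [dzdzb, dzb₀, wedge1_form1_apply]
  have h2 : dzdwb.compContinuousLinearMap (A : V →L[ℝ] V) = dzdw := by
    ext v; simp [dzdwb, dzdw, dwb₀, dw₀, wedge1_form1_apply]
  rw [h1, h2]

/-- Chart-representative computation `inChart_dolbeaultBar_alpha_origin_zero` for the rigged atlas
`{id, A}`. [folklore] -/
theorem inChart_dolbeaultBar_alpha_origin_zero : (dolbeaultBar alpha).inChart origin 0 = 0 := by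
  ext v
  rw [inChart_apply', dolbeaultBar_alpha_eq_zero_of (by simp)]
  rfl

/-- the smooth function agreeing with the representative of `ρ` at the origin off `0` [folklore] -/
def R₀ (y : V) : V [⋀^Fin 2]→L[ℝ] ℂ := -(f₁ ⟨A y⟩ • S₁ + f₂ ⟨A y⟩ • Sc 2 h22 dzdw)

/-- Chart-representative computation `inChart_rhoF_origin_of_ne` for the rigged atlas `{id, A}`.
[folklore] -/
theorem inChart_rhoF_origin_of_ne {y : V} (hy : y ≠ 0) : rhoF.inChart origin y = R₀ y := by
  rw [rhoF, inChart_cHodgeStar, inChart_dolbeaultBar_alpha_origin_of_ne hy, Sc_add, Sc_smul, Sc_smul]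
  simp only [sgn, origin_toV, if_true, R₀, S₁, A_apply]
  exact neg_one_smul ℝ _

/-- Chart-representative computation `inChart_rhoF_origin_zero` for the rigged atlas `{id, A}`.
[folklore] -/
theorem inChart_rhoF_origin_zero : rhoF.inChart origin 0 = 0 := by
  rw [rhoF, inChart_cHodgeStar, inChart_dolbeaultBar_alpha_origin_zero, Sc_zero]
  exact smul_zero _

/-- Smoothness statement `contDiff_R₀`. [folklore] -/
theorem contDiff_R₀ : ContDiff ℝ ∞ R₀ := by
  unfold R₀
  refine ContDiff.neg (ContDiff.add ?_ ?_)
  · exact (contDiff_f₁.comp A.contDiff).smul contDiff_const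
  · exact (contDiff_f₂.comp A.contDiff).smul contDiff_const

/-- Auxiliary lemma `dzdw_ne_zero` for the `ℂ²` counterexample (see the module docstring). [folklore] -/
theorem dzdw_ne_zero : dzdw ≠ 0 := by
  intro h
  have := congrArg (fun f : V [⋀^Fin 2]→L[ℝ] ℂ ↦ f ![e₁, e₃]) h
  simp [dzdw, dw₀, wedge1_form1_apply] at this

/-- Model Hodge-star computation `Sc_injective`. [folklore] -/
theorem Sc_injective {k m : ℕ} (h : k + m = 4) (h' : m + k = 4) {η : V [⋀^Fin k]→L[ℝ] ℂ}
    (hη : Sc k h η = 0) : η = 0 := by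
  have key : Sc m h' (Sc k h η) = ((-1 : ℝ) ^ (k * m) : ℝ) • η := by
    rw [Sc, show reP (Sc k h η) = S k h (reP η) from by ext; simp [Sc_apply],
      show imP (Sc k h η) = S k h (imP η) from by ext; simp [Sc_apply], S_S, S_S]
    ext v
    simp
    apply Complex.ext <;> simp <;> ring
  rw [hη, Sc_zero] at key
  have hc : ((-1 : ℝ) ^ (k * m) : ℝ) ≠ 0 := pow_ne_zero _ (neg_ne_zero.2 one_ne_zero)
  exact (smul_eq_zero.1 key.symm).resolve_left hc

/-- Auxiliary lemma `R₀_zero_ne` for the `ℂ²` counterexample (see the module docstring). [folklore] -/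
theorem R₀_zero_ne : R₀ 0 ≠ 0 := by
  intro h
  have h0 : R₀ 0 = Sc 2 h22 dzdw := by
    simp only [R₀, _root_.map_zero, f₁, f₂]
    simp only [Prod.snd_zero, Prod.fst_zero, _root_.map_zero, neg_zero, zero_add]
    rw [czero_smul, zero_add, cneg_smul, cone_smul, neg_neg]
  rw [h0] at h
  exact dzdw_ne_zero (Sc_injective h22 h22 h)

/-- **`dρ` at the origin is the junk value `0`** (the representative jumps there) [folklore] -/
theorem mextDeriv_rhoF_origin : mextDeriv rhoF origin = 0 := by
  apply mextDeriv_apply_eq_zero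
  rw [range_eq_univ, fderivWithin_univ, Mc2.extChartAt_apply]
  simp only [origin_toV, if_true, _root_.map_zero]
  apply fderiv_zero_of_not_differentiableAt
  intro hd
  refine not_continuousAt_of_eq_off_zero contDiff_R₀.continuous.continuousAt
    (fun y hy ↦ inChart_rhoF_origin_of_ne hy) ?_ hd.continuousAt
  rw [inChart_rhoF_origin_zero]
  exact R₀_zero_ne.symm

/-- `∂ρ = 0` [folklore] -/
theorem dolbeault_rhoF : dolbeault rhoF = 0 := by
  rw [IsOfType.dolbeault_eq_holds isOfType_rhoF]
  funext z
  by_cases hz : z.toV = 0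
  · obtain rfl : z = origin := Mc2.ext hz
    rw [typeComponent_congr (α' := 0) mextDeriv_rhoF_origin 2 1,
      Literature.Geometry.Kaehler.MForm.typeComponent_zero]
  · rw [typeComponent_congr (mextDeriv_rhoF_of_ne hz) 2 1,
      IsOfType.typeComponent_of_ne_holds (p := 1) (q := 2)
        (isOfType_constForm rfl (by simpa using hasWeight_C₃)) (Or.inl (by norm_num))]

/-- the second term vanishes: `∂̄*(∂̄α) = 0` [folklore] -/
theorem dolbeaultBarAdjoint_dolbeaultBar_alpha (h : (0 + 1 + 1) + 2 = 4) :
    dolbeaultBarAdjoint orient h (dolbeaultBar alpha) = 0 := by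
  rw [dolbeaultBarAdjoint, show MForm.cHodgeStar orient h (dolbeaultBar alpha) = rhoF from rfl, dolbeault_rhoF,
    _root_.map_zero, neg_zero]

/-- **`Δ_∂̄ α = 0`.** [folklore] -/
theorem dolbeaultLaplacian_alpha (h : 1 + 3 = 4) : dolbeaultLaplacian orient 1 3 h alpha = 0 := by
  change dolbeaultBar (dolbeaultBarAdjoint orient (m := 2 + 1) h alpha) +
    dolbeaultBarAdjoint orient (m := 2) (show (0 + 1 + 1) + 2 = 4 by norm_num) (dolbeaultBar alpha) = 0
  rw [dolbeaultBarAdjoint_alpha, dolbeaultBar_zero, dolbeaultBarAdjoint_dolbeaultBar_alpha, add_zero]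

/-- **`α` is `∂̄`-harmonic of type `(1,0)`.** [folklore] -/
theorem isDolbeaultHarmonic_alpha (h : 1 + 3 = 4) : IsDolbeaultHarmonic orient 1 0 h alpha :=
  ⟨isSmoothForm_alpha, isOfType_alpha, dolbeaultLaplacian_alpha h⟩

end WithMetric

end OriginSwapAtlas

namespace OriginSwapAtlas
open Mc2

/-! ### more V-world tools -/

/-- the representative at the origin, at the centre, is the value [folklore] -/
theorem inChart_origin_zero {F : Type*} [NormedAddCommGroup F] [NormedSpace ℝ F] {k : ℕ}
    (γ : MForm 𝓘(ℝ, V) Mc2 F k) : γ.inChart origin 0 = γ origin := by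
  have key : ∀ (z : Mc2), z = origin → ∀ (w : Fin k → V),
      γ z (fun i ↦ τT origin z (w i)) = γ origin w := by
    rintro z rfl w
    change γ origin (fun i ↦ τ origin origin (w i)) = γ origin w
    have : τ origin origin = ContinuousLinearMap.id ℝ V := by unfold τ; simp
    rw [this]
    rfl
  ext w
  rw [inChart_apply']
  exact key _ (Mc2.ext (by simp)) w

/-- Model Hodge-star computation `Sc_Sc`. [folklore] -/
theorem Sc_Sc {k m : ℕ} (h : k + m = 4) (h' : m + k = 4) (η : V [⋀^Fin k]→L[ℝ] ℂ) :
    Sc m h' (Sc k h η) = ((-1 : ℝ) ^ (k * m) : ℝ) • η := by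
  rw [Sc, show reP (Sc k h η) = S k h (reP η) from by ext; simp [Sc_apply],
    show imP (Sc k h η) = S k h (imP η) from by ext; simp [Sc_apply], S_S, S_S]
  ext v
  simp
  apply Complex.ext <;> simp <;> ring

/-- Model Hodge-star computation `Sc_Sc'`. [folklore] -/
theorem Sc_Sc' {k m : ℕ} (h : k + m = 4) (h' : m + k = 4) (η : V [⋀^Fin k]→L[ℝ] ℂ) :
    Sc m h' (Sc k h η) = (((-1 : ℝ) ^ (k * m) : ℝ) : ℂ) • η := by
  rw [Sc_Sc]; ext v; simp

section WithMetric
attribute [local instance] bundle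

/-- **`Sc` anti-commutes with the pull-back by the orientation-reversing chart map `A`.** [folklore] -/
theorem Sc_comp_A {k m : ℕ} (h : k + m = 4) (η : V [⋀^Fin k]→L[ℝ] ℂ) :
    Sc k h (η.compContinuousLinearMap (A : V →L[ℝ] V)) =
      -(Sc k h η).compContinuousLinearMap (A : V →L[ℝ] V) := by
  have h1 := inChart_cHodgeStar h (constForm η) origin e₁
  rw [inChart_origin_eq, inChart_origin_eq, rep, inChart_cHodgeStar, sgn_pt1, one_smul, ← rep,
    rep_constForm_of_ne η (by simp [e₁] : A e₁ ≠ 0)] at h1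
  simp only [sgn, origin_toV, if_true] at h1
  have h2 : (Sc k h η).compContinuousLinearMap (A : V →L[ℝ] V) =
      -Sc k h (η.compContinuousLinearMap (A : V →L[ℝ] V)) := by
    rw [h1]; exact neg_one_smul ℝ (Sc k h (η.compContinuousLinearMap (A : V →L[ℝ] V)))
  rw [h2, neg_neg]

end WithMetric

/-- `Sc` of a top-degree covector [folklore] -/
theorem Sc_top (h : 4 + 0 = 4) (X : V [⋀^Fin 4]→L[ℝ] ℂ) :
    Sc 4 h X = X fr • ContinuousAlternatingMap.constOfIsEmpty ℝ V (Fin 0) (1 : ℂ) := by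
  conv_lhs => rw [top_eq_smul_det4c X]
  rw [Sc_smul, Sc_det4c]

/-- Auxiliary lemma `top_comp_A_fr` for the `ℂ²` counterexample (see the module docstring). [folklore] -/
theorem top_comp_A_fr (X : V [⋀^Fin 4]→L[ℝ] ℂ) :
    X.compContinuousLinearMap (A : V →L[ℝ] V) fr = -X fr := by
  conv_lhs => rw [top_eq_smul_det4c X]
  rw [ContinuousAlternatingMap.compContinuousLinearMap_apply, ContinuousAlternatingMap.smul_apply,
    det4c_apply]
  change X fr • ((det4 fun i ↦ A (fr i) : ℝ) : ℂ) = _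
  rw [det4_comp_A, det4_fr]
  simp

/-! ### `2`-covectors: bilinear expansion, weight `-2` -/

/-- partial evaluation of a `2`-covector as a functional [folklore] -/
def slot2 (η : V [⋀^Fin 2]→L[ℝ] ℂ) (a : V) : V →L[ℝ] ℂ :=
  (ofSubsingleton ℝ V ℂ (0 : Fin 1)).symm (η.curryLeft a)

/-- Evaluation formula (`slot2_apply`); pointwise computation in the model. [folklore] -/
theorem slot2_apply (η : V [⋀^Fin 2]→L[ℝ] ℂ) (a b : V) : slot2 η a b = η ![a, b] := by
  rw [slot2, ofSubsingleton_symm_apply', ContinuousAlternatingMap.curryLeft_apply_apply]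

/-- Auxiliary lemma `eval₂_swap` for the `ℂ²` counterexample (see the module docstring). [folklore] -/
theorem eval₂_swap (η : V [⋀^Fin 2]→L[ℝ] ℂ) (a b : V) : η ![a, b] = -η ![b, a] := by
  have := η.map_swap ![b, a] (i := 0) (j := 1) (by decide)
  have hsw : (![b, a] : Fin 2 → V) ∘ ⇑(Equiv.swap (0 : Fin 2) 1) = ![a, b] := by
    funext i; fin_cases i <;> rfl
  rw [hsw] at this
  exact this

/-- bilinear expansion in the second slot [folklore] -/
theorem eval₂_expand_right (η : V [⋀^Fin 2]→L[ℝ] ℂ) (a b : V) :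
    η ![a, b] = (b.1.re : ℂ) * η ![a, e₁] + (b.1.im : ℂ) * η ![a, e₂] + (b.2.re : ℂ) * η ![a, e₃] +
      (b.2.im : ℂ) * η ![a, e₄] := by
  simp only [← slot2_apply]
  exact clm_apply_decomp (slot2 η a) b

/-- a `2`-covector vanishing on all pairs of frame vectors vanishes [folklore] -/
theorem eq_zero_of_forall_fr (η : V [⋀^Fin 2]→L[ℝ] ℂ) (h : ∀ i j : Fin 4, η ![fr i, fr j] = 0) : η = 0 := by
  have h' : ∀ (j : Fin 4) (a : V), η ![fr j, a] = 0 := by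
    intro j a
    rw [eval₂_expand_right, show (e₁ : V) = fr 0 from rfl, show (e₂ : V) = fr 1 from rfl,
      show (e₃ : V) = fr 2 from rfl, show (e₄ : V) = fr 3 from rfl, h, h, h, h]
    simp
  ext v
  have hv : v = ![v 0, v 1] := by funext i; fin_cases i <;> rfl
  rw [hv, eval₂_expand_right, eval₂_swap η (v 0) e₁, eval₂_swap η (v 0) e₂, eval₂_swap η (v 0) e₃,
    eval₂_swap η (v 0) e₄, show (e₁ : V) = fr 0 from rfl, show (e₂ : V) = fr 1 from rfl,
    show (e₃ : V) = fr 2 from rfl, show (e₄ : V) = fr 3 from rfl, h', h', h', h']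
  simp

/-- Auxiliary lemma `rot_e₁` for the `ℂ²` counterexample (see the module docstring). [folklore] -/
theorem rot_e₁ (θ : ℝ) : rot θ e₁ = (Real.cos θ : ℂ) • e₁ + (Real.sin θ : ℂ) • e₂ := by
  rw [rot_apply, Complex.exp_mul_I, ← Complex.ofReal_cos, ← Complex.ofReal_sin]
  ext <;> apply Complex.ext <;> simp [e₁, e₂]

/-- Auxiliary lemma `rot_e₃` for the `ℂ²` counterexample (see the module docstring). [folklore] -/
theorem rot_e₃ (θ : ℝ) : rot θ e₃ = (Real.cos θ : ℂ) • e₃ + (Real.sin θ : ℂ) • e₄ := by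
  rw [rot_apply, Complex.exp_mul_I, ← Complex.ofReal_cos, ← Complex.ofReal_sin]
  ext <;> apply Complex.ext <;> simp [e₃, e₄]

/-- Auxiliary lemma `rot_e₄` for the `ℂ²` counterexample (see the module docstring). [folklore] -/
theorem rot_e₄ (θ : ℝ) : rot θ e₄ = (Real.cos θ : ℂ) • e₄ - (Real.sin θ : ℂ) • e₃ := by
  rw [rot_apply, Complex.exp_mul_I, ← Complex.ofReal_cos, ← Complex.ofReal_sin]
  ext <;> apply Complex.ext <;> simp [e₃, e₄]

end OriginSwapAtlas

namespace OriginSwapAtlas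
open Mc2

/-! ### weight `-2` two-covectors are multiples of `dz̄ ∧ dw̄` -/

/-- Auxiliary lemma `I_smul_e₁` for the `ℂ²` counterexample (see the module docstring). [folklore] -/
theorem I_smul_e₁ : (Complex.I • e₁ : V) = e₂ := e₂_eq
/-- Auxiliary lemma `I_smul_e₂` for the `ℂ²` counterexample (see the module docstring). [folklore] -/
theorem I_smul_e₂ : (Complex.I • e₂ : V) = -e₁ := by ext <;> simp [e₁, e₂]
/-- Auxiliary lemma `I_smul_e₃` for the `ℂ²` counterexample (see the module docstring). [folklore] -/
theorem I_smul_e₃ : (Complex.I • e₃ : V) = e₄ := e₄_eq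
/-- Auxiliary lemma `I_smul_e₄` for the `ℂ²` counterexample (see the module docstring). [folklore] -/
theorem I_smul_e₄ : (Complex.I • e₄ : V) = -e₃ := by ext <;> simp [e₃, e₄]

/-- Auxiliary lemma `exp_neg_two_pi_div_two` for the `ℂ²` counterexample (see the module docstring).
[folklore] -/
theorem exp_neg_two_pi_div_two :
    Complex.exp (((-2 : ℤ) : ℂ) * ((Real.pi / 2 : ℝ) : ℂ) * Complex.I) = -1 := by
  have : (((-2 : ℤ) : ℂ) * ((Real.pi / 2 : ℝ) : ℂ) * Complex.I) = ((-Real.pi : ℝ) : ℂ) * Complex.I := by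
    push_cast; ring
  rw [this, Complex.exp_mul_I, ← Complex.ofReal_cos, ← Complex.ofReal_sin, Real.cos_neg, Real.sin_neg,
    Real.cos_pi, Real.sin_pi]
  simp

/-- Auxiliary lemma `exp_neg_two_pi_div_four` for the `ℂ²` counterexample (see the module docstring).
[folklore] -/
theorem exp_neg_two_pi_div_four :
    Complex.exp (((-2 : ℤ) : ℂ) * ((Real.pi / 4 : ℝ) : ℂ) * Complex.I) = -Complex.I := by
  have : (((-2 : ℤ) : ℂ) * ((Real.pi / 4 : ℝ) : ℂ) * Complex.I) = ((-(Real.pi / 2) : ℝ) : ℂ) * Complex.I := by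
    push_cast; ring
  rw [this, Complex.exp_mul_I, ← Complex.ofReal_cos, ← Complex.ofReal_sin, Real.cos_neg, Real.sin_neg,
    Real.cos_pi_div_two, Real.sin_pi_div_two]
  simp

/-- linearity in the first slot, via antisymmetry [folklore] -/
theorem eval₂_add_left (η : V [⋀^Fin 2]→L[ℝ] ℂ) (a a' b : V) : η ![a + a', b] = η ![a, b] + η ![a', b] := by
  rw [eval₂_swap η (a + a'), eval₂_swap η a, eval₂_swap η a', ← slot2_apply, ← slot2_apply, ← slot2_apply,
    map_add, neg_add]

/-- Auxiliary lemma `eval₂_smul_left` for the `ℂ²` counterexample (see the module docstring).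
[folklore] -/
theorem eval₂_smul_left (η : V [⋀^Fin 2]→L[ℝ] ℂ) (r : ℝ) (a b : V) : η ![r • a, b] = (r : ℂ) * η ![a, b] := by
  rw [eval₂_swap η (r • a), eval₂_swap η a, ← slot2_apply, ← slot2_apply, map_smul, Complex.real_smul,
    mul_neg]

/-- Auxiliary lemma `eval₂_add_right` for the `ℂ²` counterexample (see the module docstring).
[folklore] -/
theorem eval₂_add_right (η : V [⋀^Fin 2]→L[ℝ] ℂ) (a b b' : V) : η ![a, b + b'] = η ![a, b] + η ![a, b'] := by
  rw [← slot2_apply, ← slot2_apply, ← slot2_apply, map_add]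

/-- Auxiliary lemma `eval₂_smul_right` for the `ℂ²` counterexample (see the module docstring).
[folklore] -/
theorem eval₂_smul_right (η : V [⋀^Fin 2]→L[ℝ] ℂ) (r : ℝ) (a b : V) : η ![a, r • b] = (r : ℂ) * η ![a, b] := by
  rw [← slot2_apply, ← slot2_apply, map_smul, Complex.real_smul]

/-- Auxiliary lemma `eval₂_neg_right` for the `ℂ²` counterexample (see the module docstring).
[folklore] -/
theorem eval₂_neg_right (η : V [⋀^Fin 2]→L[ℝ] ℂ) (a b : V) : η ![a, -b] = -η ![a, b] := by
  rw [← slot2_apply, ← slot2_apply, map_neg]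

/-- Auxiliary lemma `eval₂_self` for the `ℂ²` counterexample (see the module docstring). [folklore] -/
theorem eval₂_self (η : V [⋀^Fin 2]→L[ℝ] ℂ) (a : V) : η ![a, a] = 0 := by
  have := eval₂_swap η a a
  linear_combination this / 2

/-- Auxiliary lemma `rot_e₁'` for the `ℂ²` counterexample (see the module docstring). [folklore] -/
theorem rot_e₁' (θ : ℝ) : rot θ e₁ = Real.cos θ • e₁ + Real.sin θ • e₂ := by
  rw [rot_e₁]; ext <;> simp
/-- Auxiliary lemma `rot_e₃'` for the `ℂ²` counterexample (see the module docstring). [folklore] -/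
theorem rot_e₃' (θ : ℝ) : rot θ e₃ = Real.cos θ • e₃ + Real.sin θ • e₄ := by
  rw [rot_e₃]; ext <;> simp

/-- Auxiliary lemma `dzbdwb_e₁_e₃` for the `ℂ²` counterexample (see the module docstring). [folklore] -/
@[simp] theorem dzbdwb_e₁_e₃ : dzbdwb ![e₁, e₃] = 1 := by
  simp [dzbdwb, dwb₀, wedge1_form1_apply]

/-- **A `2`-covector of weight `-2` is a multiple of `dz̄ ∧ dw̄`.** [folklore] -/
theorem eq_of_hasWeight_neg_two {η : V [⋀^Fin 2]→L[ℝ] ℂ} (h : HasWeight (-2) η) :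
    η = (η ![e₁, e₃]) • dzbdwb := by
  rw [← sub_eq_zero]
  set ζ := η - (η ![e₁, e₃]) • dzbdwb with hζ
  have hw : HasWeight (-2) ζ := h.sub (hasWeight_dzbdwb.smul _)
  have h13 : ζ ![e₁, e₃] = 0 := by
    simp only [hζ, ContinuousAlternatingMap.sub_apply, ContinuousAlternatingMap.smul_apply, dzbdwb_e₁_e₃,
      smul_eq_mul, mul_one, sub_self]
  -- the rotation by `π/2` is multiplication by `i`
  have hI : ∀ a b : V, ζ ![Complex.I • a, Complex.I • b] = -ζ ![a, b] := by
    intro a b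
    have hv : (fun i ↦ rot (Real.pi / 2) ((![a, b] : Fin 2 → V) i)) = ![Complex.I • a, Complex.I • b] := by
      funext i; fin_cases i <;> simp
    have := hw (Real.pi / 2) ![a, b]
    rw [exp_neg_two_pi_div_two, hv] at this
    rw [this]; ring
  have h12 : ζ ![e₁, e₂] = 0 := by
    have := hI e₁ e₂
    rw [I_smul_e₁, I_smul_e₂, eval₂_neg_right, eval₂_swap ζ e₂ e₁, neg_neg] at this
    linear_combination this / 2
  have h34 : ζ ![e₃, e₄] = 0 := by
    have := hI e₃ e₄
    rw [I_smul_e₃, I_smul_e₄, eval₂_neg_right, eval₂_swap ζ e₄ e₃, neg_neg] at this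
    linear_combination this / 2
  have h24 : ζ ![e₂, e₄] = 0 := by
    have := hI e₁ e₃
    rw [I_smul_e₁, I_smul_e₃, h13, neg_zero] at this
    exact this
  have h23' : ζ ![e₂, e₃] = ζ ![e₁, e₄] := by
    have := hI e₁ e₄
    rw [I_smul_e₁, I_smul_e₄, eval₂_neg_right] at this
    linear_combination -this
  have h14 : ζ ![e₁, e₄] = 0 := by
    have := hw (Real.pi / 4) ![e₁, e₃]
    rw [exp_neg_two_pi_div_four, h13, mul_zero] at this
    have hv : (fun i ↦ rot (Real.pi / 4) ((![e₁, e₃] : Fin 2 → V) i)) =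
        ![Real.cos (Real.pi / 4) • e₁ + Real.sin (Real.pi / 4) • e₂,
          Real.cos (Real.pi / 4) • e₃ + Real.sin (Real.pi / 4) • e₄] := by
      funext i; fin_cases i
      · exact rot_e₁' _
      · exact rot_e₃' _
    rw [hv, eval₂_add_left, eval₂_smul_left, eval₂_smul_left, eval₂_add_right, eval₂_add_right,
      eval₂_smul_right, eval₂_smul_right, eval₂_smul_right, eval₂_smul_right, h13, h24, h23',
      Real.cos_pi_div_four, Real.sin_pi_div_four] at this
    have hs : ((Real.sqrt 2 / 2 : ℝ) : ℂ) * ((Real.sqrt 2 / 2 : ℝ) : ℂ) = 2⁻¹ := by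
      rw [← Complex.ofReal_mul]
      rw [show (Real.sqrt 2 / 2 * (Real.sqrt 2 / 2) : ℝ) = (Real.sqrt 2 * Real.sqrt 2) / 4 by ring,
        Real.mul_self_sqrt (by norm_num : (0 : ℝ) ≤ 2)]
      norm_num
    have : (2 : ℂ) * (((Real.sqrt 2 / 2 : ℝ) : ℂ) * (((Real.sqrt 2 / 2 : ℝ) : ℂ))) * ζ ![e₁, e₄] = 0 := by
      linear_combination this
    rw [hs] at this
    simpa using this
  have h23 : ζ ![e₂, e₃] = 0 := by rw [h23', h14]
  apply eq_zero_of_forall_fr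
  intro i j
  fin_cases i <;> fin_cases j <;>
    simp [fr, eval₂_self, h12, h13, h14, h23, h24, h34, eval₂_swap ζ e₂ e₁, eval₂_swap ζ e₃ e₁,
      eval₂_swap ζ e₄ e₁, eval₂_swap ζ e₃ e₂, eval₂_swap ζ e₄ e₂, eval₂_swap ζ e₄ e₃]

end OriginSwapAtlas

namespace OriginSwapAtlas
open Mc2

/-! ### the star of the basic `1`-forms, on frame triples -/

/-- Auxiliary lemma `h13` for the `ℂ²` counterexample (see the module docstring). [folklore] -/
theorem h13 : 1 + 3 = 4 := rfl
/-- Auxiliary lemma `h31` for the `ℂ²` counterexample (see the module docstring). [folklore] -/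
theorem h31 : 3 + 1 = 4 := rfl
/-- Auxiliary lemma `h40` for the `ℂ²` counterexample (see the module docstring). [folklore] -/
theorem h40 : 4 + 0 = 4 := rfl

/-- The constant `3`-covector `T₁ = Sc dz̄` (`= ι_{e₁} det4 - i ι_{e₂} det4`). [folklore] -/
def T₁ : V [⋀^Fin 3]→L[ℝ] ℂ := Sc 1 h13 dzb₀
/-- The constant `3`-covector `T₂ = Sc dw̄`. [folklore] -/
def T₂ : V [⋀^Fin 3]→L[ℝ] ℂ := Sc 1 h13 dwb₀
/-- The constant `3`-covector `T₂' = Sc dw` (the `A`-pull-back picture of `T₂`). [folklore] -/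
def T₂' : V [⋀^Fin 3]→L[ℝ] ℂ := Sc 1 h13 dw₀

/-- Evaluation formula (`T₁_apply`); pointwise computation in the model. [folklore] -/
theorem T₁_apply (w : Fin 3 → V) :
    T₁ w = (det4 (Fin.cons e₁ w) : ℂ) - Complex.I * (det4 (Fin.cons e₂ w) : ℂ) := by
  rw [T₁, dzb₀, Sc_form1_apply, sharp_re_zbL, sharp_im_zbL, det4_cons_neg]
  push_cast; ring

/-- Evaluation formula (`T₂_apply`); pointwise computation in the model. [folklore] -/
theorem T₂_apply (w : Fin 3 → V) :
    T₂ w = (det4 (Fin.cons e₃ w) : ℂ) - Complex.I * (det4 (Fin.cons e₄ w) : ℂ) := by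
  rw [T₂, dwb₀, Sc_form1_apply, sharp_re_wbL, sharp_im_wbL, det4_cons_neg]
  push_cast; ring

/-- Evaluation formula (`T₂'_apply`); pointwise computation in the model. [folklore] -/
theorem T₂'_apply (w : Fin 3 → V) :
    T₂' w = (det4 (Fin.cons e₃ w) : ℂ) + Complex.I * (det4 (Fin.cons e₄ w) : ℂ) := by
  rw [T₂', dw₀, Sc_form1_apply, sharp_re_wL, sharp_im_wL]

/-- numerics of `det4` on frame tuples [folklore] -/
theorem det4_cons_apply (a : V) (w : Fin 3 → V) :
    det4 (Fin.cons a w) = a.1.re * e234 ![w 0, w 1, w 2] - (w 0).1.re * e234 ![a, w 1, w 2]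
      + (w 1).1.re * e234 ![a, w 0, w 2] - (w 2).1.re * e234 ![a, w 0, w 1] := by
  rw [det4_apply]
  simp only [Fin.cons_zero, Fin.cons_succ, show (1 : Fin 4) = Fin.succ 0 from rfl,
    show (2 : Fin 4) = Fin.succ 1 from rfl, show (3 : Fin 4) = Fin.succ 2 from rfl]

/-- Wedge-product identity `wedge1_T₁_fr` in the model. [folklore] -/
theorem wedge1_T₁_fr (ℓ : V →L[ℝ] ℂ) : wedge1 ℓ T₁ fr = ℓ e₁ - Complex.I * ℓ e₂ := by
  simp only [wedge1_three_apply, fr, Matrix.cons_val_zero, Matrix.cons_val_one, Matrix.cons_val, T₁_apply,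
    det4_cons_apply, e234_apply]
  simp
  ring

/-- Wedge-product identity `wedge1_T₂_fr` in the model. [folklore] -/
theorem wedge1_T₂_fr (ℓ : V →L[ℝ] ℂ) : wedge1 ℓ T₂ fr = ℓ e₃ - Complex.I * ℓ e₄ := by
  simp only [wedge1_three_apply, fr, Matrix.cons_val_zero, Matrix.cons_val_one, Matrix.cons_val, T₂_apply,
    det4_cons_apply, e234_apply]
  simp
  ring

/-- Wedge-product identity `wedge1_T₂'_fr` in the model. [folklore] -/
theorem wedge1_T₂'_fr (ℓ : V →L[ℝ] ℂ) : wedge1 ℓ T₂' fr = ℓ e₃ + Complex.I * ℓ e₄ := by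
  simp only [wedge1_three_apply, fr, Matrix.cons_val_zero, Matrix.cons_val_one, Matrix.cons_val, T₂'_apply,
    det4_cons_apply, e234_apply]
  simp
  ring

/-- pull-backs of the basic `1`-forms by `A` [folklore] -/
theorem dzb₀_comp_A : dzb₀.compContinuousLinearMap (A : V →L[ℝ] V) = dzb₀ := by ext v; simp [dzb₀]
/-- Auxiliary lemma `dwb₀_comp_A` for the `ℂ²` counterexample (see the module docstring). [folklore] -/
theorem dwb₀_comp_A : dwb₀.compContinuousLinearMap (A : V →L[ℝ] V) = dw₀ := by ext v; simp [dwb₀, dw₀]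
/-- Auxiliary lemma `dzbdwb_comp_A` for the `ℂ²` counterexample (see the module docstring). [folklore] -/
theorem dzbdwb_comp_A : dzbdwb.compContinuousLinearMap (A : V →L[ℝ] V) = dzbdw := by
  ext v; simp [dzbdwb, dzbdw, dwb₀, dw₀, wedge1_form1_apply]

/-! ### `3`-form identities for the second term -/

/-- `dw̄ ∧ (dz̄ ∧ dw)` [folklore] -/
def E4' : V [⋀^Fin 3]→L[ℝ] ℂ := wedge1 wbL dzbdw

/-- Wedge-product identity `wedge1_zbL_dzbdw` in the model. [folklore] -/
theorem wedge1_zbL_dzbdw : wedge1 zbL dzbdw = 0 := by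
  ext v; simp only [wedge1_two_apply, dzbdw, dw₀, wedge1_form1_apply]; change _ = (0 : ℂ); simp; ring
/-- Wedge-product identity `wedge1_wL_dzbdw` in the model. [folklore] -/
theorem wedge1_wL_dzbdw : wedge1 wL dzbdw = 0 := by
  ext v; simp only [wedge1_two_apply, dzbdw, dw₀, wedge1_form1_apply]; change _ = (0 : ℂ); simp; ring

/-- Weight of the covector or operator in `hasWeight_E4'` under the rotations `e^{iθ}` (Voisin (2002),
§2.3.1). [folklore] -/
theorem hasWeight_E4' : HasWeight (-1) E4' := by
  unfold E4'; have := HasWeight.wedge1 wbL_rot hasWeight_dzbdw; norm_num at this; exact this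

/-- `E4' = -2 T₁` (`⋆dz̄ = -½ dz̄∧dw∧dw̄`) [folklore] -/
theorem E4'_eq : E4' = (-2 : ℂ) • T₁ := by
  ext v
  rw [ContinuousAlternatingMap.smul_apply, T₁_apply, det4_cons_apply, det4_cons_apply]
  simp only [E4', wedge1_two_apply, dzbdw, dw₀, wedge1_form1_apply, e234_apply, wbL_apply, zbL_apply,
    wL_apply, smul_eq_mul]
  simp
  apply Complex.ext
  · simp; ring
  · simp; ring

/-- `Sc E4' = 2 dz̄` [folklore] -/
theorem csmul_zero {n : ℕ} (c : ℂ) : c • (0 : V [⋀^Fin n]→L[ℝ] ℂ) = 0 := by ext v; simp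

/-- Model Hodge-star computation `Sc_E4'`. [folklore] -/
theorem Sc_E4' : Sc 3 h31 E4' = (2 : ℂ) • dzb₀ := by
  rw [E4'_eq, Sc_smul, T₁, Sc_Sc']
  ext v
  simp
  ring

/-- decomposition of `ℓ ∧ (dz̄ ∧ dw)` [folklore] -/
theorem wedge1_dzbdw_decomp (ℓ : V →L[ℝ] ℂ) :
    wedge1 ℓ dzbdw = (2⁻¹ * (ℓ e₁ - Complex.I * ℓ e₂)) • E1₀ + (2⁻¹ * (ℓ e₃ + Complex.I * ℓ e₄)) • E4' := by
  conv_lhs => rw [clm_decomp ℓ]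
  rw [wedge1_add_left, wedge1_add_left, wedge1_add_left, wedge1_smul_left, wedge1_smul_left, wedge1_smul_left,
    wedge1_smul_left, wedge1_zbL_dzbdw, wedge1_wL_dzbdw, csmul_zero, csmul_zero, add_zero, add_zero]
  rfl

/-! ### `0`-forms -/

/-- the complex unit `0`-covector [folklore] -/
def one₀ : V [⋀^Fin 0]→L[ℝ] ℂ := ContinuousAlternatingMap.constOfIsEmpty ℝ V (Fin 0) (1 : ℂ)

/-- Evaluation formula (`one₀_apply`); pointwise computation in the model. [folklore] -/
@[simp] theorem one₀_apply (v : Fin 0 → V) : one₀ v = 1 := rfl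

/-- Wedge-product identity `wedge1_one₀` in the model. [folklore] -/
theorem wedge1_one₀ (ℓ : V →L[ℝ] ℂ) : wedge1 ℓ one₀ = form1 ℓ := by
  ext v
  rw [wedge1_apply, Fin.sum_univ_one, form1_apply]
  simp

section WithMetric
attribute [local instance] bundle

/-- every `0`-form has type `(0,0)` [folklore] -/
theorem isOfType_zero_zero (ψ : MForm 𝓘(ℝ, V) Mc2 ℂ 0) : IsOfType 0 0 ψ :=
  ⟨rfl, fun x θ v ↦ by
    have hv : (fun i ↦ tangentRotate V x θ (v i)) = v := funext fun i ↦ Fin.elim0 i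
    rw [hv]; simp⟩

/-- `∂̄` of a `0`-form [folklore] -/
theorem dolbeaultBar_zero_form (ψ : MForm 𝓘(ℝ, V) Mc2 ℂ 0) :
    dolbeaultBar ψ = (mextDeriv ψ).typeComponent 0 1 := by
  rw [IsOfType.dolbeaultBar_eq_holds (isOfType_zero_zero ψ)]

/-- the `(2,2)`-component of a top form is the form [folklore] -/
theorem typeComponent_two_two (X : MForm 𝓘(ℝ, V) Mc2 ℂ 4) : X.typeComponent 2 2 = X := by
  have hsum := sum_antidiagonal_typeComponent_holds (E := V) (M := Mc2) (k := 4) X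
  rw [Finset.sum_eq_single (2, 2)] at hsum
  · exact hsum
  · rintro ⟨p, q⟩ hpq hne
    rw [Finset.mem_antidiagonal] at hpq
    apply typeComponent_eq_zero_of_finrank_lt_or_lt orient inner_tangentJ_tangentJ h40
    rw [finrank_V]
    simp only [ne_eq, Prod.mk.injEq, not_and_or] at hne
    omega
  · intro h; exact absurd (Finset.mem_antidiagonal.2 (show 2 + 2 = 4 from rfl)) h

end WithMetric

end OriginSwapAtlas

namespace OriginSwapAtlas
open Mc2

/-! ## The general `∂̄`-harmonic `(0,1)`-form: the functional `L` -/

section GeneralBeta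

/-- coefficient functions of the identity-chart representative [folklore] -/
def cF (β : MForm 𝓘(ℝ, V) Mc2 ℂ 1) (y : V) : ℂ := rep β y ![e₁]
/-- The coefficient `e` of `dw̄` in the identity-chart representative of a `(0,1)`-form (`rep_eq`).
[folklore] -/
def eF (β : MForm 𝓘(ℝ, V) Mc2 ℂ 1) (y : V) : ℂ := rep β y ![e₃]

/-- evaluation at a fixed tuple is a continuous linear map [folklore] -/
def evL {k : ℕ} (v : Fin k → V) : (V [⋀^Fin k]→L[ℝ] ℂ) →L[ℝ] ℂ :=
  ContinuousAlternatingMap.apply ℝ V ℂ v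

/-- Evaluation formula (`evL_apply`); pointwise computation in the model. [folklore] -/
@[simp] theorem evL_apply {k : ℕ} (v : Fin k → V) (η : V [⋀^Fin k]→L[ℝ] ℂ) : evL v η = η v := rfl

/-- Property `cF_eq` of the coefficient functions / the test functional `L`. [folklore] -/
theorem cF_eq (β : MForm 𝓘(ℝ, V) Mc2 ℂ 1) : cF β = evL ![e₁] ∘ rep β := rfl
/-- Property `eF_eq` of the coefficient functions / the test functional `L`. [folklore] -/
theorem eF_eq (β : MForm 𝓘(ℝ, V) Mc2 ℂ 1) : eF β = evL ![e₃] ∘ rep β := rfl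

section WithMetric
attribute [local instance] bundle

variable {β : MForm 𝓘(ℝ, V) Mc2 ℂ 1}

/-- Smoothness statement `contDiff_cF`. [folklore] -/
theorem contDiff_cF (hs : IsSmoothForm β) : ContDiff ℝ ∞ (cF β) := by
  rw [cF_eq]; exact (evL ![e₁]).contDiff.comp (contDiff_rep hs)

/-- Smoothness statement `contDiff_eF`. [folklore] -/
theorem contDiff_eF (hs : IsSmoothForm β) : ContDiff ℝ ∞ (eF β) := by
  rw [eF_eq]; exact (evL ![e₃]).contDiff.comp (contDiff_rep hs)

/-- **The representative of a smooth `(0,1)`-form is `c dz̄ + e dw̄`** (off `0` by the weight, at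
`0` by continuity). [folklore] -/
theorem rep_eq (hs : IsSmoothForm β) (ht : IsOfType 0 1 β) (y : V) :
    rep β y = cF β y • dzb₀ + eF β y • dwb₀ := by
  have hne : ∀ y : V, y ≠ 0 → rep β y = cF β y • dzb₀ + eF β y • dwb₀ := fun y hy ↦
    eq_of_hasWeight_neg_one (by simpa using hasWeight_rep ht hy)
  by_cases hy : y = 0
  · subst hy
    by_contra hne0
    have hc : Continuous fun y ↦ rep β y - (cF β y • dzb₀ + eF β y • dwb₀) :=
      (contDiff_rep hs).continuous.sub
        (((contDiff_cF hs).continuous.smul continuous_const).add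
          ((contDiff_eF hs).continuous.smul continuous_const))
    refine not_continuousAt_of_eq_off_zero (g := fun _ ↦ (0 : V [⋀^Fin 1]→L[ℝ] ℂ)) continuousAt_const
      (fun y hy ↦ by simp only [hne y hy, sub_self]) ?_ hc.continuousAt
    simpa [sub_eq_zero] using hne0
  · exact hne y hy

/-- `σ = ⋆β` [folklore] -/
theorem rep_sigma (hs : IsSmoothForm β) (ht : IsOfType 0 1 β) (y : V) :
    rep (MForm.cHodgeStar orient h13 β) y = cF β y • T₁ + eF β y • T₂ := by
  rw [rep, inChart_cHodgeStar, sgn_pt1, one_smul, ← rep, rep_eq hs ht, Sc_add, Sc_smul, Sc_smul]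
  rfl

/-- Smoothness statement `contDiff_rep_sigma`. [folklore] -/
theorem contDiff_rep_sigma (hs : IsSmoothForm β) (ht : IsOfType 0 1 β) :
    ContDiff ℝ ∞ (rep (MForm.cHodgeStar orient h13 β)) := by
  rw [show rep (MForm.cHodgeStar orient h13 β) = fun y ↦ cF β y • T₁ + eF β y • T₂ from
    funext (rep_sigma hs ht)]
  exact ((contDiff_cF hs).smul contDiff_const).add ((contDiff_eF hs).smul contDiff_const)

/-- Auxiliary lemma `isSmoothForm_sigma` for the `ℂ²` counterexample (see the module docstring).
[folklore] -/
theorem isSmoothForm_sigma (hs : IsSmoothForm β) (ht : IsOfType 0 1 β) :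
    IsSmoothForm (MForm.cHodgeStar orient h13 β) :=
  isSmoothForm_of_contDiff_rep (contDiff_rep_sigma hs ht)

/-- Type of the form in `isOfType_sigma` (chart-wise types, `IsOfType`). [folklore] -/
theorem isOfType_sigma (ht : IsOfType 0 1 β) : IsOfType 1 2 (MForm.cHodgeStar orient h13 β) :=
  ht.cHodgeStar orient inner_tangentJ_tangentJ h13 rfl (by norm_num)

/-- `∂σ = dσ` (types) [folklore] -/
theorem dolbeault_sigma (ht : IsOfType 0 1 β) :
    dolbeault (MForm.cHodgeStar orient h13 β) = mextDeriv (MForm.cHodgeStar orient h13 β) := by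
  rw [IsOfType.dolbeault_eq_holds (isOfType_sigma ht), typeComponent_two_two]

/-- `dσ` in the identity chart [folklore] -/
theorem extDeriv_rep_sigma (hs : IsSmoothForm β) (ht : IsOfType 0 1 β) (y : V) :
    extDeriv (rep (MForm.cHodgeStar orient h13 β)) y =
      wedge1 (fderiv ℝ (cF β) y) T₁ + wedge1 (fderiv ℝ (eF β) y) T₂ := by
  have hc := ((contDiff_cF hs).differentiable (by simp)).differentiableAt (x := y)
  have he := ((contDiff_eF hs).differentiable (by simp)).differentiableAt (x := y)
  rw [show rep (MForm.cHodgeStar orient h13 β) = (fun y ↦ cF β y • T₁) + fun y ↦ eF β y • T₂ from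
    funext (rep_sigma hs ht), extDeriv_add (hc.hasFDerivAt.smul_const T₁).differentiableAt
      (he.hasFDerivAt.smul_const T₂).differentiableAt,
    extDeriv_smul_const_of_hasFDerivAt hc.hasFDerivAt, extDeriv_smul_const_of_hasFDerivAt he.hasFDerivAt]

/-- `dσ` represented: `rep (dσ) = d (rep σ)` [folklore] -/
theorem rep_mextDeriv_sigma (hs : IsSmoothForm β) (ht : IsOfType 0 1 β) (y : V) :
    rep (mextDeriv (MForm.cHodgeStar orient h13 β)) y =
      wedge1 (fderiv ℝ (cF β) y) T₁ + wedge1 (fderiv ℝ (eF β) y) T₂ := by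
  rw [rep, inChart_mextDeriv_of_mem_target _ (by simp) (isSmoothForm_sigma hs ht _), range_eq_univ,
    extDerivWithin_univ, ← rep, extDeriv_rep_sigma hs ht]

/-- the function `2Φ = (c_x - i c_y) + (e_u - i e_v)` [folklore] -/
def Φ₂ (β : MForm 𝓘(ℝ, V) Mc2 ℂ 1) (y : V) : ℂ :=
  fderiv ℝ (cF β) y e₁ - Complex.I * fderiv ℝ (cF β) y e₂ +
    (fderiv ℝ (eF β) y e₃ - Complex.I * fderiv ℝ (eF β) y e₄)

/-- Chart-representative computation `rep_mextDeriv_sigma_fr` for the rigged atlas `{id, A}`.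
[folklore] -/
theorem rep_mextDeriv_sigma_fr (hs : IsSmoothForm β) (ht : IsOfType 0 1 β) (y : V) :
    rep (mextDeriv (MForm.cHodgeStar orient h13 β)) y fr = Φ₂ β y := by
  rw [rep_mextDeriv_sigma hs ht, ContinuousAlternatingMap.add_apply, wedge1_T₁_fr, wedge1_T₂_fr]
  rfl

/-- `ψ = ∂̄* β` in the chart at the origin: the function `-2Φ ∘ A` [folklore] -/
theorem inChart_psi_origin (hs : IsSmoothForm β) (ht : IsOfType 0 1 β) (y : V) :
    (dolbeaultBarAdjoint orient (show (0 + 1) + 3 = 4 from rfl) β).inChart origin y =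
      (-(Φ₂ β (A y))) • one₀ := by
  rw [dolbeaultBarAdjoint, show MForm.cHodgeStar orient (show (0 + 1) + 3 = 4 from rfl) β =
    MForm.cHodgeStar orient h13 β from rfl, dolbeault_sigma ht]
  rw [show ∀ γ : MForm 𝓘(ℝ, V) Mc2 ℂ 0, (-γ).inChart origin y = -(γ.inChart origin y) from fun γ ↦ by
    rw [← neg_one_smul ℝ γ, MForm.inChart_smul]; simp]
  rw [inChart_cHodgeStar, inChart_origin_eq, Sc_top, top_comp_A_fr, rep_mextDeriv_sigma_fr hs ht]
  simp only [sgn, origin_toV, if_true, one₀]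
  rw [neg_one_smul ℝ (-Φ₂ β (A y) • ContinuousAlternatingMap.constOfIsEmpty ℝ V (Fin 0) (1 : ℂ)), neg_neg]

end WithMetric

end GeneralBeta

end OriginSwapAtlas

namespace OriginSwapAtlas
open Mc2

/-- the representative at the origin, at the centre, of a constant form [folklore] -/
theorem inChart_origin_constForm_zero {k : ℕ} (η : V [⋀^Fin k]→L[ℝ] ℂ) :
    (constForm η).inChart origin 0 = η := by
  ext v
  rw [inChart_apply', constForm_apply]
  have : τ origin ((extChartAt 𝓘(ℝ, V) origin).symm 0) = ContinuousLinearMap.id ℝ V := by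
    unfold τ; rw [if_pos]; simp
  change η (fun i ↦ τ origin _ (v i)) = η v
  rw [this]
  rfl

/-- values at points with zero coordinates transfer to the representative at the origin [folklore] -/
theorem inChart_origin_zero_of_forall {k : ℕ} {γ γ' : MForm 𝓘(ℝ, V) Mc2 ℂ k}
    (h : ∀ z : Mc2, z.toV = 0 → γ z = γ' z) : γ.inChart origin 0 = γ'.inChart origin 0 := by
  rw [inChart_eq, inChart_eq, h _ (by simp)]

/-- Auxiliary lemma `constForm_add` for the `ℂ²` counterexample (see the module docstring). [folklore] -/
theorem constForm_add {k : ℕ} (η η' : V [⋀^Fin k]→L[ℝ] ℂ) :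
    constForm (η + η') = constForm η + constForm η' := rfl

/-- Auxiliary lemma `constForm_smul` for the `ℂ²` counterexample (see the module docstring).
[folklore] -/
theorem constForm_smul {k : ℕ} (c : ℂ) (η : V [⋀^Fin k]→L[ℝ] ℂ) :
    constForm (c • η) = c • constForm η := rfl

section GeneralBeta2

section WithMetric
attribute [local instance] bundle

variable {β : MForm 𝓘(ℝ, V) Mc2 ℂ 1}

/-- Smoothness statement `contDiff_Φ₂`. [folklore] -/
theorem contDiff_Φ₂ (hs : IsSmoothForm β) : ContDiff ℝ ∞ (Φ₂ β) := by
  have hc := (contDiff_infty_iff_fderiv.1 (contDiff_cF (β := β) hs)).2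
  have he := (contDiff_infty_iff_fderiv.1 (contDiff_eF (β := β) hs)).2
  unfold Φ₂
  refine ContDiff.add (ContDiff.sub (hc.clm_apply contDiff_const) ?_)
    (ContDiff.sub (he.clm_apply contDiff_const) ?_)
  · exact contDiff_const.mul (hc.clm_apply contDiff_const)
  · exact contDiff_const.mul (he.clm_apply contDiff_const)

/-- the differential at `0` of `-2Φ ∘ A` [folklore] -/
def ℓ₀ (β : MForm 𝓘(ℝ, V) Mc2 ℂ 1) : V →L[ℝ] ℂ := -((fderiv ℝ (Φ₂ β) 0).comp (A : V →L[ℝ] V))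

/-- Derivative computation `hasFDerivAt_negΦ₂A` (Mathlib's `fderiv`/`extDeriv`, junk value `0` where
not differentiable). [folklore] -/
theorem hasFDerivAt_negΦ₂A (hs : IsSmoothForm β) :
    HasFDerivAt (fun y ↦ -(Φ₂ β (A y))) (ℓ₀ β) 0 := by
  have hd : DifferentiableAt ℝ (Φ₂ β) (A 0) :=
    ((contDiff_Φ₂ hs).differentiable (by simp)).differentiableAt
  have h1 : HasFDerivAt (fun y ↦ Φ₂ β (A y)) ((fderiv ℝ (Φ₂ β) (A 0)).comp (A : V →L[ℝ] V)) 0 :=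
    hd.hasFDerivAt.comp 0 A.hasFDerivAt
  rw [_root_.map_zero] at h1
  exact h1.neg

/-- `dψ` at the origin [folklore] -/
theorem mextDeriv_psi_origin (hs : IsSmoothForm β) (ht : IsOfType 0 1 β) :
    mextDeriv (dolbeaultBarAdjoint orient (show (0 + 1) + 3 = 4 from rfl) β) origin =
      constForm (form1 (ℓ₀ β)) origin := by
  rw [mextDeriv_origin, show (dolbeaultBarAdjoint orient (show (0 + 1) + 3 = 4 from rfl) β).inChart origin =
      fun y ↦ (-(Φ₂ β (A y))) • one₀ from funext (inChart_psi_origin hs ht),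
    extDeriv_smul_const_of_hasFDerivAt (hasFDerivAt_negΦ₂A hs), wedge1_one₀]
  rfl

/-- the comparison form for `dψ (origin)` split into types [folklore] -/
def Γψ (β : MForm 𝓘(ℝ, V) Mc2 ℂ 1) : MForm 𝓘(ℝ, V) Mc2 ℂ 1 :=
  constForm ((2⁻¹ * (ℓ₀ β e₁ - Complex.I * ℓ₀ β e₂)) • dz₀) +
    constForm ((2⁻¹ * (ℓ₀ β e₁ + Complex.I * ℓ₀ β e₂)) • dzb₀) +
    constForm ((2⁻¹ * (ℓ₀ β e₃ - Complex.I * ℓ₀ β e₄)) • dw₀) +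
    constForm ((2⁻¹ * (ℓ₀ β e₃ + Complex.I * ℓ₀ β e₄)) • dwb₀)

/-- Auxiliary lemma `form1_ℓ₀` for the `ℂ²` counterexample (see the module docstring). [folklore] -/
theorem form1_ℓ₀ (β : MForm 𝓘(ℝ, V) Mc2 ℂ 1) : constForm (form1 (ℓ₀ β)) = Γψ β := by
  rw [Γψ, ← constForm_add, ← constForm_add, ← constForm_add]
  congr 1
  conv_lhs => rw [clm_decomp (ℓ₀ β)]
  rw [form1_add, form1_add, form1_add, form1_smul, form1_smul, form1_smul, form1_smul]
  rfl

/-- Chart-wise `∂̄`/type computation `typeComponent_Γψ` on `Mc2`. [folklore] -/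
theorem typeComponent_Γψ (β : MForm 𝓘(ℝ, V) Mc2 ℂ 1) :
    (Γψ β).typeComponent 0 1 =
      constForm ((2⁻¹ * (ℓ₀ β e₁ + Complex.I * ℓ₀ β e₂)) • dzb₀) +
        constForm ((2⁻¹ * (ℓ₀ β e₃ + Complex.I * ℓ₀ β e₄)) • dwb₀) := by
  rw [Γψ, MForm.typeComponent_add, MForm.typeComponent_add, MForm.typeComponent_add,
    IsOfType.typeComponent_of_ne_holds (p := 1) (q := 0)
      (isOfType_constForm rfl (by simpa using hasWeight_dz₀.smul _)) (Or.inl (by norm_num)),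
    (isOfType_constForm (p := 0) (q := 1) rfl (by simpa using hasWeight_dzb₀.smul _)).typeComponent_eq_self,
    IsOfType.typeComponent_of_ne_holds (p := 1) (q := 0)
      (isOfType_constForm rfl (by simpa using hasWeight_dw₀.smul _)) (Or.inl (by norm_num)),
    (isOfType_constForm (p := 0) (q := 1) rfl (by simpa using hasWeight_dwb₀.smul _)).typeComponent_eq_self,
    zero_add, add_zero]

/-- **The first term at the origin**, evaluated on `e₃`: `-½ (Φ'(0) e₃ - i Φ'(0) e₄)`. [folklore] -/
theorem first_term (hs : IsSmoothForm β) (ht : IsOfType 0 1 β) :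
    (dolbeaultBar (dolbeaultBarAdjoint orient (show (0 + 1) + 3 = 4 from rfl) β)).inChart origin 0 ![e₃] =
      -(2⁻¹ * (fderiv ℝ (Φ₂ β) 0 e₃ - Complex.I * fderiv ℝ (Φ₂ β) 0 e₄)) := by
  rw [dolbeaultBar_zero_form]
  have hval : ∀ z : Mc2, z.toV = 0 →
      (mextDeriv (dolbeaultBarAdjoint orient (show (0 + 1) + 3 = 4 from rfl) β)).typeComponent 0 1 z =
        (constForm ((2⁻¹ * (ℓ₀ β e₁ + Complex.I * ℓ₀ β e₂)) • dzb₀) +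
          constForm ((2⁻¹ * (ℓ₀ β e₃ + Complex.I * ℓ₀ β e₄)) • dwb₀)) z := by
    intro z hz
    obtain rfl : z = origin := Mc2.ext hz
    rw [typeComponent_congr (α' := Γψ β) (by rw [mextDeriv_psi_origin hs ht, form1_ℓ₀]) 0 1,
      typeComponent_Γψ]
  rw [inChart_origin_zero_of_forall hval, ← constForm_add, inChart_origin_constForm_zero]
  have hA3 : (A : V →L[ℝ] V) e₃ = e₃ := by ext <;> simp [e₃]
  have hA4 : (A : V →L[ℝ] V) e₄ = -e₄ := by ext <;> simp [e₄]
  have h3 : ℓ₀ β e₃ = -fderiv ℝ (Φ₂ β) 0 e₃ := by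
    simp only [ℓ₀, _root_.neg_apply, ContinuousLinearMap.coe_comp, Function.comp_apply, hA3]
  have h4 : ℓ₀ β e₄ = fderiv ℝ (Φ₂ β) 0 e₄ := by
    simp only [ℓ₀, _root_.neg_apply, ContinuousLinearMap.coe_comp, Function.comp_apply, hA4, map_neg, neg_neg]
  simp only [ContinuousAlternatingMap.add_apply, ContinuousAlternatingMap.smul_apply, dzb₀, dwb₀, form1_apply,
    Matrix.cons_val_zero, zbL_apply, wbL_apply, e₃_fst, e₃_snd, _root_.map_zero, map_one, smul_eq_mul,
    mul_one, h3, h4]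
  ring

end WithMetric

end GeneralBeta2

end OriginSwapAtlas

namespace OriginSwapAtlas
open Mc2

/-! ### the weight projection at the model level -/

/-- the weight-`w` projection of a covector of the model (`= weightComponent` in a chart) [folklore] -/
def tcV (k : ℕ) (w : ℤ) (η : V [⋀^Fin k]→L[ℝ] ℂ) : V [⋀^Fin k]→L[ℝ] ℂ :=
  ((2 * k + 1 : ℕ) : ℂ)⁻¹ • ∑ j : Fin (2 * k + 1),
    Complex.exp (-(w * (2 * Real.pi * j / (2 * k + 1)) : ℝ) * Complex.I) •
      η.compContinuousLinearMap (rot (2 * Real.pi * j / (2 * k + 1)))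

/-- Evaluation formula (`tcV_apply`); pointwise computation in the model. [folklore] -/
theorem tcV_apply (k : ℕ) (w : ℤ) (η : V [⋀^Fin k]→L[ℝ] ℂ) (v : Fin k → V) :
    tcV k w η v = ((2 * k + 1 : ℕ) : ℂ)⁻¹ * ∑ j : Fin (2 * k + 1),
      Complex.exp (-(w * (2 * Real.pi * j / (2 * k + 1)) : ℝ) * Complex.I) *
        η (fun i ↦ rot (2 * Real.pi * j / (2 * k + 1)) (v i)) := by
  simp only [tcV, ContinuousAlternatingMap.smul_apply, ContinuousAlternatingMap.sum_apply,
    ContinuousAlternatingMap.compContinuousLinearMap_apply, smul_eq_mul]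
  rfl

/-- Smoothness statement `contDiff_tcV_comp`. [folklore] -/
theorem contDiff_tcV_comp {k : ℕ} (w : ℤ) {F : V → V [⋀^Fin k]→L[ℝ] ℂ} (hF : ContDiff ℝ ∞ F) :
    ContDiff ℝ ∞ (fun y ↦ tcV k w (F y)) := by
  unfold tcV
  refine ContDiff.const_smul _ (ContDiff.sum fun j _ ↦ ContDiff.const_smul _ ?_)
  rw [contDiff_iff_contDiffAt]
  intro y
  exact ContDiffAt.continuousAlternatingMapCompContinuousLinearMap hF.contDiffAt contDiffAt_const

section WithMetric
attribute [local instance] bundle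

/-- **The identity-chart representative of a type component is the model projection of the
representative** (off the origin). [folklore] -/
theorem rep_typeComponent_of_ne {k p q : ℕ} (γ : MForm 𝓘(ℝ, V) Mc2 ℂ k) (hpq : p + q = k) {y : V}
    (hy : y ≠ 0) : rep (γ.typeComponent p q) y = tcV k ((p : ℤ) - q) (rep γ y) := by
  have hτ : ∀ (θ : ℝ) (u : V), τT pt1 (⟨y⟩ : Mc2) (rot θ u) =
      tangentRotate V (⟨y⟩ : Mc2) θ (τT pt1 (⟨y⟩ : Mc2) u) := by
    intro θ u
    change τ pt1 ⟨y⟩ (rot θ u) = rot θ (τ pt1 ⟨y⟩ u)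
    rw [τ_pt1_of_ne (z := ⟨y⟩) hy]
    rfl
  have hrep : ∀ (δ : MForm 𝓘(ℝ, V) Mc2 ℂ k) (w : Fin k → V),
      rep δ y w = δ ⟨y⟩ (fun i ↦ τT pt1 (⟨y⟩ : Mc2) (w i)) := by
    intro δ w
    rw [rep, inChart_apply', extChartAt_pt1_symm]
  ext v
  rw [tcV_apply, hrep]
  simp only [hrep]
  rw [MForm.typeComponent, if_pos hpq, MForm.weightComponent]
  simp only [ContinuousAlternatingMap.smul_apply, ContinuousAlternatingMap.sum_apply,
    ContinuousAlternatingMap.compContinuousLinearMap_apply, smul_eq_mul, hτ, Function.comp_def]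

end WithMetric

/-! ### The second term vanishes on `e₃` -/

section GeneralBeta3

/-- the `dz̄∧dw̄`-coefficient of `(d (rep β))^{0,2}` [folklore] -/
def rfun (β : MForm 𝓘(ℝ, V) Mc2 ℂ 1) (y : V) : ℂ := tcV 2 (-2) (extDeriv (rep β) y) ![e₁, e₃]

section WithMetric
attribute [local instance] bundle

variable {β : MForm 𝓘(ℝ, V) Mc2 ℂ 1}

set_option synthInstance.maxHeartbeats 200000 in
/-- Smoothness statement `contDiff_extDeriv_rep`. [folklore] -/
theorem contDiff_extDeriv_rep (hs : IsSmoothForm β) : ContDiff ℝ ∞ (extDeriv (rep β)) := by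
  have hd := (contDiff_infty_iff_fderiv.1 (contDiff_rep hs)).2
  exact (ContinuousAlternatingMap.alternatizeUncurryFinCLM ℝ V ℂ (n := 1)).contDiff.comp hd

/-- Smoothness statement `contDiff_rfun`. [folklore] -/
theorem contDiff_rfun (hs : IsSmoothForm β) : ContDiff ℝ ∞ (rfun β) := by
  unfold rfun
  exact (evL ![e₁, e₃]).contDiff.comp (contDiff_tcV_comp (-2) (contDiff_extDeriv_rep hs))

/-- Chart-wise `∂̄`/type computation `dolbeaultBar_beta_eq` on `Mc2`. [folklore] -/
theorem dolbeaultBar_beta_eq (ht : IsOfType 0 1 β) : dolbeaultBar β = (mextDeriv β).typeComponent 0 2 :=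
  IsOfType.dolbeaultBar_eq_holds ht

/-- Type of the form in `isOfType_pi` (chart-wise types, `IsOfType`). [folklore] -/
theorem isOfType_pi (ht : IsOfType 0 1 β) : IsOfType 0 2 (dolbeaultBar β) := by
  rw [dolbeaultBar_beta_eq ht]; exact isOfType_typeComponent_holds rfl _

/-- `∂̄β` in the identity chart: `r · dz̄∧dw̄` [folklore] -/
theorem rep_pi_of_ne (hs : IsSmoothForm β) (ht : IsOfType 0 1 β) {y : V} (hy : y ≠ 0) :
    rep (dolbeaultBar β) y = rfun β y • dzbdwb := by
  have hw : HasWeight (-2) (rep (dolbeaultBar β) y) := by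
    simpa using hasWeight_rep (isOfType_pi ht) hy
  have hval : rep (dolbeaultBar β) y = tcV 2 (-2) (extDeriv (rep β) y) := by
    rw [dolbeaultBar_beta_eq ht, rep_typeComponent_of_ne _ rfl hy, rep,
      inChart_mextDeriv_of_mem_target _ (by simp) (hs _), range_eq_univ, extDerivWithin_univ]
    rfl
  rw [eq_of_hasWeight_neg_two hw, hval]
  rfl

/-- Chart-representative computation `inChart_pi_origin_of_ne` for the rigged atlas `{id, A}`.
[folklore] -/
theorem inChart_pi_origin_of_ne (hs : IsSmoothForm β) (ht : IsOfType 0 1 β) {y : V} (hy : y ≠ 0) :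
    (dolbeaultBar β).inChart origin y = rfun β (A y) • dzbdw := by
  rw [inChart_origin_eq, rep_pi_of_ne hs ht (fun h ↦ hy (A.map_eq_zero_iff.1 h))]
  ext v
  simp only [ContinuousAlternatingMap.compContinuousLinearMap_apply, ContinuousAlternatingMap.smul_apply,
    ← dzbdwb_comp_A]

/-- `ρ = ⋆∂̄β` in the chart at the origin, off `0` [folklore] -/
def Rρ (β : MForm 𝓘(ℝ, V) Mc2 ℂ 1) (y : V) : V [⋀^Fin 2]→L[ℝ] ℂ := (-(rfun β (A y))) • Sc 2 h22 dzbdw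

/-- Chart-representative computation `inChart_rho_origin_of_ne` for the rigged atlas `{id, A}`.
[folklore] -/
theorem inChart_rho_origin_of_ne (hs : IsSmoothForm β) (ht : IsOfType 0 1 β) {y : V} (hy : y ≠ 0) :
    (MForm.cHodgeStar orient h22 (dolbeaultBar β)).inChart origin y = Rρ β y := by
  rw [inChart_cHodgeStar, inChart_pi_origin_of_ne hs ht hy, Sc_smul]
  simp only [sgn, origin_toV, if_true, Rρ]
  rw [neg_one_smul ℝ (rfun β (A y) • Sc 2 h22 dzbdw), cneg_smul]

/-- Smoothness statement `contDiff_Rρ`. [folklore] -/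
theorem contDiff_Rρ (hs : IsSmoothForm β) : ContDiff ℝ ∞ (Rρ β) := by
  unfold Rρ
  exact ((contDiff_rfun hs).comp A.contDiff).neg.smul contDiff_const

/-- the constant `d₀` with `Sc (dz̄∧dw̄) = d₀ dz̄∧dw̄` [folklore] -/
def d₀ : ℂ := Sc 2 h22 dzbdwb ![e₁, e₃]

/-- Model Hodge-star computation `Sc_dzbdwb`. [folklore] -/
theorem Sc_dzbdwb : Sc 2 h22 dzbdwb = d₀ • dzbdwb :=
  eq_of_hasWeight_neg_two (by
    simpa using hasWeight_Sc (p := 0) (q := 2) (p' := 0) (q' := 2) h22 rfl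
      (by simpa using hasWeight_dzbdwb) rfl rfl)

/-- Model Hodge-star computation `Sc_dzbdw`. [folklore] -/
theorem Sc_dzbdw : Sc 2 h22 dzbdw = (-d₀) • dzbdw := by
  rw [← dzbdwb_comp_A, Sc_comp_A, Sc_dzbdwb]
  ext v
  simp only [ContinuousAlternatingMap.neg_apply, ContinuousAlternatingMap.compContinuousLinearMap_apply,
    ContinuousAlternatingMap.smul_apply, smul_eq_mul, neg_mul]

/-- Wedge-product identity `wedge1_smul_right` in the model. [folklore] -/
theorem wedge1_smul_right {n : ℕ} (ℓ : V →L[ℝ] ℂ) (c : ℂ) (η : V [⋀^Fin n]→L[ℝ] ℂ) :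
    wedge1 ℓ (c • η) = c • wedge1 ℓ η := by
  ext v
  simp only [wedge1_apply, ContinuousAlternatingMap.smul_apply, smul_eq_mul, Finset.mul_sum]
  refine Finset.sum_congr rfl fun i _ ↦ ?_
  rw [mul_smul_comm]; ring_nf

/-- **The second term at the origin vanishes on `e₃`.** [folklore] -/
theorem second_term (hs : IsSmoothForm β) (ht : IsOfType 0 1 β) :
    (dolbeaultBarAdjoint orient (show (1 + 1) + 2 = 4 from rfl) (dolbeaultBar β)).inChart origin 0 ![e₃] = 0 := by
  set ρ := MForm.cHodgeStar orient h22 (dolbeaultBar β) with hρ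
  have hρt : IsOfType 0 2 ρ := (isOfType_pi ht).cHodgeStar orient inner_tangentJ_tangentJ h22 rfl rfl
  -- the junk dichotomy for `dρ (origin)`
  have hdich := fderiv_eq_zero_or_eq_of_eq_off_zero (f := ρ.inChart origin) (g := Rρ β)
    (((contDiff_Rρ hs).differentiable (by simp)).differentiableAt) (fun y hy ↦ inChart_rho_origin_of_ne hs ht hy)
  have hd : mextDeriv ρ origin = 0 ∨ ∃ a d : ℂ, mextDeriv ρ origin = constForm (a • E1₀ + d • E4') origin := by
    rcases hdich with h0 | ⟨-, h1⟩
    · left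
      rw [mextDeriv_origin, extDeriv, h0]
      exact _root_.map_zero (ContinuousAlternatingMap.alternatizeUncurryFinCLM ℝ V ℂ (n := 2))
    · right
      have hr : HasFDerivAt (fun y ↦ -(rfun β (A y))) (fderiv ℝ (fun y ↦ -(rfun β (A y))) 0) 0 :=
        ((((contDiff_rfun hs).comp A.contDiff).neg.differentiable (by simp)).differentiableAt).hasFDerivAt
      set ℓ₁ := fderiv ℝ (fun y ↦ -(rfun β (A y))) 0 with hℓ₁
      refine ⟨(-d₀) * (2⁻¹ * (ℓ₁ e₁ - Complex.I * ℓ₁ e₂)), (-d₀) * (2⁻¹ * (ℓ₁ e₃ + Complex.I * ℓ₁ e₄)), ?_⟩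
      rw [mextDeriv_origin, extDeriv, h1, ← extDeriv, show Rρ β = fun y ↦ (-(rfun β (A y))) • Sc 2 h22 dzbdw
        from rfl, extDeriv_smul_const_of_hasFDerivAt hr, Sc_dzbdw, wedge1_smul_right, wedge1_dzbdw_decomp,
        smul_add, smul_smul, smul_smul]
      rfl
  -- `∂ρ (origin)` has no `E4'`-free part surviving the projection to type `(1,2)` except a multiple of `E4'`
  have hval : ∀ z : Mc2, z.toV = 0 → ∃ c : ℂ, dolbeault ρ z = constForm (c • E4') z := by
    intro z hz
    obtain rfl : z = origin := Mc2.ext hz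
    rw [IsOfType.dolbeault_eq_holds hρt]
    rcases hd with h0 | ⟨a, d, h1⟩
    · refine ⟨0, ?_⟩
      rw [typeComponent_congr (α' := 0) h0 1 2, Literature.Geometry.Kaehler.MForm.typeComponent_zero]
      change (0 : V [⋀^Fin 3]→L[ℝ] ℂ) = (0 : ℂ) • E4'
      rw [czero_smul]
    · refine ⟨d, ?_⟩
      rw [typeComponent_congr h1 1 2, constForm_add, constForm_smul, constForm_smul, MForm.typeComponent_add,
        MForm.typeComponent_smul, MForm.typeComponent_smul,
        IsOfType.typeComponent_of_ne_holds (p := 2) (q := 1)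
          (isOfType_constForm rfl (by simpa using hasWeight_E1₀)) (Or.inl (by norm_num)),
        (isOfType_constForm (p := 1) (q := 2) rfl (by simpa using hasWeight_E4')).typeComponent_eq_self,
        smul_zero, zero_add, ← constForm_smul]
  obtain ⟨c, hc⟩ := hval origin rfl
  have hval' : ∀ z : Mc2, z.toV = 0 → dolbeault ρ z = constForm (c • E4') z := by
    intro z hz; obtain rfl : z = origin := Mc2.ext hz; exact hc
  rw [dolbeaultBarAdjoint, ← hρ]
  rw [show ∀ γ : MForm 𝓘(ℝ, V) Mc2 ℂ 1, (-γ).inChart origin 0 = -(γ.inChart origin 0) from fun γ ↦ by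
    rw [← neg_one_smul ℝ γ, MForm.inChart_smul]; simp]
  rw [inChart_cHodgeStar, inChart_origin_zero_of_forall hval', inChart_origin_constForm_zero, Sc_smul, Sc_E4']
  simp [dzb₀]

end WithMetric

end GeneralBeta3

end OriginSwapAtlas

namespace OriginSwapAtlas
open Mc2

/-! ### The functional `L` and its vanishing on `∂̄`-harmonic `(0,1)`-forms -/

/-- **The functional** `L(β) = Φ'(0) e₃ - i Φ'(0) e₄` (`= 4 ∂_w(∂_z c + ∂_w e)(0)`). [folklore] -/
def Lfun (β : MForm 𝓘(ℝ, V) Mc2 ℂ 1) : ℂ := fderiv ℝ (Φ₂ β) 0 e₃ - Complex.I * fderiv ℝ (Φ₂ β) 0 e₄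

section WithMetric
attribute [local instance] bundle

variable {β : MForm 𝓘(ℝ, V) Mc2 ℂ 1}

/-- **`Δ_∂̄ β` at the origin, on `e₃`, is `-½ L(β)`.** [folklore] -/
theorem laplacian_inChart_origin (hs : IsSmoothForm β) (ht : IsOfType 0 1 β) :
    (dolbeaultLaplacian orient 1 3 h13 β).inChart origin 0 ![e₃] = -(2⁻¹ * Lfun β) := by
  change (dolbeaultBar (dolbeaultBarAdjoint orient (m := 2 + 1) (show (0 + 1) + 3 = 4 from rfl) β) +
    dolbeaultBarAdjoint orient (m := 2) (show (0 + 1 + 1) + 2 = 4 by norm_num) (dolbeaultBar β)).inChart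
      origin 0 ![e₃] = _
  rw [MForm.inChart_add, Pi.add_apply, ContinuousAlternatingMap.add_apply, first_term hs ht]
  have h2 := second_term (β := β) hs ht
  rw [h2, add_zero, Lfun]

/-- **`L` vanishes on `∂̄`-harmonic `(0,1)`-forms.** [folklore] -/
theorem Lfun_eq_zero_of_isDolbeaultHarmonic (hβ : IsDolbeaultHarmonic orient 0 1 h13 β) : Lfun β = 0 := by
  have h := laplacian_inChart_origin hβ.1 hβ.2.1
  rw [hβ.2.2, MForm.inChart_zero] at h
  have h' : -((2⁻¹ : ℂ) * Lfun β) = 0 := h.symm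
  rw [neg_eq_zero] at h'
  simpa using h'

/-! ### Linearity of `L` on smooth forms -/

/-- Property `cF_add` of the coefficient functions / the test functional `L`. [folklore] -/
theorem cF_add (β β' : MForm 𝓘(ℝ, V) Mc2 ℂ 1) : cF (β + β') = cF β + cF β' := by
  funext y; simp [cF, rep_add]

/-- Property `eF_add` of the coefficient functions / the test functional `L`. [folklore] -/
theorem eF_add (β β' : MForm 𝓘(ℝ, V) Mc2 ℂ 1) : eF (β + β') = eF β + eF β' := by
  funext y; simp [eF, rep_add]

/-- Property `cF_smul` of the coefficient functions / the test functional `L`. [folklore] -/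
theorem cF_smul (c : ℂ) (β : MForm 𝓘(ℝ, V) Mc2 ℂ 1) : cF (c • β) = fun y ↦ c * cF β y := by
  funext y; simp [cF, rep, MForm.inChart_smul_complex]

/-- Property `eF_smul` of the coefficient functions / the test functional `L`. [folklore] -/
theorem eF_smul (c : ℂ) (β : MForm 𝓘(ℝ, V) Mc2 ℂ 1) : eF (c • β) = fun y ↦ c * eF β y := by
  funext y; simp [eF, rep, MForm.inChart_smul_complex]

/-- Property `Φ₂_add` of the coefficient functions / the test functional `L`. [folklore] -/
theorem Φ₂_add {β β' : MForm 𝓘(ℝ, V) Mc2 ℂ 1} (hs : IsSmoothForm β) (hs' : IsSmoothForm β') :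
    Φ₂ (β + β') = Φ₂ β + Φ₂ β' := by
  funext y
  have hc := ((contDiff_cF hs).differentiable (by simp)).differentiableAt (x := y)
  have hc' := ((contDiff_cF hs').differentiable (by simp)).differentiableAt (x := y)
  have he := ((contDiff_eF hs).differentiable (by simp)).differentiableAt (x := y)
  have he' := ((contDiff_eF hs').differentiable (by simp)).differentiableAt (x := y)
  simp only [Φ₂, cF_add, eF_add, Pi.add_apply, fderiv_add hc hc', fderiv_add he he',
    _root_.add_apply]
  ring

/-- Property `Φ₂_smul` of the coefficient functions / the test functional `L`. [folklore] -/
theorem Φ₂_smul (c : ℂ) {β : MForm 𝓘(ℝ, V) Mc2 ℂ 1} (hs : IsSmoothForm β) : Φ₂ (c • β) = fun y ↦ c * Φ₂ β y := by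
  funext y
  have hc := ((contDiff_cF hs).differentiable (by simp)).differentiableAt (x := y)
  have he := ((contDiff_eF hs).differentiable (by simp)).differentiableAt (x := y)
  simp only [Φ₂, cF_smul, eF_smul, fderiv_const_mul hc, fderiv_const_mul he, _root_.smul_apply,
    smul_eq_mul]
  ring

/-- Property `Lfun_add` of the coefficient functions / the test functional `L`. [folklore] -/
theorem Lfun_add {β β' : MForm 𝓘(ℝ, V) Mc2 ℂ 1} (hs : IsSmoothForm β) (hs' : IsSmoothForm β') :
    Lfun (β + β') = Lfun β + Lfun β' := by
  have h1 := ((contDiff_Φ₂ hs).differentiable (by simp)).differentiableAt (x := (0 : V))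
  have h2 := ((contDiff_Φ₂ hs').differentiable (by simp)).differentiableAt (x := (0 : V))
  simp only [Lfun, Φ₂_add hs hs', fderiv_add h1 h2, _root_.add_apply]
  ring

/-- Property `Lfun_smul` of the coefficient functions / the test functional `L`. [folklore] -/
theorem Lfun_smul (c : ℂ) {β : MForm 𝓘(ℝ, V) Mc2 ℂ 1} (hs : IsSmoothForm β) : Lfun (c • β) = c * Lfun β := by
  have h1 := ((contDiff_Φ₂ hs).differentiable (by simp)).differentiableAt (x := (0 : V))
  simp only [Lfun, Φ₂_smul c hs, fderiv_const_mul h1, _root_.smul_apply, smul_eq_mul]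
  ring

/-- Property `Lfun_zero` of the coefficient functions / the test functional `L`. [folklore] -/
theorem Lfun_zero : Lfun (0 : MForm 𝓘(ℝ, V) Mc2 ℂ 1) = 0 := by
  have h0 : Φ₂ (0 : MForm 𝓘(ℝ, V) Mc2 ℂ 1) = fun _ ↦ 0 := by
    funext y
    have hc : cF (0 : MForm 𝓘(ℝ, V) Mc2 ℂ 1) = fun _ ↦ 0 := by funext y; simp [cF, rep, MForm.inChart_zero]
    have he : eF (0 : MForm 𝓘(ℝ, V) Mc2 ℂ 1) = fun _ ↦ 0 := by funext y; simp [eF, rep, MForm.inChart_zero]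
    simp [Φ₂, hc, he]
  simp [Lfun, h0]

/-- **The test submodule** `T = {β smooth | L β = 0}`. [folklore] -/
def Tsub : Submodule ℂ (MForm 𝓘(ℝ, V) Mc2 ℂ 1) where
  carrier := {β | IsSmoothForm β ∧ Lfun β = 0}
  add_mem' := by
    rintro β β' ⟨hs, hL⟩ ⟨hs', hL'⟩
    exact ⟨hs.add hs', by rw [Lfun_add hs hs', hL, hL', add_zero]⟩
  zero_mem' := ⟨Literature.Geometry.Kaehler.isSmoothForm_zero, Lfun_zero⟩
  smul_mem' := by
    rintro c β ⟨hs, hL⟩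
    exact ⟨hs.smul_complex c, by rw [Lfun_smul c hs, hL, mul_zero]⟩

/-- **`ℋ^{0,1} ≤ T`**: the `ℂ`-span of the `∂̄`-harmonic `(0,1)`-forms lies in the test submodule
(`Submodule.span_le`). [folklore] -/
theorem dolbeaultHarmonicForms_le_Tsub : dolbeaultHarmonicForms orient 0 1 h13 ≤ Tsub :=
  Submodule.span_le.2 fun _ hβ ↦ ⟨hβ.1, Lfun_eq_zero_of_isDolbeaultHarmonic hβ⟩

end WithMetric

/-! ### `L(ᾱ) = 4` -/

/-- `ᾱ = (z + 1) w dz̄` [folklore] -/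
def alphaBar : MForm 𝓘(ℝ, V) Mc2 ℂ 1 := alpha.conj

/-- The coefficient `(z + 1) w` of `ᾱ = (z + 1) w dz̄`. [folklore] -/
def aC (y : V) : ℂ := (y.1 + 1) * y.2

/-- Chart-representative computation `rep_alphaBar` for the rigged atlas `{id, A}`. [folklore] -/
theorem rep_alphaBar : rep alphaBar = fun y ↦ conj (aV y) • dzb₀ := by
  funext y
  rw [alphaBar, rep, MForm.inChart_conj]
  change (Complex.conjCLE : ℂ →L[ℝ] ℂ).compContinuousAlternatingMap (rep alpha y) = _
  rw [rep_alpha]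
  ext v
  simp [dz₀, dzb₀]

/-- Property `cF_alphaBar` of the coefficient functions / the test functional `L`. [folklore] -/
theorem cF_alphaBar : cF alphaBar = aC := by
  funext y
  simp only [cF, rep_alphaBar, ContinuousAlternatingMap.smul_apply, dzb₀, form1_apply, Matrix.cons_val_zero,
    zbL_apply, e₁_fst, map_one, smul_eq_mul, mul_one, aV, aC, map_mul, map_add, Complex.conj_conj]

/-- Property `eF_alphaBar` of the coefficient functions / the test functional `L`. [folklore] -/
theorem eF_alphaBar : eF alphaBar = fun _ ↦ 0 := by
  funext y
  simp only [eF, rep_alphaBar, ContinuousAlternatingMap.smul_apply, dzb₀, form1_apply, Matrix.cons_val_zero,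
    zbL_apply, e₃_fst, _root_.map_zero, smul_eq_mul, mul_zero]

/-- Derivative computation `hasFDerivAt_aC` (Mathlib's `fderiv`/`extDeriv`, junk value `0` where not
differentiable). [folklore] -/
theorem hasFDerivAt_aC (y : V) : HasFDerivAt aC ((y.1 + 1) • wL + y.2 • zL) y := by
  have h1 : HasFDerivAt (fun y : V ↦ y.1 + 1) zL y := by
    simpa using (zL.hasFDerivAt (x := y)).add_const 1
  have h2 : HasFDerivAt (fun y : V ↦ y.2) wL y := wL.hasFDerivAt
  exact h1.mul h2

/-- Property `Φ₂_alphaBar` of the coefficient functions / the test functional `L`. [folklore] -/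
theorem Φ₂_alphaBar : Φ₂ alphaBar = fun y : V ↦ 2 * y.2 := by
  funext y
  simp only [Φ₂, cF_alphaBar, eF_alphaBar, (hasFDerivAt_aC y).fderiv, fderiv_const_apply, _root_.zero_apply,
    _root_.add_apply, _root_.smul_apply, zL_apply, wL_apply, e₁_fst, e₁_snd, e₂_fst,
    e₂_snd, smul_eq_mul, mul_zero, mul_one, zero_add, add_zero, sub_zero]
  ring_nf
  rw [Complex.I_sq]
  ring

/-- **`L(ᾱ) = 4`** for `ᾱ = (z + 1) w dz̄` (`c = (z+1)w`, `e = 0`, `2Φ = 2w`). [folklore] -/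
theorem Lfun_alphaBar : Lfun alphaBar = 4 := by
  have hd : HasFDerivAt (fun y : V ↦ (2 : ℂ) * y.2) ((2 : ℂ) • wL) 0 := by
    simpa using (wL.hasFDerivAt (x := (0 : V))).const_mul (2 : ℂ)
  rw [Lfun, Φ₂_alphaBar, hd.fderiv]
  simp only [_root_.smul_apply, wL_apply, e₃_snd, e₄_snd, smul_eq_mul, mul_one]
  ring_nf
  rw [Complex.I_sq]
  ring

section WithMetric
attribute [local instance] bundle

/-- Auxiliary lemma `isSmoothForm_alphaBar` for the `ℂ²` counterexample (see the module docstring).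
[folklore] -/
theorem isSmoothForm_alphaBar : IsSmoothForm alphaBar := isSmoothForm_conj isSmoothForm_alpha

/-- Auxiliary lemma `alphaBar_not_mem_Tsub` for the `ℂ²` counterexample (see the module docstring).
[folklore] -/
theorem alphaBar_not_mem_Tsub : alphaBar ∉ Tsub := by
  rintro ⟨-, hL⟩
  rw [Lfun_alphaBar] at hL
  norm_num at hL

/-! ### The refutation on `Mc2` -/

/-- **`dolbeaultHarmonicForms_conj` fails for `(Mc2, g, o)`** in degree `k = 1` (`m = 3`, `n = 4`),
types `(p, q) = (1, 0)`: `ᾱ = \overline{(z̄ + 1) w̄ dz}` lies in `\overline{ℋ^{1,0}}` but not in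
`ℋ^{0,1}`, which is contained in the kernel of the linear functional `L`, while `L(ᾱ) = 4`. [folklore] -/
theorem not_dolbeaultHarmonicForms_conj_Mc2 :
    ¬ dolbeaultHarmonicForms_conj (k := 1) (m := 3) metric orient := by
  intro H
  have h := H isKaehler h13 1 0 isSmoothForm_riemannianVolumeForm
  have hmem : alphaBar ∈ (dolbeaultHarmonicForms orient 1 0 h13).map (MForm.conjₛₗ 1) :=
    Submodule.mem_map_of_mem ((isDolbeaultHarmonic_alpha h13).mem_dolbeaultHarmonicForms)
  rw [h] at hmem
  exact alphaBar_not_mem_Tsub (dolbeaultHarmonicForms_le_Tsub hmem)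

end WithMetric

end OriginSwapAtlas

section UniversalClosure

open OriginSwapAtlas

/-- **`dolbeaultHarmonicForms_conj` cannot be discharged as stated**: its universal closure over real
`C^∞` fourfolds charted in `ℂ²` (smooth metric, any orientation family) is false — witness `Mc2`
with the flat metric (`not_dolbeaultHarmonicForms_conj_Mc2`). [folklore] -/
theorem not_forall_dolbeaultHarmonicForms_conj :
    ¬ ∀ (M : Type) [TopologicalSpace M] [ChartedSpace (ℂ × ℂ) M] [IsManifold 𝓘(ℝ, ℂ × ℂ) ∞ M]
        (g : Bundle.ContMDiffRiemannianMetric 𝓘(ℝ, ℂ × ℂ) ∞ (ℂ × ℂ) (fun x : M ↦ TangentSpace 𝓘(ℝ, ℂ × ℂ) x))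
        (o : (x : M) → Orientation ℝ (TangentSpace 𝓘(ℝ, ℂ × ℂ) x) (Fin 4)),
        Literature.NumberTheory.Transcendental.dolbeaultHarmonicForms_conj (k := 1) (m := 3) g o :=
  fun H ↦ not_dolbeaultHarmonicForms_conj_Mc2 (H Mc2 metric orient)

/-- **The named fact `dolbeaultHarmonicForms_conj` is false as stated**: closed universally over exactly
the binders it elaborates with, it fails (witness `E = ℂ × ℂ`, `M = Mc2`, `k = 1`, `m = 3`, the flat
metric and the chart-wise orientation). [folklore] -/
theorem not_dolbeaultHarmonicForms_conj :
    ¬ ∀ {E : Type} [NormedAddCommGroup E] [NormedSpace ℂ E] {M : Type} [TopologicalSpace M]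
        [ChartedSpace E M] {k m : ℕ} [FiniteDimensional ℂ E] {n : ℕ} [Fact (finrank ℝ E = n)]
        [IsManifold 𝓘(ℝ, E) ∞ M]
        (g : Bundle.ContMDiffRiemannianMetric 𝓘(ℝ, E) ∞ E (fun x : M ↦ TangentSpace 𝓘(ℝ, E) x))
        (o : (x : M) → Orientation ℝ (TangentSpace 𝓘(ℝ, E) x) (Fin n)),
        Literature.NumberTheory.Transcendental.dolbeaultHarmonicForms_conj (k := k) (m := m) g o :=
  fun H ↦ not_dolbeaultHarmonicForms_conj_Mc2 (@H (ℂ × ℂ) _ _ Mc2 _ _ 1 3 _ 4 fact_finrank _ metric orient)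

end UniversalClosure

end Literature.NumberTheory.Transcendental
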